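import Mathlib
import Literature.Barriers.PneNP.CorrelationPolytopeXCLowerBoundGraph
import Literature.Barriers.PneNP.ExtendedFormulationMinkowskiFaces
import Literature.Barriers.PneNP.ExtendedFormulationLinearImage
import Summits.ValiantsHypothesis.ValiantsHypothesis.Theses.FifoMatching
import Summits.ValiantsHypothesis.ValiantsHypothesis.Theorems.FifoMatchingXcMinkowskiMultiplesHard
import Summits.ValiantsHypothesis.ValiantsHypothesis.Theorems.FifoMatchingXcDivisionZmixFace
import Summits.ValiantsHypothesis.ValiantsHypothesis.Theorems.FifoMatchingNNDivisionHardLocatedFaceExposure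
import Summits.ValiantsHypothesis.ValiantsHypothesis.Theorems.FifoMatchingNNDivisionHardSparseEdgePassenger
import Summits.ValiantsHypothesis.ValiantsHypothesis.Theorems.FifoMatchingNNDivisionHardLowDimRung
import Summits.ValiantsHypothesis.ValiantsHypothesis.Theorems.FifoMatchingXcDivisionChamberCertificate
import Summits.ValiantsHypothesis.ValiantsHypothesis.Theorems.FifoMatchingNNDivisionHardCorSandwich
import Summits.ValiantsHypothesis.ValiantsHypothesis.Theorems.FifoMatchingNNDivisionHardSwitchedFaceTower
import Summits.ValiantsHypothesis.ValiantsHypothesis.Theorems.FifoMatchingNNDivisionHardExposedFibreRung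
import Summits.ValiantsHypothesis.ValiantsHypothesis.Theorems.FifoMatchingNNDivisionHardFaceBlindRung
import Summits.ValiantsHypothesis.ValiantsHypothesis.Theorems.FifoMatchingNNDivisionHardLocalization
import Summits.ValiantsHypothesis.ValiantsHypothesis.Theorems.FifoMatchingNNDivisionHardLocalizationOrbit
import Summits.ValiantsHypothesis.ValiantsHypothesis.Theorems.FifoMatchingNNDivisionHardMaxCutLPDecided
import Summits.ValiantsHypothesis.ValiantsHypothesis.Theorems.FifoMatchingNNDivisionHardGadgetRigidity
import Summits.ValiantsHypothesis.ValiantsHypothesis.Theorems.FifoMatchingNNDivisionHardLocatedRowsColumnCoupled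
import Summits.ValiantsHypothesis.ValiantsHypothesis.Theorems.FifoMatchingNNDivisionHardShadowConstReadTwinFibre
import Summits.ValiantsHypothesis.ValiantsHypothesis.Theorems.FifoMatchingNNDivisionHardLocalizationRoot
import Summits.ValiantsHypothesis.ValiantsHypothesis.Theorems.FifoMatchingNNDivisionHardLocalizationFace
import Summits.ValiantsHypothesis.ValiantsHypothesis.Theorems.FifoMatchingNNDivisionHardLocalizationFaceSpecies
import Summits.ValiantsHypothesis.ValiantsHypothesis.Theorems.FifoMatchingNNDivisionHardExactIsVirtual
import Summits.ValiantsHypothesis.ValiantsHypothesis.Theorems.FifoMatchingNNDivisionHardLocalizationWeightedPin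
import Summits.ValiantsHypothesis.ValiantsHypothesis.Theorems.FifoMatchingNNDivisionHardLocalizationUPatFace
import Literature.Analysis.Convex.LinearProgrammingDuality
import Literature.Barriers.PneNP.TSPExtensionComplexity
import Literature.Combinatorics.Optimization.KMRLpLowerBoundsUnconditional
import Literature.Combinatorics.Optimization.LpRelaxationOfNonnegativeFactorization
import Summits.ValiantsHypothesis.ValiantsHypothesis.Cruxes.NNLinearDegreeCofactorHard.Lines.xc_division
import Literature.Barriers.PneNP.TSPExtensionComplexityHyperplaneBound
import Literature.Computability.Complexity.UniqueDisjointnessCorruption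
import Literature.Combinatorics.Optimization.UdisjShiftNonnegativeRank
import HarnessLib

/-!
# LINE `virtual_passenger` — crux `Theses.FifoMatching.NNDivisionHard` (stmt-ValiantsHypothesis-21181) — REV 25

Pen val-idea-42 g0 (revs 1–14) → g2 (revs 15–19.1) → g3 (revs 20–24) → g4 (rev 25); critic of record val-idea-crit-9; suppliers by name val-idea-38/40/41/43, ports val-port-1/3/4.
FULL REVISION LOG = the line card `Lines/virtual_passenger.md` + git history (⟨abr.⟩ = abridged for the 200 KB cap; full texts rev 15 @f9e94003f1c0).

THE LINE.  21181 ⇐ `CorVirtualHard` (no BUDGETED passenger makes `COR(K_h) + Q` quasi-polynomially cheap; Hertrich–Loho 2024 Q5.1 at `P = COR`) —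
PROVED in §1.  §3 splits `CorVirtualHard` by `by_cases` on passenger-family classes at read level `⌊√h⌋ − 2`, each DECIDED by a theorem of this
file / the tree: A⁺ `GadgetBlind` · D `DimDeficient` · E `BlockBlind` · B `SparseDiff` · F `CommonExtremiser` · G `DiagFacePoor` · H `RootedExtremisers` ·
R `NearRooted` / R\* `MixedRooted τ` (Razborov's corruption pair `UDISJCorruption` — a tree THEOREM since rev 21, ✓ p682396) · K / K_θ / K^aff_θ (val-idea-43; tree KMR
theorem) · S `Shallow` (BFPS 2012 Thm 6 `BFPS2012_corSandwichHard` — a tree THEOREM since rev 21, ✓ p682764) · E♭ `FibreBlind` (val-idea-40) ⊇ L `BraidCoarse` · W `SwitchLocated`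
(val-idea-38) · Z♭_c `ZonoBlind c` (val-idea-41) · Δ `Localization.DelLocated` (val-idea-43, rev 20) · P `PinLocated` / P′ `CubeLocated` (val-idea-40's `LocatedRows.PinExposed` /
`ColumnCoupled` affine cubes BY NAME, rev 21) · C / C♭ (revs 7–18) · C♭_loc (rev 19) ·
T `TwinLocated` (val-idea-41's twin genus BY NAME, rev 23) · U `Localization.UPat` (val-idea-43 g6's GENUS I OF RECORD BY NAME, rev 25) · C♭_orb⋆ `CoreLawOrb` (revs 20–22) ·
C♭_face⋆ `CoreLawFace` (rev 23: COR-VIRTUAL outside `Face (AutStar ConeD)`, val-idea-43 g6's functors BY NAME) ·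
C♭_hull `CoreLawHull` — THE REGISTERED RESEARCH STUB `stub_coreLaw` (rev 24: COR-VIRTUAL outside `Hull (Face (AutStar ConeD))` — a statement about passenger POLYTOPES).
SKELETON (rev 21): `NNDivisionHard_of : stub_coreLaw → …Theses.FifoMatching.NNDivisionHard` BY NAME, PROVED; sorries 1 = the research stub (revs 11–20: sorries 3 =
1 research + 2 KNOWN print facts `stub_bfps2012` / `stub_udisjCorruption`, both DISCHARGED BY NAME in rev 21 from the Literature theorems ✓ p682764 / ✓ p682396).
HONESTY CLAUSE (R294 (2)), IN KERNEL since rev 21: the classes are decided SUB-POPULATIONS and `coreLawOrb_iff_corVirtualHard : CoreLawOrb ↔ CorVirtualHard` —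
the research stub IS COR-VIRTUAL restated on its undecided residual; no intake moves the distance to the crux.

REVS 16–18 (g2; crit-9 g2 V#44 / V#46 / row 74): rev 16 BFPS wire by name + CLASS L; rev 17 CLASS W by theorem + N18 (C⁺_diag ✗ p674104);
rev 18 CLASS Z♭_c by import + census lemma `offDiagConst_blockBlind` (diagonal passengers are CLASS E; prior art PROP D₀); rev 19.1 census
lemma 2 `diagConst_gadgetBlind` (diagonal-CONSTANT, e.g. zero-diagonal, passengers are CLASS A⁺).
REV 19 (g2; crit-9 g2 GO 00:02Z): **C♭ ↦ C♭_loc — DELETION-LOCALIZATION BY NAME** (val-idea-43 g5, crit-9 V#47/V#53; val-port-4 g3's port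
`…Theorems.FifoMatching.Localization` ✓ p679690): the fifteen `c`-free classes become ONE class predicate `Cone θ τ` (`cone_decided`), and the
research stub is RE-TYPED to the WEAKER `CoreLawLoc` — hardness only for HEREDITARILY WILD budgeted families (no `⌊√h⌋`-deletion minor in the
cone, not zone-blind); `coreLawLoc_of_coreLaw`, `corVirtualHard_of_partitionLoc` PROVED; stub names and sorry count (3) unchanged.
REV 20 (pen g3; bytes staged by val-idea-43 g5 8a38e47173ce9426 + the pen's `ConeD` delta; sig-first 00:23:33Z): (a) BYTE RELIEF — §2 (gadget) and §3g (max-cut LP)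
replaced by imports of their Theorems ports (names opened explicitly / cited as `Theorems.FifoMatching.MaxCutLP.X`; no statement change);
(b) **C♭_loc ↦ C♭_orb⋆ — ORBIT-LOCALIZATION BY NAME** (val-idea-43 g5 kernel rev 6a §10, crit-9 V#65; port `…Theorems.FifoMatching.Localization`
part 5 `…LocalizationOrbit`): the research stub is RE-TYPED to the WEAKER `CoreLawOrb` — hardness only for budgeted families NO COMPOSITE
SWITCHING of which has a `⌊√h⌋`-deletion minor in the ENLARGED cone `ConeD θ τ = Cone θ τ ∨ Localization.DelLocated` (43 g5's UNCONDITIONAL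
deletion-located class — it carries `ColSep`, `SwitchSep`, the switched diag-permutahedra; `¬ Localization.OrbStar (ConeD θ τ)`), not zone-blind; `coreLawOrb_of_coreLawLoc`,
`corVirtualHard_of_partitionOrb` PROVED (`Localization.decided_orbStar`); stub names and sorry count (3) unchanged; chain C ⇒ C♭ ⇒ C♭_loc ⇒ C♭_orb⋆.
REV 21 (pen g3; BY IMPORT ONLY, R331 (2)(f)): val-idea-40 g5's located species, now Theorems ports (`…LocatedRowsPinExposed` ✓ p681115,
`…LocatedRowsColumnCoupled` ✓ p681292; val-port-1 g4 00:32Z «cite BY NAME»), join the enlarged cone as CLASSES P `PinLocated` (pin-exposed: a valid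
inequality tight on a coordinate face `F_S`, `2|S| ≤ h`, one member maximising every tilted clique row; `LocatedRows.pinExposed_decided`) and P′
`CubeLocated` (full vertex families of COLUMN-COUPLED affine cubes, N20; `LocatedRows.columnCoupled_decided`), read through §1's flat currency map
(`flatE`, `hasEFOfSize_flatE`): `ConeD θ τ = Cone θ τ ∨ DelLocated ∨ PinLocated ∨ CubeLocated` (X₁₈); `coneD_decided` by two more `decided_or`;
the research statement TEXT `CoreLawOrb` is unchanged (its cone grew: the stub is WEAKER again, `¬ OrbStar X₁₈ ⇒ ¬ OrbStar X₁₆`, `orbStar_mono`);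
(ii) **BOTH KNOWN STUBS DISCHARGED BY NAME** (tenure g15 00:58:50Z (E); Literature seat littype-FN2-1 g25): `stub_udisjCorruption` ↦ theorem
`udisjCorruption_known : UDISJCorruption := Literature.Computability.Complexity.udisjCorruption_holds` (✓ p682396 `Literature/Computability/Complexity/
UniqueDisjointnessCorruption.lean`, Razborov's Main Lemma proved from frame functionals; its `udisjCorruption` is this file's `UDISJCorruption` VERBATIM) and
`stub_bfps2012` ↦ theorem `bfps2012_known := Literature.Combinatorics.Optimization.BFPS2012_corSandwichHard_holds` (✓ p682764 `…/UdisjShiftNonnegativeRank.lean`,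
BFPS 2012 Thm 6 ⇐ Thm 5); the skeleton loses both print binders: `NNDivisionHard_of (hC : Registered.stub_coreLaw)`; sorries 3 ↦ 1 (research only); the honesty clause
becomes the kernel theorem `coreLawOrb_iff_corVirtualHard`.  R327 (3)'s `BFPS2012Fact` support item is MOOT.
REV 22 (pen g3; theorem-only, crit-9 g3 V#100): §1 gains the graph→flat transport twin `corVirtualHardN_of_corVirtualHard` (so
`corVirtualHardN_iff_corVirtualHard`) and the by-name bridge `corVirtualHardN_iff_locatedRows : CorVirtualHardN ↔ LocatedRows.CorVirtualHardN` (the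
LANDED Theorems decl, `Iff.rfl`); §6 gains the KILL LINE OF RECORD IN KERNEL `not_coreLawOrb_of_not_corVirtualHardN : ¬ LocatedRows.CorVirtualHardN →
¬ CoreLawOrb` and `coreLawOrb_iff_corVirtualHardN` — a kernel refutation of flat COR-VIRTUAL (e.g. of C′ = `LocatedRows.ExactPencilLaw`, once val-idea-41 g4's
announced `exactPencilLaw_iff_corVirtualHardN` is kernel) kills `stub_coreLaw` and every rev of this line, NOT the crux.  `CoreLawOrb` TEXT, `ConeD`, skeleton,
sorry count (1) UNCHANGED.
REV 23 (pen g3).  (a) (crit-9 g3 V#101b (3) «ONE disjunct»; BY IMPORT, ✓ p687153 `…ShadowConstReadTwinFibre`): CLASS T `TwinLocated` :=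
val-idea-41's twin genus (twin frame, pin `P ≥ 0` on `ι₂ × ι₂`, partial common maximisers of the twin directions on the top fibre; ⊇ twin-blind ⊇ π-symmetric
lists, ⊇ sTop ⊇ TEN), decided by name from `ShadowConstRead.sTopFibre_decided`; `ConeD` ↦ X₁₉ `= X₁₈ ∨ TwinLocated`, `coneD_decided` by one more `decided_or`;
`CoreLawOrb` TEXT unchanged.  (b) **RESEARCH STUB RE-TYPED BY NAME** (crit-9 g3 V#97 §4 (A)(B) GO / V#105a (i)–(v); val-idea-43 g6's functors, ✓ p687218
`…LocalizationRoot` (re-rooting `rootLin`, `AutWord`, `AutStar := Loc ∘ AutWord`, `orbStar_le_autStar`, `decided_autStar`), ✓ p687398 `…LocalizationFace` (free-face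
functor `Face`, `decided_face`, `le_face`), ✓ p688217 `…LocalizationFaceSpecies` (`decided_face_autStar`, genus-I instances)): `def CoreLawFace` := `CoreLawOrb` with
`¬ OrbStar (ConeD θ τ)` replaced by `¬ Face (AutStar (ConeD θ τ))` (every other clause verbatim); `coreLawFace_of_coreLawOrb` (PROVED, the new stub is WEAKER:
`OrbStar X ≤ AutStar X ≤ Face (AutStar X)`); glue `corVirtualHard_of_partitionFace` (PROVED, via `decided_face_autStar (coneD_decided …)`); `abbrev Registered.stub_coreLaw := CoreLawFace`;
`theorem stub_coreLaw : CoreLawFace := by sorry` (NAME kept, ONE binder); honesty `coreLawFace_iff_corVirtualHard`, `coreLawFace_iff_coreLawOrb`, `coreLawFace_iff_corVirtualHardN` and the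
kill line `not_coreLawFace_of_not_corVirtualHardN` (all PROVED, axioms std); skeleton `NNDivisionHard_of (hC : Registered.stub_coreLaw)` through `corVirtualHard_of_partitionFace`.
HONEST LABEL: the typed residual shrinks to «budgeted, not zone-blind, and on EVERY free face of COR(K_h) (deletion AND contraction minors, pins, stable-set
faces, top sub-families) in EVERY rooting/switching the read is outside X₁₉» — still exactly COR-VIRTUAL (`coreLawFace_iff_corVirtualHard`); 0 explicit members.  CALIBRATION (cite only, R331 (2)(f); not law evidence, 0 residual members): ✓ p684578 / ✓ p684617
`…Theorems.NNDivisionHard.Calibration.nonnegRank_C3 : HasNonnegFactorization C3r 8 ∧ ∀ r, HasNonnegFactorization C3r r → 8 ≤ r` (rank₊ of the K₃ clique-row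
slack pattern is exactly 8 — an exact finite fact, not in print as an equality); cell val-cor-slack 2-leg exact LP optimum xc-ratio 9/10 (K₃), 17/18 (K₄) likewise calibration.
INTAKE POLICY (pen, 01:25Z; crit-9 V#101b): 41's species O (`OffDiagConst`) ⊆ Loc(E) by `offDiagConst_blockBlind`, TEN / `sTop` ⊆ P (`PinLocated`, w = λ·flat P; kernel by name
in 41's rev 13 / ✓ p688185 `…ShadowConstReadTenPinned`) — no disjuncts; GENUS-I species (38's ELEVEN/TWELVE, 43's stick-out cubes) are `Face Quiet` members — no disjuncts.
REV 24 (pen g3; research-stub RE-TYPING BY NAME, crit-9 g3 explicit word; ✓ `…LocalizationWeightedPin` = val-idea-43 g6's Theorems part 11): `def CoreLawHull` := `CoreLawFace` with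
`¬ Face (AutStar (ConeD θ τ))` replaced by `¬ Hull (Face (AutStar (ConeD θ τ)))` (every other clause verbatim; `CoreLawFace` / `CoreLawOrb` KEPT as defs); `coreLawHull_of_coreLawFace`
(PROVED, `le_hull`); glue `corVirtualHard_of_partitionHull` (PROVED, `decided_hull ∘ decided_face_autStar ∘ coneD_decided`); `abbrev Registered.stub_coreLaw := CoreLawHull`;
`theorem stub_coreLaw : CoreLawHull := by sorry` (NAME kept, ONE binder); honesty `coreLawHull_iff_corVirtualHard`, `coreLawHull_iff_coreLawFace`, `coreLawHull_iff_exactPencilLaw`,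
`coreLawHull_iff_corVirtualHardN`, kill lines `not_coreLawHull_of_not_exactPencilLaw` / `not_coreLawHull_of_not_corVirtualHardN` (all PROVED); skeleton through `corVirtualHard_of_partitionHull`.
HONEST LABEL: the research statement is now PRESENTATION-FREE on the located side (a budgeted passenger POLYTOPE none of whose vertex-supersets read located) — still
exactly COR-VIRTUAL (`coreLawHull_iff_corVirtualHard`); 0 explicit members.
REV 25 (pen g4; BY IMPORT, crit-9 g4 explicit word; ✓ p691158 `…LocalizationUPat` / ✓ p691255 `…LocalizationUPatFace` = val-idea-43 g6's Theorems parts 12/13): CLASS U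
`Localization.UPat` := GENUS I OF RECORD (crit-9 V#119a, clause (E-U)) — the slack matrix of `COR(K_h) + conv q` (all valid rows × all points of the SUM) carries a
UNIQUE-DISJOINTNESS PATTERN of order `⌊√h⌋` (rows may depend on `a`, passenger column points on `b`: no common maximiser, no single top, no located face needed;
⊇ `Hull (Face Quiet)` by `hullFaceQuiet_le_uPat`, ⊇ every budget-free located species typed so far), decided by name from `Localization.uPat_decided`
(Yannakakis + Kaibel–Weltge `uPatAt_three_pow_le`, rate `c ↦ 2c`); `ConeD` ↦ X₂₀ `= X₁₉ ∨ UPat`, `coneD_decided` by one more `decided_or`; census lemmas `uPat_le_coneD`,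
`hullFaceQuiet_le_coneD`.  `CoreLawHull` TEXT, glue, honesty iffs, kill chain, skeleton, sorry count (1) UNCHANGED.  HONEST LABEL: the typed residual now carries
(E-U) BY NAME — «budgeted, not zone-blind, and NO presentation of the passenger polytope is face-located or automorphism-located in X₂₀; in particular slack(COR(K_h)+Q)
has NO UDISJ pattern of order ⌊√h⌋» — `UPat` is DECIDED ⇒ `CoreLawHull` over X₂₀ ⟺ over X₁₉ ⟺ COR-VIRTUAL ≡ C′ (`coreLawHull_iff_corVirtualHard`
re-proved unchanged); residual book-keeping BY NAME, NOT progress on the law; 0 explicit residual members.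
KILL CHAIN OF RECORD (R335 (2)(b′) / R341 (1), T1 ✓ p688316): `coreLawFace_iff_exactPencilLaw : CoreLawFace ↔ LocatedRows.ExactPencilLaw` and `not_coreLawFace_of_not_exactPencilLaw` (PROVED here) —
a kernel `¬ ExactPencilLaw` kills `stub_coreLaw` and this LINE, not the crux.
Nothing here proves the crux: 21181 OPEN; COR-VIRTUAL OPEN (both currencies, `corVirtualHardN_iff_corVirtualHard`; ≡ C′ `ExactPencilLaw`, `coreLawFace_iff_exactPencilLaw`); VP ≠ VNP NOT proved.
-/


/-! # §1 The budgeted transport (= crux workfile `VirtualPassenger.lean`, namespace `…XcDivision.VPLine`) -/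

namespace Summit.ValiantsHypothesis.ValiantsHypothesis.Cruxes.NNLinearDegreeCofactorHard.XcDivision

open Matrix Finset MvPolynomial
open scoped NNReal Pointwise
open Literature.Barriers.PneNP (HasEFOfSize)
open Literature.Combinatorics.Optimization (corPolytopeGraph)
open Literature.Computability.AlgebraicComplexity (complexity nestFreeMatchingPoly)
open Literature.Computability.AlgebraicComplexity.MonotoneCircuitEF (hasEFOfSize_newtonPolytope_complexity)
open Literature.Algebra.Polynomial.NewtonPolytope (newtonPolytope)
open Summit.ValiantsHypothesis.ValiantsHypothesis.Theorems.FifoMatching.XcDivision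
  (hasEFOfSize_minkowski_of_complexity_le)
open Summit.ValiantsHypothesis.ValiantsHypothesis.Theorems.FifoMatching.QueueGridFace
  (realOf suppPts newt QGV patternVec queueGridPP corMap corMap_image_queueGridPP newt_nonneg)
open Summit.ValiantsHypothesis.ValiantsHypothesis.Theorems.FifoMatching.GridCorShadow (queueGridZeroOnePoints_holds)
open Summit.ValiantsHypothesis.ValiantsHypothesis.Theorems.FifoMatching.MonomialCofactor (newt_eq_newtonPolytope)
open Literature.Combinatorics.Optimization (AboulkerEtAl2019_gridCorCliqueFace)
open Literature.Computability.MetaComplexity (gridGraph)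

namespace VPLine

/-! ## The budgeted statements -/

/-- **XC-VIRTUAL (budgeted XC-MINKOWSKI)**: eventually in `n`, no `NFP_n + Newt(h)` whose passenger `Newt(h)` ITSELF ha … ⟨abr.⟩ -/
def XcVirtualHard : Prop :=
  ∀ c : ℕ, ∃ n₀ : ℕ, ∀ n ≥ n₀, ∀ h : MvPolynomial (Fin (2 * n) × Fin (2 * n)) ℝ≥0, h ≠ 0 →
    HasEFOfSize (newtR h) (3 * T c n) →
    ¬ HasEFOfSize (newtR (nestFreeMatchingPoly n ℝ≥0) + newtR h) (3 * T c n)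

/-- **COR-VIRTUAL (the budgeted law; = vxc(COR(K_h)) super-quasi-polynomial, Hertrich–Loho Q5.1 at COR)**. -/
def CorVirtualHard : Prop :=
  ∀ c : ℕ, ∃ h₀ : ℕ, ∀ h ≥ h₀, ∀ (K : ℕ) (q : Fin (K + 1) → (Fin h × Fin h → ℝ)) (r : ℕ),
    HasEFOfSize (convexHull ℝ (Set.range q)) r →
    HasEFOfSize (corPolytopeGraph (⊤ : SimpleGraph (Fin h)) + convexHull ℝ (Set.range q)) r → T c h < r

/-- the law of record implies the budgeted law. -/
theorem corVirtualHard_of_corMinkowski (hC : CorMinkowskiHard) : CorVirtualHard := by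
  intro c
  obtain ⟨h₀, hh₀⟩ := hC c
  exact ⟨h₀, fun h hh K q r _ hEF => hh₀ h hh K q r hEF⟩

/-- local ALIAS of the crux statement, used as the conclusion of the §1 transport theorems so that the skeleton checker … ⟨abr.⟩ -/
abbrev Crux21181 : Prop := Summit.ValiantsHypothesis.ValiantsHypothesis.Theses.FifoMatching.NNDivisionHard

/-- ★ XC-VIRTUAL ⇒ the crux BY NAME (the crux charges `L₊(h)`; `xc(Newt h) ≤ 3·L₊(h)`, HY21 Thm 35). -/
theorem nnDivisionHard_of_xcVirtual (hX : XcVirtualHard) :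
    Crux21181 := by
  intro c
  obtain ⟨n₀, hn₀⟩ := hX c
  refine ⟨n₀, fun n hn h hh => ?_⟩
  by_contra hlt
  have hle : complexity (nestFreeMatchingPoly n ℝ≥0 * h) + complexity h ≤ T c n := not_lt.mp hlt
  have h1 : complexity (nestFreeMatchingPoly n ℝ≥0 * h) ≤ T c n := le_trans (Nat.le_add_right _ _) hle
  have h2 : complexity h ≤ T c n := le_trans (Nat.le_add_left _ _) hle
  exact hn₀ n hn h hh ((hasEFOfSize_newtonPolytope_complexity h).of_le (by omega))
    (hasEFOfSize_minkowski_of_complexity_le n h h1)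

/-! ## The budgeted transport steps -/

/-- **ONE TRANSPORT STEP, WITH BUDGET**: as `transport_step`, and the new passenger `conv{q'}` (a linear image of a fac … ⟨abr.⟩ -/
theorem transport_step_budget {ι κ J : Type} [Fintype ι] [Fintype κ] [Fintype J] [Nonempty J]
    {P : Set (ι → ℝ)} (q : J → ι → ℝ) {r r' : ℕ} (h : HasEFOfSize (P + convexHull ℝ (Set.range q)) r)
    (hB : HasEFOfSize (convexHull ℝ (Set.range q)) r')
    (w : ι → ℝ) (δ : ℝ) (hP : ∀ x ∈ P, w ⬝ᵥ x ≤ δ) (L : (ι → ℝ) →ₗ[ℝ] (κ → ℝ)) :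
    ∃ (K : ℕ) (q' : Fin (K + 1) → κ → ℝ),
      HasEFOfSize (L '' (P ∩ {x | w ⬝ᵥ x = δ}) + convexHull ℝ (Set.range q')) r ∧
      HasEFOfSize (convexHull ℝ (Set.range q')) r' := by
  classical
  obtain ⟨j₀, -, hj₀⟩ :=
    Finset.exists_max_image Finset.univ (fun j => w ⬝ᵥ q j) Finset.univ_nonempty
  have hle : ∀ j, w ⬝ᵥ q j ≤ w ⬝ᵥ q j₀ := fun j => hj₀ j (Finset.mem_univ _)
  have hQ : ∀ y ∈ convexHull ℝ (Set.range q), w ⬝ᵥ y ≤ w ⬝ᵥ q j₀ :=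
    dot_le_of_mem_convexHull _ w _ (by rintro _ ⟨j, rfl⟩; exact hle j)
  have h2 := hasEFOfSize_image_add (hasEFOfSize_face_add h w δ _ hP hQ) L
  rw [convexHull_range_inter_eq q w _ hle, LinearMap.image_convexHull, ← Set.range_comp] at h2
  have hB2 := (hB.inter_eq w (w ⬝ᵥ q j₀)).image_linearMap L
  rw [convexHull_range_inter_eq q w _ hle, LinearMap.image_convexHull, ← Set.range_comp] at hB2
  haveI : Nonempty {j : J // w ⬝ᵥ q j = w ⬝ᵥ q j₀} := ⟨⟨j₀, rfl⟩⟩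
  obtain ⟨K, q', hq'⟩ := exists_fin_range_eq (L ∘ fun j : {j : J // w ⬝ᵥ q j = w ⬝ᵥ q j₀} => q j.1)
  exact ⟨K, q', by rw [hq']; exact h2, by rw [hq']; exact hB2⟩

/-- **THE GEOMETRIC TRANSPORT, WITH BUDGET**: as `transport_geometric`, plus: an EF of `Newt(h)` of size `s'` yields an … ⟨abr.⟩ -/
theorem transport_geometric_budget :
    ∃ c : ℝ, 0 < c ∧ ∃ t₀ : ℕ, ∀ (n r g : ℕ), 1 ≤ r → (r + 1) * (2 * r + 1) ≤ n → ∀ (hg : 2 * g ≤ r), t₀ ≤ g →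
      ∀ (hh : MvPolynomial (Fin (2 * n) × Fin (2 * n)) ℝ≥0), hh ≠ 0 → ∀ s s' : ℕ,
        HasEFOfSize (newtR (nestFreeMatchingPoly n ℝ≥0) + newtR hh) s → HasEFOfSize (newtR hh) s' →
          ∃ h : ℕ, c * g ≤ h ∧ ∃ (K : ℕ) (q : Fin (K + 1) → (Fin h × Fin h → ℝ)),
            HasEFOfSize (corPolytopeGraph (⊤ : SimpleGraph (Fin h)) + convexHull ℝ (Set.range q)) s ∧
            HasEFOfSize (convexHull ℝ (Set.range q)) s' := by
  classical
  obtain ⟨c, hc, t₀, hface⟩ := AboulkerEtAl2019_gridCorCliqueFace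
  refine ⟨c, hc, t₀, fun n r g hr hn hg ht hh hh0 s s' hEF hB => ?_⟩
  -- Step 0: Newton polytopes as hulls of their support points
  have hEF' : HasEFOfSize (newt (nestFreeMatchingPoly n ℝ≥0) + newt hh) s := by
    rw [newt_eq_newtonPolytope, newt_eq_newtonPolytope]; exact hEF
  have hB' : HasEFOfSize (newt hh) s' := by
    rw [newt_eq_newtonPolytope]; exact hB
  haveI : Nonempty hh.support := (MvPolynomial.support_nonempty.2 hh0).coe_sort
  let q₀ : hh.support → (Fin (2 * n) × Fin (2 * n)) → ℝ := fun d => realOf d.1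
  have hQ : newt hh = convexHull ℝ (Set.range q₀) := by
    unfold newt suppPts; rw [Set.image_eq_range]; rfl
  rw [hQ] at hEF' hB'
  -- Step 1: the A1 coordinate face, read out onto `PP_r`
  obtain ⟨Z, f, hA1⟩ := queueGridZeroOnePoints_holds r n hr hn
  let w : (Fin (2 * n) × Fin (2 * n)) → ℝ := fun e => if e ∈ Z then (-1 : ℝ) else 0
  have hw : ∀ x : (Fin (2 * n) × Fin (2 * n)) → ℝ, w ⬝ᵥ x = -∑ e ∈ Z, x e := by
    intro x
    simp only [dotProduct, w, ite_mul, neg_one_mul, zero_mul]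
    rw [Finset.sum_ite_mem, Finset.univ_inter, Finset.sum_neg_distrib]
  have hP : ∀ x ∈ newt (nestFreeMatchingPoly n ℝ≥0), w ⬝ᵥ x ≤ 0 := fun x hx => by
    rw [hw]; exact neg_nonpos.2 (Finset.sum_nonneg fun e _ => newt_nonneg _ x hx e)
  let Lf : ((Fin (2 * n) × Fin (2 * n)) → ℝ) →ₗ[ℝ] ((QGV r × QGV r) × Bool × Bool → ℝ) :=
    LinearMap.funLeft ℝ ℝ f
  obtain ⟨K₁, q₁, h₁, hB₁⟩ := transport_step_budget q₀ hEF' hB' w 0 hP Lf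
  have hF : Lf '' (newt (nestFreeMatchingPoly n ℝ≥0) ∩ {x | w ⬝ᵥ x = 0}) = queueGridPP r := by
    rw [newt_inter_zeroSet_eq, LinearMap.image_convexHull]
    unfold queueGridPP
    congr 1
  rw [hF] at h₁
  -- Step 2: c1's coordinate-linear map onto `COR(G_g)` (the passenger goes along: a linear image keeps its budget)
  have h₂ := hasEFOfSize_image_add h₁ (corMap r g hg)
  rw [corMap_image_queueGridPP, LinearMap.image_convexHull, ← Set.range_comp,
    ← Summit.ValiantsHypothesis.ValiantsHypothesis.Theorems.FifoMatching.QueueGridFace.corPolytopeGraph_eq] at h₂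
  have hB₂ := hB₁.image_linearMap (corMap r g hg)
  rw [LinearMap.image_convexHull, ← Set.range_comp] at hB₂
  -- Step 3: AFHMS's face of `COR(G_g)` onto `COR(K_h)`, as ONE valid functional
  obtain ⟨h, hch, k, cv, δ, π, hvalid, hπ⟩ := hface g ht
  obtain ⟨K₃, q₃, h₃, hB₃⟩ := transport_step_budget (⇑(corMap r g hg) ∘ q₁) h₂ hB₂ (fun e => ∑ i, cv i e)
    (∑ i, δ i) (sum_dotProduct_le _ cv δ hvalid) π
  rw [← inter_forall_eq_inter_sum _ cv δ hvalid, hπ] at h₃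
  exact ⟨h, hch, K₃, q₃, h₃, hB₃⟩

/-- ★ **THE BUDGETED TRANSPORT IS A THEOREM**: COR-VIRTUAL ⇒ XC-VIRTUAL. -/
theorem xcVirtualTransport_holds : CorVirtualHard → XcVirtualHard := by
  intro hK c
  obtain ⟨cA, hcA, t₀, htrans⟩ := transport_geometric_budget
  obtain ⟨h₀, hh₀⟩ := hK (4 ^ (c + 1) + c + 1)
  -- constants
  set cm : ℝ := min cA 1 with hcm
  have hcm0 : 0 < cm := lt_min hcA one_pos
  have hcmA : cm ≤ cA := min_le_left _ _
  have hcm1 : cm ≤ 1 := min_le_right _ _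
  obtain ⟨S₁, hS₁⟩ := exists_nat_ge ((20 / cm) ^ 2)
  obtain ⟨S₀, hS₀a, hS₀b, hS₀c, hS₀d⟩ :
      ∃ S₀ : ℕ, 4 * t₀ + 4 ≤ S₀ ∧ h₀ ^ 2 ≤ S₀ ∧ S₁ ≤ S₀ ∧ 16 ≤ S₀ :=
    ⟨4 * t₀ + 4 + h₀ ^ 2 + S₁ + 16, by omega, by omega, by omega, by omega⟩
  refine ⟨S₀ ^ 2, fun n hn hh hh0 hB hEF => ?_⟩
  obtain ⟨s, hs⟩ : ∃ s, s = Nat.sqrt n := ⟨_, rfl⟩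
  have hsS : S₀ ≤ s := by rw [hs]; exact Nat.le_sqrt'.2 hn
  have hss : s ^ 2 ≤ n := by rw [hs]; exact Nat.sqrt_le' n
  have hns : n < (s + 1) ^ 2 := by rw [hs]; exact Nat.lt_succ_sqrt' n
  obtain ⟨g, hg⟩ : ∃ g, g = s / 4 := ⟨_, rfl⟩
  have h4g : 4 * g ≤ s := by rw [hg]; exact Nat.mul_div_le s 4
  have hg4 : s < 4 * (g + 1) := by rw [hg]; omega
  have hg1 : 1 ≤ g := by omega
  have hgt : t₀ ≤ g := by omega
  have hn' : (2 * g + 1) * (2 * (2 * g) + 1) ≤ n := by nlinarith [Nat.mul_le_mul h4g h4g]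
  obtain ⟨h, hch, K, q, hEF', hBq⟩ :=
    htrans n (2 * g) g (by omega) hn' (le_refl _) hgt hh hh0 (3 * T c n) (3 * T c n) hEF hB
  -- `h` is large: `h ≥ √s + 1`
  have hsqrt_s : Real.sqrt s * Real.sqrt s = s := Real.mul_self_sqrt (Nat.cast_nonneg s)
  have hreal : Real.sqrt s + 1 ≤ (h : ℝ) := by
    have hS₁s : ((20 / cm) ^ 2 : ℝ) ≤ s := le_trans hS₁ (by exact_mod_cast (show S₁ ≤ s by omega))
    have hsq : 20 / cm ≤ Real.sqrt s := by
      rw [show (20 / cm : ℝ) = Real.sqrt ((20 / cm) ^ 2) by rw [Real.sqrt_sq (by positivity)]]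
      exact Real.sqrt_le_sqrt hS₁s
    have h20 : 20 ≤ cm * Real.sqrt s := by
      have := mul_le_mul_of_nonneg_left hsq hcm0.le
      rwa [show cm * (20 / cm) = 20 by field_simp] at this
    have hg_real : (s : ℝ) / 4 - 1 ≤ g := by
      have : (s : ℝ) < 4 * ((g : ℝ) + 1) := by exact_mod_cast hg4
      linarith
    have h1 : cm * ((s : ℝ) / 4 - 1) ≤ h :=
      calc cm * ((s : ℝ) / 4 - 1) ≤ cm * g := mul_le_mul_of_nonneg_left hg_real hcm0.le
        _ ≤ cA * g := mul_le_mul_of_nonneg_right hcmA (Nat.cast_nonneg g)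
        _ ≤ h := hch
    have h2 : 20 * Real.sqrt s ≤ cm * s := by
      have := mul_le_mul_of_nonneg_right h20 (Real.sqrt_nonneg s)
      rw [mul_assoc, hsqrt_s] at this
      exact this
    have hs1 : 1 ≤ Real.sqrt s := by
      rw [show (1 : ℝ) = Real.sqrt 1 by simp]
      exact Real.sqrt_le_sqrt (by exact_mod_cast (show 1 ≤ s by omega))
    nlinarith
  -- consequences in ℕ: `h ≥ h₀` and `n < h⁴`
  have hh₀' : h₀ ≤ h := by
    have : (h₀ : ℝ) ≤ Real.sqrt s := by
      rw [show (h₀ : ℝ) = Real.sqrt ((h₀ : ℝ) ^ 2) by rw [Real.sqrt_sq (Nat.cast_nonneg _)]]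
      exact Real.sqrt_le_sqrt (by exact_mod_cast (show h₀ ^ 2 ≤ s by omega))
    exact_mod_cast (by linarith : (h₀ : ℝ) ≤ h)
  have hn4 : n < h ^ 4 := by
    have hs1 : s + 1 ≤ h ^ 2 := by
      have : (s : ℝ) + 1 ≤ (h : ℝ) ^ 2 := by nlinarith [Real.sqrt_nonneg s]
      exact_mod_cast this
    calc n < (s + 1) ^ 2 := hns
      _ ≤ (h ^ 2) ^ 2 := Nat.pow_le_pow_left hs1 2
      _ = h ^ 4 := by rw [← pow_mul]
  have hn0 : n ≠ 0 := by
    have : 16 ^ 2 ≤ s ^ 2 := Nat.pow_le_pow_left (by omega) 2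
    omega
  have hT := T_pow_four_le (c := c) hn0 hn4
  have hlt := hh₀ h hh₀' K q (3 * T c n) hBq hEF'
  have hT2 : 2 ≤ T c n := by
    show 2 ^ 1 ≤ 2 ^ _
    exact Nat.pow_le_pow_right (by norm_num)
      (Nat.one_le_pow _ _ (by
        have h256 : 16 ^ 2 ≤ S₀ ^ 2 := Nat.pow_le_pow_left hS₀d 2
        have := Nat.log_pos one_lt_two (show 2 ≤ n by omega)
        omega))
  have h8 : 8 * T c n ≤ (T c n) ^ 4 := by
    have : 2 ^ 3 ≤ (T c n) ^ 3 := Nat.pow_le_pow_left hT2 3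
    calc 8 * T c n = 2 ^ 3 * T c n := by norm_num
      _ ≤ (T c n) ^ 3 * T c n := Nat.mul_le_mul_right _ this
      _ = (T c n) ^ 4 := by ring
  omega

/-- ★★ **COR-VIRTUAL ⇒ stmt-ValiantsHypothesis-21181 BY NAME, unconditionally in everything else**: the crux follows fr … ⟨abr.⟩ -/
theorem nnDivisionHard_of_corVirtual (hC : CorVirtualHard) :
    Crux21181 :=
  nnDivisionHard_of_xcVirtual (xcVirtualTransport_holds hC)

/-- **COR-VIRTUAL in the FLAT `corPolytope n` currency** — VERBATIM val-idea-39's `CliqueRowBlind.CorVirtualHardN`: the SOCKET at which every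
certificate law typed in flat currency (39's `law_chain : … → allRows.Law → CorVirtualHardN`) meets this line BY NAME.  Negative lane on those
laws: `cliqueRows.Law` ✗ p671347, C⁺_diag `diagTilted.Law` ✗ p674104 (N18), C⁺_entry `LocatedPencilLaw` ✗-misstated (N22, crit-9 g2: witness the
diagonal permutahedron `Q^Π_λ`, ✓ p677328 / p677807 / p678258; repaired C′ = `ExactPencilLaw` ≡ `pinnedRows.Law`, val-idea-38 g2, OPEN). -/
def CorVirtualHardN : Prop :=
  ∀ c : ℕ, ∃ n₀ : ℕ, ∀ n ≥ n₀, ∀ (K : ℕ) (q : Fin (K + 1) → (Fin (n * n) → ℝ)) (r : ℕ),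
    HasEFOfSize (Literature.Combinatorics.Optimization.FixedSizePsdRank.corPolytope n + convexHull ℝ (Set.range q)) r →
      HasEFOfSize (convexHull ℝ (Set.range q)) r → T c n < r

/-- flat currency ⇒ graph currency (val-idea-39 g3's P-P1a `corVirtualHard_of_corVirtualHardN`, verbatim up to qualified names). -/
theorem corVirtualHard_of_corVirtualHardN (hN : CorVirtualHardN) : CorVirtualHard := by
  intro c
  obtain ⟨h₀, hh₀⟩ := hN c
  refine ⟨h₀, fun h hh K q r hQ hR => ?_⟩
  let e : (Fin h × Fin h → ℝ) ≃ₗ[ℝ] (Fin (h * h) → ℝ) :=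
    LinearEquiv.funCongrLeft ℝ ℝ (finProdFinEquiv (m := h) (n := h)).symm
  have hQimg : e '' convexHull ℝ (Set.range q) = convexHull ℝ (Set.range (e ∘ q)) := by
    rw [Set.range_comp]; exact e.toLinearMap.image_convexHull (Set.range q)
  have himg : e '' (corPolytopeGraph (⊤ : SimpleGraph (Fin h)) + convexHull ℝ (Set.range q)) =
      Literature.Combinatorics.Optimization.FixedSizePsdRank.corPolytope h + convexHull ℝ (Set.range (e ∘ q)) := by
    rw [Set.image_add, Literature.Barriers.PneNP.corPolytope_eq_image_corPolytopeGraph_top, hQimg]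
  have hR' : HasEFOfSize (Literature.Combinatorics.Optimization.FixedSizePsdRank.corPolytope h +
      convexHull ℝ (Set.range (e ∘ q))) r := by
    rw [← himg]; exact (HasEFOfSize.image_linearEquiv_iff e).2 hR
  have hQ' : HasEFOfSize (convexHull ℝ (Set.range (e ∘ q))) r := by
    rw [← hQimg]; exact (HasEFOfSize.image_linearEquiv_iff e).2 hQ
  exact hh₀ h hh K (e ∘ q) r hR' hQ'

/-- graph currency ⇒ flat currency (rev 22; crit-9 g3 V#100: the `e.symm` twin of `corVirtualHard_of_corVirtualHardN`).  With it the two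
currencies are interchangeable BY NAME (`corVirtualHardN_iff_corVirtualHard`) and the kill line of record is kernel (§6
`not_coreLawOrb_of_not_corVirtualHardN`). -/
theorem corVirtualHardN_of_corVirtualHard (hV : CorVirtualHard) : CorVirtualHardN := by
  intro c
  obtain ⟨h₀, hh₀⟩ := hV c
  refine ⟨h₀, fun h hh K q r hR hQ => ?_⟩
  let e : (Fin h × Fin h → ℝ) ≃ₗ[ℝ] (Fin (h * h) → ℝ) :=
    LinearEquiv.funCongrLeft ℝ ℝ (finProdFinEquiv (m := h) (n := h)).symm
  let q' : Fin (K + 1) → (Fin h × Fin h → ℝ) := fun j => e.symm (q j)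
  have hq : e ∘ q' = q := funext fun j => e.apply_symm_apply (q j)
  have hQimg : e '' convexHull ℝ (Set.range q') = convexHull ℝ (Set.range q) := by
    rw [← hq, Set.range_comp]; exact e.toLinearMap.image_convexHull (Set.range q')
  have himg : e '' (corPolytopeGraph (⊤ : SimpleGraph (Fin h)) + convexHull ℝ (Set.range q')) =
      Literature.Combinatorics.Optimization.FixedSizePsdRank.corPolytope h + convexHull ℝ (Set.range q) := by
    rw [Set.image_add, Literature.Barriers.PneNP.corPolytope_eq_image_corPolytopeGraph_top, hQimg]
  have hR' : HasEFOfSize (corPolytopeGraph (⊤ : SimpleGraph (Fin h)) + convexHull ℝ (Set.range q')) r :=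
    (HasEFOfSize.image_linearEquiv_iff e).1 (by rw [himg]; exact hR)
  have hQ' : HasEFOfSize (convexHull ℝ (Set.range q')) r :=
    (HasEFOfSize.image_linearEquiv_iff e).1 (by rw [hQimg]; exact hQ)
  exact hh₀ h hh K q' r hQ' hR'

/-- The two currencies of COR-VIRTUAL are interchangeable (rev 22). -/
theorem corVirtualHardN_iff_corVirtualHard : CorVirtualHardN ↔ CorVirtualHard :=
  ⟨corVirtualHard_of_corVirtualHardN, corVirtualHardN_of_corVirtualHard⟩

/-- By-name bridge to the LANDED Theorems decl (✓ `Theorems/FifoMatchingNNDivisionHardRowFamilies.lean`): the line's verbatim copy of 39's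
`CorVirtualHardN` and `…Theorems.FifoMatching.LocatedRows.CorVirtualHardN` are the same Prop (definitional), so 38/41's law chain
(`LocatedRows.exact_law_chain`, 41 g4's announced `exactPencilLaw_iff_corVirtualHardN`) meets this line with no restated copy. -/
theorem corVirtualHardN_iff_locatedRows :
    CorVirtualHardN ↔ Summit.ValiantsHypothesis.ValiantsHypothesis.Theorems.FifoMatching.LocatedRows.CorVirtualHardN :=
  Iff.rfl

/-- ★ **THE FLAT SOCKET (PROVED)**: `CorVirtualHardN → crux` — so 39's chain `LocatedPencilLaw → allRows.Law → CorVirtualHardN` (C⁺, the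
WAVE-6 target) ends at stmt-21181 by name, one δ-step across the two workfiles. -/
theorem nnDivisionHard_of_corVirtualN (hN : CorVirtualHardN) : Crux21181 :=
  nnDivisionHard_of_corVirtual (corVirtualHard_of_corVirtualHardN hN)

end VPLine

end Summit.ValiantsHypothesis.ValiantsHypothesis.Cruxes.NNLinearDegreeCofactorHard.XcDivision


/-! # §2 The gadget read and rigidity — PORTED in rev 20 (byte relief, −17 KB): ✓ `Theorems/FifoMatchingNNDivisionHardGadgetRigidity.lean`
(namespace `…Theorems.FifoMatching.VirtualPassengerGadget`: `gadgetSpan`, `gadget_rigidity`, `GenericGadgetRead`, `genericGadgetRead_holds`,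
`HasGadgetPattern`, `PatternFreePassengerLaw`, `patternFreePassengerLaw_holds`, `indexSupport`, `SparseEdgePassengerLaw`; PROP D₀ in
✓ `Theorems/FifoMatchingXcDivisionDiagonalPassenger.lean`, `…Theorems.FifoMatching.XcDivision.corPolytope_succ_add_diag_three_pow_le`), staged by
val-idea-43 g5, pressed by val-port-4 g3; §3 opens the six names it uses EXPLICITLY (the port's `T` is δ-equal to `XcDivision.T`). -/


/-! # §2b (the DIMENSION RUNG of val-idea-40, inlined revs 2–13) — DELETED in rev 14 (δ-wire D): the rung is the landed Theorems decl
`Summit.ValiantsHypothesis.ValiantsHypothesis.Theorems.FifoMatching.LowDim.corPolytopeGraph_top_add_hull_three_pow_le_of_finrank` (✓ p666314,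
`Theorems/FifoMatchingNNDivisionHardLowDimRung.lean`, ported by val-port-1). ⟨abr.⟩ -/



/-! # §2c Block-contraction statements of val-idea-38 (`PairFace.lean` rev 4 @2a009aecbd8d, copied VERBATIM — crux work … ⟨abr.⟩ -/

namespace Summit.ValiantsHypothesis.ValiantsHypothesis.Cruxes.NNDivisionHard.VirtualPassenger.Blocks38

open scoped Pointwise
open Literature.Barriers.PneNP (HasEFOfSize)
open Literature.Combinatorics.Optimization (corPolytopeGraph corVec)

/-- symmetric and β-block-constant: the linear hull `lin F_β` of the contraction face (val-idea-38 `BlockConstSymGen`). -/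
def BlockConstSymGen {n m : ℕ} (β : Fin n → Fin m) (g : Fin n × Fin n → ℝ) : Prop :=
  (∀ p q, g (p, q) = g (q, p)) ∧ ∀ p q p' q', β p = β p' → β q = β q' → g (p, q) = g (p', q')

/-- the all-ones direction `J` (val-idea-38 `Jdir`). -/
def Jdir (n : ℕ) : Fin n × Fin n → ℝ := fun _ => 1

/-- ★ **LOCATED-FACE EXPOSURE RUNG, J-tolerant** (val-idea-38 `LocatedFaceExposureRung`, ADVISORY #2 Step 1, verbatim): … ⟨abr.⟩ -/
def LocatedFaceExposureRung : Prop :=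
  ∀ (n m : ℕ) (β : Fin n → Fin m) (ρ : Fin m → Fin n), (∀ t, β (ρ t) = t) →
    ∀ (K : ℕ) (q : Fin (K + 1) → (Fin n × Fin n → ℝ)) (r : ℕ),
      (∀ j j', BlockConstSymGen β (q j - q j') → ∃ α : ℝ, q j - q j' = α • Jdir n) →
      HasEFOfSize (corPolytopeGraph (⊤ : SimpleGraph (Fin n)) + convexHull ℝ (Set.range q)) r →
        ∃ q' : Fin 2 → (Fin m × Fin m → ℝ),
          HasEFOfSize (corPolytopeGraph (⊤ : SimpleGraph (Fin m)) + convexHull ℝ (Set.range q')) r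

end Summit.ValiantsHypothesis.ValiantsHypothesis.Cruxes.NNDivisionHard.VirtualPassenger.Blocks38


/-! # §2e CLASS E♭ currency (val-idea-40 g3's `ExposedFibre.lean` rev 3 §0–§1 statements; proofs BY CITATION of ✓ p673124 since rev 17) -/

namespace Summit.ValiantsHypothesis.ValiantsHypothesis.Cruxes.NNDivisionHard.VirtualPassenger.ExposedFibre40

open Matrix Finset
open scoped Pointwise
open Literature.Barriers.PneNP (HasEFOfSize)
open Literature.Combinatorics.Optimization (corPolytopeGraph corVec)
open Summit.ValiantsHypothesis.ValiantsHypothesis.Theorems.FifoMatching.LocatedFaceExposure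
open Summit.ValiantsHypothesis.ValiantsHypothesis.Theorems.FifoMatching.XcDivision

variable {n m : ℕ}

/-! ## §0 Currency (verbatim shapes of the line / of 41 g3's `FaceBlind41`) -/

/-- a `0/1` vector constant on the blocks of `β` (these index the vertices of the contraction face `F_β ≅ COR(K_m)`). -/
def BlockConst (β : Fin n → Fin m) (b : Fin n → Bool) : Prop := ∀ p q, β p = β q → b p = b q

/-- (line, verbatim) a symmetric, `β`-block-constant matrix direction — the elements of `W_β`. -/
def BlockConstSymGen (β : Fin n → Fin m) (g : Fin n × Fin n → ℝ) : Prop :=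
  (∀ p p', g (p, p') = g (p', p)) ∧ ∀ p p' p'' p''', β p = β p'' → β p' = β p''' → g (p, p') = g (p'', p''')

/-- the all-ones direction `J`. -/
def Jdir (n : ℕ) : Fin n × Fin n → ℝ := fun _ => 1

/-- **ADMISSIBLE (located) direction** for the contraction face `F_β`: a linear functional that vanishes on the
block-constant vertices of `COR(K_n)` and is strictly negative on every other vertex — so `COR(K_n) ∩ {c = 0} = F_β`.
`C₀^β` (the engine's `blockDir`) is one (`admissible_blockDir`); so is `C₀^β + ε d` for every `d ⊥ W_β`, `ε` small. -/
def Admissible (β : Fin n → Fin m) (c : Fin n × Fin n → ℝ) : Prop :=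
  (∀ b, BlockConst β b → c ⬝ᵥ corVec (⊤ : SimpleGraph (Fin n)) b = 0) ∧
  (∀ b, ¬ BlockConst β b → c ⬝ᵥ corVec (⊤ : SimpleGraph (Fin n)) b < 0)

/-- the engine's direction `C₀^β` is admissible (from the landed G1 lemmas). -/
theorem admissible_blockDir (β : Fin n → Fin m) : ∃ c : Fin n × Fin n → ℝ, Admissible β c := by
  obtain ⟨B, hB⟩ := exists_blockDir (n := n) (m := m) β
  refine ⟨B, fun b hb => dot_eq_zero_of_blockConst β hB hb, fun b hb => ?_⟩
  rcases (blockDir_dot_corVec_le β hB b).lt_or_eq with h | h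
  · exact h
  · exact absurd (blockConst_of_dot_eq_zero β hB h) hb

/-! ## §1 The class `E♭` and the one-cut rung -/

/-- **CLASS E♭ — EXPOSED-FIBRE-BLIND.**  Some admissible direction `c` whose maximisers among the generators
`q j` pairwise differ by multiples of `J`: the fibre of `conv q` over ONE `𝒩_β`-exposed vertex of the shadow is a
`J`-segment.  (E asks this of ALL block-constant differences, E♯ of all block-constant EDGE directions.) -/
def ExposedFibreBlind (β : Fin n → Fin m) {J : Type} (q : J → (Fin n × Fin n → ℝ)) : Prop :=
  ∃ c : Fin n × Fin n → ℝ, Admissible β c ∧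
    ∀ j j', (∀ k, c ⬝ᵥ q k ≤ c ⬝ᵥ q j) → (∀ k, c ⬝ᵥ q k ≤ c ⬝ᵥ q j') → ∃ α : ℝ, q j - q j' = α • Jdir n

/-- **ONE-CUT RUNG** (PROVED below, `exposedFibreRung_holds`: `face_add_face₁` ONCE with the admissible `c` —
`COR ∩ {c = 0} = F_β` by `XcDivision.convexHull_range_inter_eq` + `Admissible` —, then `funLeft_image_cor_blockFace`,
`convexHull_collinear_pair`; no `blockRead_iterate`).  `m` free, as in the landed rung. -/
def ExposedFibreRung : Prop :=
  ∀ (n m : ℕ) (β : Fin n → Fin m) (ρ : Fin m → Fin n), (∀ t, β (ρ t) = t) →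
    ∀ (K : ℕ) (q : Fin (K + 1) → (Fin n × Fin n → ℝ)) (r : ℕ),
      ExposedFibreBlind β q →
      HasEFOfSize (corPolytopeGraph (⊤ : SimpleGraph (Fin n)) + convexHull ℝ (Set.range q)) r →
        ∃ q' : Fin 2 → (Fin m × Fin m → ℝ),
          HasEFOfSize (corPolytopeGraph (⊤ : SimpleGraph (Fin m)) + convexHull ℝ (Set.range q')) r

/-- … hence (PROP A at `K + 1 = 2`, `corPolytopeGraph_top_add_hull_three_pow_le`) the count `3^m ≤ (r+1)·2^(m+1)`
for every `E♭`-certified block map with `m` blocks — at `m = lvl n + 1` the line's rate, at `m = 2(log₂ n + c)^c + 4`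
already the route's rate `T c n < r`. -/
def ExposedFibreDecided : Prop :=
  ∀ (n m : ℕ) (β : Fin n → Fin m) (ρ : Fin m → Fin n), (∀ t, β (ρ t) = t) →
    ∀ (K : ℕ) (q : Fin (K + 1) → (Fin n × Fin n → ℝ)) (r : ℕ),
      ExposedFibreBlind β q →
      HasEFOfSize (corPolytopeGraph (⊤ : SimpleGraph (Fin n)) + convexHull ℝ (Set.range q)) r →
        3 ^ m ≤ (r + 1) * 2 ^ (m + 1)

/-- `E ⊆ E♭` (kernel food: take `c := C₀^β + ε d` with `d ⊥ W_β` generic — `DimensionRung40.exists_generic_comb` —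
so that all maximiser differences are block-constant, then apply the `E`-hypothesis).  `E♯ ⊆ E♭` is the same
argument applied to the iterated-argmax set the engine visits. -/
def BlockBlind_sub_ExposedFibreBlind : Prop :=
  ∀ (n m : ℕ) (β : Fin n → Fin m) (K : ℕ) (q : Fin (K + 1) → (Fin n × Fin n → ℝ)),
    (∀ j j', BlockConstSymGen β (q j - q j') → ∃ α : ℝ, q j - q j' = α • Jdir n) → ExposedFibreBlind β q


/-! ### §1b The one-cut rung — PROVED; since rev 17 BY CITATION of val-port-4 g3's Theorems port of this very file (✓ p673124
`Theorems/FifoMatchingNNDivisionHardExposedFibreRung.lean`, ns `…Theorems.FifoMatching.ExposedFibre`; the port δ-unfolds the currency, so the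
pasted closed Props are proved by the ported theorems as one-line terms, defeq — 40 g4's `PasteCompatTest`). -/

/-- ★ THE ONE-CUT RUNG HOLDS (tree `ExposedFibre.exposedFibreRung_holds`, by name). -/
theorem exposedFibreRung_holds : ExposedFibreRung :=
  Summit.ValiantsHypothesis.ValiantsHypothesis.Theorems.FifoMatching.ExposedFibre.exposedFibreRung_holds

/-- ★ … hence the count (tree `ExposedFibre.exposedFibreDecided_holds`, by name): `3^m ≤ (r+1)·2^(m+1)`. -/
theorem exposedFibreDecided_holds : ExposedFibreDecided :=
  Summit.ValiantsHypothesis.ValiantsHypothesis.Theorems.FifoMatching.ExposedFibre.exposedFibreDecided_holds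

end Summit.ValiantsHypothesis.ValiantsHypothesis.Cruxes.NNDivisionHard.VirtualPassenger.ExposedFibre40

/-! # §2g CLASS L currency (rev 16, val-idea-42 g2 — lens «restricted-Q law first»): BRAID-COARSE passengers
The passengers of every catalogued ONE-DIVISION COLLAPSE (FGK star–mesh identities; Jukna Thm 6.1 / Rem. 6.3) are Newton polytopes of products
of nonnegative linear forms = sums of scaled coordinate simplices (generalized permutohedra of the pair coordinates): every coordinate-injective
functional has ONE maximiser.  A generic admissible cut is coordinate-injective (`exists_admissible_injective`), so L ⊆ E♭ (zero fibre). -/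

namespace Summit.ValiantsHypothesis.ValiantsHypothesis.Cruxes.NNDivisionHard.VirtualPassenger.Braid42

open Literature.Combinatorics.Optimization (corPolytopeGraph corVec)
open Summit.ValiantsHypothesis.ValiantsHypothesis.Theorems.FifoMatching.LocatedFaceExposure
  (exists_blockDir blockDir_dot_corVec_le blockConst_of_dot_eq_zero dot_eq_zero_of_blockConst)
open Summit.ValiantsHypothesis.ValiantsHypothesis.Theorems.FifoMatching.XcDivision (corVec_top_apply)
open Summit.ValiantsHypothesis.ValiantsHypothesis.Theorems.FifoMatching.LowDim (exists_generic_comb exists_large_avoid)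
open ExposedFibre40 (BlockConst Admissible ExposedFibreBlind Jdir)

variable {n m : ℕ}

/-- test direction `e_a − e_{a'}` for two coordinates in the same (unordered) `β`-block pair, else `0`; all lie in `W_β^⊥`. -/
def testVec (β : Fin n → Fin m) (k : (Fin n × Fin n) × (Fin n × Fin n)) : Fin n × Fin n → ℝ :=
  if (β k.1.1 = β k.2.1 ∧ β k.1.2 = β k.2.2) ∨ (β k.1.1 = β k.2.2 ∧ β k.1.2 = β k.2.1) then
    Pi.single k.1 1 - Pi.single k.2 1 else 0

theorem corVec_eq_of_samePart (β : Fin n → Fin m) {b : Fin n → Bool} (hb : BlockConst β b) {a a' : Fin n × Fin n}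
    (h : (β a.1 = β a'.1 ∧ β a.2 = β a'.2) ∨ (β a.1 = β a'.2 ∧ β a.2 = β a'.1)) :
    corVec (⊤ : SimpleGraph (Fin n)) b a = corVec (⊤ : SimpleGraph (Fin n)) b a' := by
  obtain ⟨p, q⟩ := a
  obtain ⟨p', q'⟩ := a'
  rw [corVec_top_apply, corVec_top_apply]
  rcases h with ⟨h1, h2⟩ | ⟨h1, h2⟩
  · rw [hb p p' h1, hb q q' h2]
  · rw [hb p q' h1, hb q p' h2, mul_comm]

theorem testVec_dot_corVec (β : Fin n → Fin m) (k : (Fin n × Fin n) × (Fin n × Fin n)) {b : Fin n → Bool}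
    (hb : BlockConst β b) : testVec β k ⬝ᵥ corVec (⊤ : SimpleGraph (Fin n)) b = 0 := by
  unfold testVec
  split_ifs with h
  · rw [sub_dotProduct, single_dotProduct, single_dotProduct, one_mul, one_mul, corVec_eq_of_samePart β hb h, sub_self]
  · exact zero_dotProduct _

/-- every pair of distinct coordinates is SEPARATED by some test direction (blocks of size ≥ 2). -/
theorem testVec_separates (β : Fin n → Fin m) (hβ : ∀ p : Fin n, ∃ p', p' ≠ p ∧ β p' = β p)
    {a a' : Fin n × Fin n} (hne : a ≠ a') : ∃ k, testVec β k a - testVec β k a' ≠ 0 := by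
  classical
  by_cases hs : (β a.1 = β a'.1 ∧ β a.2 = β a'.2) ∨ (β a.1 = β a'.2 ∧ β a.2 = β a'.1)
  · refine ⟨(a, a'), ?_⟩
    have ht : testVec β (a, a') = Pi.single a 1 - Pi.single a' 1 := if_pos hs
    rw [ht]
    simp only [Pi.sub_apply, Pi.single_apply, if_true, if_neg hne.symm, if_neg hne]
    norm_num
  · obtain ⟨p', hp', hβp'⟩ := hβ a.1
    have hb : ((p', a.2) : Fin n × Fin n) ≠ a := fun h => hp' (by rw [← h])
    have hba' : ((p', a.2) : Fin n × Fin n) ≠ a' := by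
      rintro rfl
      exact hs (Or.inl ⟨hβp'.symm, rfl⟩)
    refine ⟨(a, (p', a.2)), ?_⟩
    have hpart : (β a.1 = β p' ∧ β a.2 = β a.2) ∨ (β a.1 = β a.2 ∧ β a.2 = β p') := Or.inl ⟨hβp'.symm, rfl⟩
    have ht : testVec β (a, (p', a.2)) = Pi.single a 1 - Pi.single (p', a.2) 1 := if_pos hpart
    rw [ht]
    simp only [Pi.sub_apply, Pi.single_apply, if_true, if_neg hb.symm, if_neg hne.symm, if_neg hba'.symm]
    norm_num

/-- scaling: finitely many `α M + γ` with `α < 0` are all negative for `M` large. -/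
theorem exists_scale_neg (s : Finset (ℝ × ℝ)) (hs : ∀ p ∈ s, p.1 < 0) :
    ∃ M₀ : ℝ, ∀ M, M₀ ≤ M → ∀ p ∈ s, p.1 * M + p.2 < 0 := by
  refine ⟨1 + ∑ p ∈ s, |p.2 / p.1|, fun M hM p hp => ?_⟩
  have h1 : p.1 < 0 := hs p hp
  have hle : |p.2 / p.1| ≤ ∑ p ∈ s, |p.2 / p.1| :=
    Finset.single_le_sum (f := fun p : ℝ × ℝ => |p.2 / p.1|) (fun p _ => abs_nonneg _) hp
  have hge : -|p.2 / p.1| ≤ p.2 / p.1 := neg_abs_le _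
  have hpos : 0 < M + p.2 / p.1 := by linarith
  have h0 : p.1 ≠ 0 := h1.ne
  have hmul : p.1 * (p.2 / p.1) = p.2 := by field_simp
  rw [show p.1 * M + p.2 = p.1 * (M + p.2 / p.1) by rw [mul_add, hmul]]
  exact mul_neg_of_neg_of_pos h1 hpos

/-- ★ GENERICITY: if every `β`-block has two elements, some ADMISSIBLE direction is COORDINATE-INJECTIVE
(`c = M•C₀^β + Σ_k ε_k (e_a − e_{a'})_k`, tree `exists_generic_comb` / `exists_large_avoid`). -/
theorem exists_admissible_injective (β : Fin n → Fin m) (hβ : ∀ p : Fin n, ∃ p', p' ≠ p ∧ β p' = β p) :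
    ∃ c : Fin n × Fin n → ℝ, Admissible β c ∧ Function.Injective c := by
  classical
  obtain ⟨B, hB⟩ := exists_blockDir (n := n) (m := m) β
  -- a generic element `d` of `W_β^⊥` with pairwise distinct coordinates
  let T : Finset ((Fin n × Fin n) × (Fin n × Fin n)) := Finset.univ.filter fun e => e.1 ≠ e.2
  obtain ⟨ε, hε⟩ := exists_generic_comb T (fun k e => testVec β k e.1 - testVec β k e.2)
  let d : Fin n × Fin n → ℝ := ∑ k, ε k • testVec β k
  have hd_app : ∀ a, d a = ∑ k, ε k * testVec β k a := fun a => by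
    simp only [d, Finset.sum_apply, Pi.smul_apply, smul_eq_mul]
  have hdW : ∀ b, BlockConst β b → d ⬝ᵥ corVec (⊤ : SimpleGraph (Fin n)) b = 0 := by
    intro b hb
    simp only [d, sum_dotProduct, smul_dotProduct, testVec_dot_corVec β _ hb, smul_zero, Finset.sum_const_zero]
  have hdinj : ∀ a a', a ≠ a' → d a ≠ d a' := by
    intro a a' hne heq
    have hT : (a, a') ∈ T := Finset.mem_filter.2 ⟨Finset.mem_univ _, hne⟩
    have h := hε (a, a') hT (testVec_separates β hβ hne)
    apply h
    have : ∑ k, ε k * (testVec β k a - testVec β k a') = d a - d a' := by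
      rw [hd_app, hd_app, ← Finset.sum_sub_distrib]
      refine Finset.sum_congr rfl fun k _ => by ring
    rw [this, heq, sub_self]
  -- negativity scale
  have hBneg : ∀ b, ¬ BlockConst β b → B ⬝ᵥ corVec (⊤ : SimpleGraph (Fin n)) b < 0 := by
    intro b hb
    rcases (blockDir_dot_corVec_le β hB b).lt_or_eq with h | h
    · exact h
    · exact absurd (blockConst_of_dot_eq_zero β hB h) hb
  let s₁ : Finset (ℝ × ℝ) := (Finset.univ.filter fun b => ¬ BlockConst β b).image
    fun b => (B ⬝ᵥ corVec (⊤ : SimpleGraph (Fin n)) b, d ⬝ᵥ corVec (⊤ : SimpleGraph (Fin n)) b)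
  obtain ⟨M₀, hM₀⟩ := exists_scale_neg s₁ (by
    intro p hp
    obtain ⟨b, hb, rfl⟩ := Finset.mem_image.1 hp
    exact hBneg b (Finset.mem_filter.1 hb).2)
  let s₂ : Finset (ℝ × ℝ) := T.image fun e => (B e.1 - B e.2, d e.1 - d e.2)
  obtain ⟨M, hM, hMs⟩ := exists_large_avoid s₂ (by
    intro p hp
    obtain ⟨e, he, rfl⟩ := Finset.mem_image.1 hp
    have hne : e.1 ≠ e.2 := (Finset.mem_filter.1 he).2
    by_cases hBe : B e.1 - B e.2 = 0
    · exact Or.inr (sub_ne_zero.2 (hdinj e.1 e.2 hne))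
    · exact Or.inl hBe) M₀
  refine ⟨M • B + d, ⟨fun b hb => ?_, fun b hb => ?_⟩, fun a a' hc => ?_⟩
  · rw [add_dotProduct, smul_dotProduct, dot_eq_zero_of_blockConst β hB hb, smul_zero, zero_add, hdW b hb]
  · rw [add_dotProduct, smul_dotProduct, smul_eq_mul, mul_comm]
    refine hM₀ M hM.le _ (Finset.mem_image.2 ⟨b, Finset.mem_filter.2 ⟨Finset.mem_univ _, hb⟩, rfl⟩)
  · by_contra hne
    have hT : (a, a') ∈ T := Finset.mem_filter.2 ⟨Finset.mem_univ _, hne⟩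
    have h := hMs _ (Finset.mem_image.2 ⟨(a, a'), hT, rfl⟩)
    apply h
    have hc' : M * B a + d a = M * B a' + d a' := by
      simpa only [Pi.add_apply, Pi.smul_apply, smul_eq_mul] using hc
    show (B a - B a') * M + (d a - d a') = 0
    linarith

/-- **CLASS L — BRAID-COARSE passenger families**: every coordinate-injective functional is maximised over the family at a single
POINT (its normal fan is refined by the braid fan of the pair coordinates). -/
def BraidCoarse (h : ℕ) {J : Type} (q : J → (Fin h × Fin h → ℝ)) : Prop :=
  ∀ c : Fin h × Fin h → ℝ, Function.Injective c →
    ∀ j j', (∀ k, c ⬝ᵥ q k ≤ c ⬝ᵥ q j) → (∀ k, c ⬝ᵥ q k ≤ c ⬝ᵥ q j') → q j = q j'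

/-- ★ `L ⊆ E♭` with the ZERO fibre: braid-coarse families are exposed-fibre-blind for EVERY block map with blocks of size ≥ 2. -/
theorem exposedFibreBlind_of_braidCoarse (β : Fin n → Fin m) (hβ : ∀ p : Fin n, ∃ p', p' ≠ p ∧ β p' = β p)
    {J : Type} (q : J → (Fin n × Fin n → ℝ)) (hq : BraidCoarse n q) : ExposedFibreBlind β q := by
  obtain ⟨c, hc, hinj⟩ := exists_admissible_injective β hβ
  exact ⟨c, hc, fun j j' hj hj' => ⟨0, by rw [hq c hinj j j' hj hj', sub_self, zero_smul]⟩⟩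

/-- braid-coarseness is a property of the point SET: closed under reindexing. -/
theorem BraidCoarse.comp {h : ℕ} {J J' : Type} {q : J → (Fin h × Fin h → ℝ)} (hq : BraidCoarse h q) (e : J' → J)
    (he : Function.Surjective e) : BraidCoarse h (q ∘ e) := by
  intro c hc j j' hj hj'
  refine hq c hc (e j) (e j') (fun k => ?_) (fun k => ?_)
  · obtain ⟨k', rfl⟩ := he k; exact hj k'
  · obtain ⟨k', rfl⟩ := he k; exact hj' k'

/-- ★ **MEMBERS — SIMPLEX SUMS** (`w + Σ_k a_k • e_{φ k}`, `φ` over all choice functions of coordinate sets `S k`): the vertex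
families of every sum of scaled coordinate simplices — Newton polytopes of (monomial ×) PRODUCTS OF NONNEGATIVE LINEAR FORMS, i.e.
every FGK / star–mesh denominator `Π_A (Σ_{i∈A} x_{i n})^{a_A}` — are braid-coarse. -/
theorem braidCoarse_simplexSum {h N : ℕ} (S : Fin N → Finset (Fin h × Fin h)) (a : Fin N → ℝ) (ha : ∀ k, 0 ≤ a k)
    (w : Fin h × Fin h → ℝ) :
    BraidCoarse h (fun φ : ((k : Fin N) → S k) =>
      w + ∑ k, a k • (Pi.single ((φ k : Fin h × Fin h)) (1 : ℝ) : Fin h × Fin h → ℝ)) := by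
  classical
  intro c hc φ φ' hφ hφ'
  -- the value of `c` on the family
  have hval : ∀ ψ : ((k : Fin N) → S k),
      c ⬝ᵥ (w + ∑ k, a k • (Pi.single ((ψ k : Fin h × Fin h)) (1 : ℝ) : Fin h × Fin h → ℝ)) =
        c ⬝ᵥ w + ∑ k, a k * c (ψ k) := by
    intro ψ
    rw [dotProduct_add, dotProduct_sum]
    refine congrArg _ (Finset.sum_congr rfl fun k _ => ?_)
    rw [dotProduct_smul, dotProduct_single, mul_one, smul_eq_mul]
  -- exchange: improving one coordinate of a maximiser is impossible
  have hexch : ∀ ψ ψ' : ((k : Fin N) → S k), (∀ χ : ((k : Fin N) → S k),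
      c ⬝ᵥ (w + ∑ k, a k • (Pi.single ((χ k : Fin h × Fin h)) (1 : ℝ) : Fin h × Fin h → ℝ)) ≤
      c ⬝ᵥ (w + ∑ k, a k • (Pi.single ((ψ k : Fin h × Fin h)) (1 : ℝ) : Fin h × Fin h → ℝ))) →
      ∀ k, a k ≠ 0 → c (ψ' k) ≤ c (ψ k) := by
    intro ψ ψ' hψ k hak
    by_contra hlt
    push Not at hlt
    have h1 := hψ (Function.update ψ k (ψ' k))
    rw [hval, hval] at h1
    have h2 : ∑ k', a k' * c ((Function.update ψ k (ψ' k) k' : Fin h × Fin h)) - ∑ k', a k' * c (ψ k') =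
        a k * (c (ψ' k) - c (ψ k)) := by
      rw [← Finset.sum_sub_distrib, Finset.sum_eq_single k]
      · rw [Function.update_self]; ring
      · intro k' _ hk'
        rw [Function.update_of_ne hk', sub_self]
      · intro hk; exact absurd (Finset.mem_univ k) hk
    have hpos : 0 < a k * (c (ψ' k) - c (ψ k)) := mul_pos ((ha k).lt_of_ne (Ne.symm hak)) (by linarith)
    linarith
  -- hence both maximisers choose the same coordinate wherever the weight is nonzero
  have hcoord : ∀ k, a k ≠ 0 → (φ k : Fin h × Fin h) = φ' k := by
    intro k hak
    by_contra hne
    have h1 := hexch φ φ' hφ k hak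
    have h2 := hexch φ' φ hφ' k hak
    exact hne (hc (le_antisymm h2 h1))
  simp only
  refine congrArg _ (Finset.sum_congr rfl fun k _ => ?_)
  by_cases hak : a k = 0
  · rw [hak, zero_smul, zero_smul]
  · rw [hcoord k hak]

end Summit.ValiantsHypothesis.ValiantsHypothesis.Cruxes.NNDivisionHard.VirtualPassenger.Braid42



/-! # §2d (the `BlockRead` engine of revs 3–11: E by iterated faces) — DELETED in rev 12 (byte cap); superseded since rev 8 by the landed … ⟨abr.⟩ -/


/-! ### §3g CLASS K / K_θ / K^aff_θ — PORTED in rev 20 (byte relief, −46 KB): ✓ `Theorems/FifoMatchingNNDivisionHardMaxCutLP.lean` →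
`…MaxCutLPKMR.lean` → `…MaxCutLPBridge.lean` → `…MaxCutLPDecided.lean` (namespace `…Theorems.FifoMatching.MaxCutLP`, val-idea-43 g2/g3's
`maxcut-relaxation` kernel verbatim: `CutDominant`, `GapThin`, `AffThin`, `MaxCutLPApproxHard`, `maxCutLPApproxHard_holds` (KMR 2017 Cor. 1.5,
unconditional), `maxCutLPHard_of_approx`, `cutDominant_decided`, `gapThin_decided`, `affThin_decided_holds`); cited below as
`Theorems.FifoMatching.MaxCutLP.X` (formerly the inlined namespace `…VirtualPassenger.MaxCutLP43`). -/

/-! # §3 The partition skeleton (line namespace) -/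

namespace Summit.ValiantsHypothesis.ValiantsHypothesis.Cruxes.NNDivisionHard.VirtualPassenger

open scoped NNReal Pointwise
open Literature.Barriers.PneNP (HasEFOfSize)
open Literature.Combinatorics.Optimization (corPolytopeGraph corVec)
open Summit.ValiantsHypothesis.ValiantsHypothesis.Theorems.FifoMatching.XcDivision
open Summit.ValiantsHypothesis.ValiantsHypothesis.Cruxes.NNLinearDegreeCofactorHard.XcDivision (T T_pow_four_le)
open Summit.ValiantsHypothesis.ValiantsHypothesis.Cruxes.NNLinearDegreeCofactorHard.XcDivision.VPLine
  (CorVirtualHard nnDivisionHard_of_corVirtual)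
open Summit.ValiantsHypothesis.ValiantsHypothesis.Theorems.FifoMatching.VirtualPassengerGadget (gadgetSpan gadget_rigidity genericGadgetRead_holds HasGadgetPattern indexSupport SparseEdgePassengerLaw)

/-- the read level at scale `h`: gadgets on `lvl h + 1` u-slots, `lvl h + 2 = ⌊√h⌋`. -/
def lvl (h : ℕ) : ℕ := Nat.sqrt h - 2

/-- **CLASS A⁺ — GADGET-BLIND passenger families**: some placement `ι` of the `(lvl h + 1)`-gadget sees no consistent vertex
difference with a live AND-slot diagonal entry. -/
def GadgetBlind (h : ℕ) {J : Type} (q : J → (Fin h × Fin h → ℝ)) : Prop :=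
  ∃ ι : Fin (lvl h + 1) ⊕ (Fin (lvl h + 1) × Fin (lvl h + 1)) ↪ Fin h,
    ∀ j j', q j - q j' ∈ gadgetSpan ι → ∀ g : Fin (lvl h + 1) × Fin (lvl h + 1), g.1 ≠ g.2 →
      (q j - q j') (wSlot ι g, wSlot ι g) = 0

/-- **CLASS B — SPARSE-DIFFERENCE passenger families**: every vertex difference touches `≤ log₂ log₂ h` indices. -/
def SparseDiff (h : ℕ) {J : Type} (q : J → (Fin h × Fin h → ℝ)) : Prop :=
  ∀ j j', (indexSupport (q j - q j')).card ≤ Nat.log 2 (Nat.log 2 h)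

/-- what ¬A⁺ says (PROVED reading): EVERY placement of the gadget sees a consistent difference with a live AND-diagonal. -/
theorem not_gadgetBlind_iff (h : ℕ) {J : Type} (q : J → (Fin h × Fin h → ℝ)) :
    ¬ GadgetBlind h q ↔ ∀ ι : Fin (lvl h + 1) ⊕ (Fin (lvl h + 1) × Fin (lvl h + 1)) ↪ Fin h,
      ∃ j j', q j - q j' ∈ gadgetSpan ι ∧ ∃ g : Fin (lvl h + 1) × Fin (lvl h + 1), g.1 ≠ g.2 ∧
        (q j - q j') (wSlot ι g, wSlot ι g) ≠ 0 := by
  unfold GadgetBlind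
  push Not
  rfl

/-- … and each such difference then CARRIES THE NONZERO EQUAL-ENTRY GADGET PATTERN (`gadget_rigidity`). -/
theorem hasGadgetPattern_of_live {h m : ℕ} (ι : Fin m ⊕ (Fin m × Fin m) ↪ Fin h) {d : Fin h × Fin h → ℝ}
    (hd : d ∈ gadgetSpan ι) {g : Fin m × Fin m} (hg : g.1 ≠ g.2) (hlive : d (wSlot ι g, wSlot ι g) ≠ 0) :
    HasGadgetPattern d := by
  obtain ⟨h1, h2, h3⟩ := gadget_rigidity ι hd g hg
  refine ⟨uSlot ι g.1, uSlot ι g.2, wSlot ι g, ?_, ?_, ?_, hlive, h1, h2, h3⟩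
  · exact fun e => hg (Sum.inl_injective (ι.injective e))
  · exact fun e => Sum.inl_ne_inr (ι.injective e)
  · exact fun e => Sum.inl_ne_inr (ι.injective e)

open Literature.Combinatorics.Optimization.FixedSizePsdRank (corPolytope flat) in
/-- ★ **CLASS A⁺ IS DECIDED (PROVED)**: a gadget-blind family has `(3/2)^{lvl h} ≤ xc(COR(K_h) + conv q) + 1`. -/
theorem gadgetBlind_three_halves_pow_le (h : ℕ) {J : Type} [Fintype J] [Nonempty J]
    (q : J → (Fin h × Fin h → ℝ)) (r : ℕ) (hA : GadgetBlind h q)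
    (hEF : HasEFOfSize (corPolytopeGraph (⊤ : SimpleGraph (Fin h)) + convexHull ℝ (Set.range q)) r) :
    (3 / 2 : ℝ) ^ ((lvl h : ℕ) : ℝ) ≤ r + 1 := by
  classical
  obtain ⟨ι, hι⟩ := hA
  obtain ⟨J', hJ'ne, hall, hEF'⟩ := genericGadgetRead_holds ι q r hEF
  obtain ⟨j₁, hj₁⟩ := hJ'ne
  -- the read passenger is `y₀ +` diagonal
  have hQ'diag : ∀ y ∈ convexHull ℝ ((fun j => diagRead ι (q j)) '' (J' : Set J)),
      ∀ i i' : Fin (lvl h + 1), i ≠ i' → y (i, i') = diagRead ι (q j₁) (i, i') := by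
    intro y hy
    refine (convexHull_min ?_ ?_ : convexHull ℝ ((fun j => diagRead ι (q j)) '' (J' : Set J)) ⊆
      {y | ∀ i i' : Fin (lvl h + 1), i ≠ i' → y (i, i') = diagRead ι (q j₁) (i, i')}) hy
    · rintro _ ⟨j, hj, rfl⟩ i i' hii'
      have hpos : slotPos ι (i, i') = (wSlot ι (i, i'), wSlot ι (i, i')) := by simp [slotPos, hii']
      have hd := hι j j₁ (hall j hj j₁ hj₁) (i, i') hii'
      rw [Pi.sub_apply, sub_eq_zero] at hd
      show diagRead ι (q j) (i, i') = diagRead ι (q j₁) (i, i')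
      rw [diagRead_apply, diagRead_apply, hpos]
      exact hd
    · intro y hy z hz a b _ _ hab i i' hii'
      simp only [Set.mem_setOf_eq] at hy hz
      simp only [Pi.add_apply, Pi.smul_apply, smul_eq_mul, hy i i' hii', hz i i' hii']
      rw [← add_mul, hab, one_mul]
  -- flatten to the `corPolytope` currency
  let e : (Fin (lvl h + 1) × Fin (lvl h + 1) → ℝ) ≃ₗ[ℝ] (Fin ((lvl h + 1) * (lvl h + 1)) → ℝ) :=
    LinearEquiv.funCongrLeft ℝ ℝ (finProdFinEquiv (m := lvl h + 1) (n := lvl h + 1)).symm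
  have himg : e '' (corPolytopeGraph (⊤ : SimpleGraph (Fin (lvl h + 1))) +
      convexHull ℝ ((fun j => diagRead ι (q j)) '' (J' : Set J))) =
      corPolytope (lvl h + 1) + e '' convexHull ℝ ((fun j => diagRead ι (q j)) '' (J' : Set J)) := by
    rw [Set.image_add, Literature.Barriers.PneNP.corPolytope_eq_image_corPolytopeGraph_top]
  have hEF'' : HasEFOfSize (corPolytope (lvl h + 1) +
      e '' convexHull ℝ ((fun j => diagRead ι (q j)) '' (J' : Set J))) r := by
    rw [← himg]
    exact (HasEFOfSize.image_linearEquiv_iff e).2 hEF'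
  have hy₀Q : e (diagRead ι (q j₁)) ∈ e '' convexHull ℝ ((fun j => diagRead ι (q j)) '' (J' : Set J)) :=
    ⟨_, subset_convexHull ℝ _ ⟨j₁, hj₁, rfl⟩, rfl⟩
  have hdiag : ∀ y ∈ e '' convexHull ℝ ((fun j => diagRead ι (q j)) '' (J' : Set J)),
      ∃ σ : Fin (lvl h + 1) → ℝ, y = e (diagRead ι (q j₁)) + flat (Matrix.diagonal σ) := by
    rintro _ ⟨y, hy, rfl⟩
    refine ⟨fun i => y (i, i) - diagRead ι (q j₁) (i, i), ?_⟩
    funext p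
    simp only [e, Pi.add_apply, flat, LinearEquiv.funCongrLeft_apply, LinearMap.funLeft_apply]
    generalize finProdFinEquiv.symm p = ab
    obtain ⟨a, b⟩ := ab
    by_cases hab : a = b
    · subst hab
      simp
    · rw [Matrix.diagonal_apply_ne _ hab, add_zero]
      exact hQ'diag y hy a b hab
  have hD0 := Theorems.FifoMatching.XcDivision.corPolytope_succ_add_diag_three_pow_le hEF'' hy₀Q hdiag
  rw [Real.rpow_natCast, div_pow, div_le_iff₀ (by positivity)]
  exact_mod_cast hD0

/-- pattern-free ⇒ gadget-blind (so CLASS A⁺ contains LAW_generic's class), whenever a placement exists. -/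
theorem gadgetBlind_of_patternFree (h : ℕ) {J : Type} (q : J → (Fin h × Fin h → ℝ))
    (hι : Nonempty (Fin (lvl h + 1) ⊕ (Fin (lvl h + 1) × Fin (lvl h + 1)) ↪ Fin h))
    (hpf : ∀ j j', ¬ HasGadgetPattern (q j - q j')) : GadgetBlind h q := by
  obtain ⟨ι⟩ := hι
  refine ⟨ι, fun j j' hd g hg => ?_⟩
  by_contra hlive
  exact hpf j j' (hasGadgetPattern_of_live ι hd hg hlive)

open Summit.ValiantsHypothesis.ValiantsHypothesis.Theorems.FifoMatching.QueueGridFace (growth_eventually) in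
/-- **the rate of CLASS A⁺ is the route's (PROVED)**: `(3/2)^{lvl h} ≤ r + 1 ⇒ T c h < r` eventually in `h`. -/
theorem rate_of_lvl (c : ℕ) : ∃ h₀ : ℕ, ∀ h ≥ h₀, ∀ r : ℕ, (3 / 2 : ℝ) ^ ((lvl h : ℕ) : ℝ) ≤ 2 * (r + 1) → T c h < r := by
  obtain ⟨r₀, hr₀2, hgrowth⟩ := growth_eventually (4 ^ (c + 1) + c + 1) (c := (1 / 2 : ℝ)) (by norm_num)
  refine ⟨(max r₀ 4 + 3) ^ 2, fun h hh r hr => ?_⟩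
  obtain ⟨s, hs⟩ : ∃ s, s = Nat.sqrt h := ⟨_, rfl⟩
  have hsR : max r₀ 4 + 3 ≤ s := by rw [hs]; exact Nat.le_sqrt'.2 hh
  have hns : h < (s + 1) * (s + 1) := by rw [hs]; exact Nat.lt_succ_sqrt h
  obtain ⟨m, hm⟩ : ∃ m, m = lvl h := ⟨_, rfl⟩
  have hm1 : s = m + 2 := by
    have := le_max_right r₀ 4
    rw [hm, lvl, ← hs]; omega
  have hm4 : 4 ≤ m := by
    have := le_max_right r₀ 4
    omega
  have hmr : r₀ ≤ m := by
    have := le_max_left r₀ 4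
    omega
  rw [hm1] at hns
  have h16 : 4 * 4 ≤ m * m := Nat.mul_le_mul hm4 hm4
  have hsm : (m + 2 + 1) * (m + 2 + 1) ≤ m ^ 4 :=
    calc (m + 2 + 1) * (m + 2 + 1) = (m + 3) * (m + 3) := by ring
      _ ≤ (4 * m) * (4 * m) := Nat.mul_le_mul (by omega) (by omega)
      _ = 16 * (m * m) := by ring
      _ ≤ (m * m) * (m * m) := Nat.mul_le_mul_right _ h16
      _ = m ^ 4 := by ring
  have hn4 : h < m ^ 4 := lt_of_lt_of_le hns hsm
  have hn0 : h ≠ 0 := by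
    have : 0 < (max r₀ 4 + 3) ^ 2 := by positivity
    omega
  have hT := Summit.ValiantsHypothesis.ValiantsHypothesis.Cruxes.NNLinearDegreeCofactorHard.XcDivision.T_pow_four_le (c := c) hn0 hn4
  have hg := hgrowth m hmr
  -- `2 · 2^{(1/2)⌊m/2⌋} ≤ 2^{m/2} ≤ (3/2)^m`
  have hmono : 2 * (2 : ℝ) ^ ((1 / 2 : ℝ) * ((m / 2 : ℕ) : ℝ)) ≤ (2 : ℝ) ^ ((1 / 2 : ℝ) * (m : ℝ)) := by
    have h21 : 2 * (2 : ℝ) ^ ((1 / 2 : ℝ) * ((m / 2 : ℕ) : ℝ)) = (2 : ℝ) ^ (1 + (1 / 2 : ℝ) * ((m / 2 : ℕ) : ℝ)) := by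
      rw [Real.rpow_add (by norm_num), Real.rpow_one]
    rw [h21]
    apply Real.rpow_le_rpow_of_exponent_le (by norm_num)
    have h2 : (((m / 2 : ℕ) : ℝ)) * 2 ≤ (m : ℝ) := by exact_mod_cast Nat.div_mul_le_self m 2
    have h4 : (4 : ℝ) ≤ m := by exact_mod_cast hm4
    linarith
  have hsqrt : (2 : ℝ) ^ (1 / 2 : ℝ) ≤ 3 / 2 := by
    rw [← Real.sqrt_eq_rpow]
    have h2 := Real.sq_sqrt (show (0 : ℝ) ≤ 2 by norm_num)
    nlinarith [Real.sqrt_nonneg 2]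
  have h32 : (2 : ℝ) ^ ((1 / 2 : ℝ) * (m : ℝ)) ≤ (3 / 2 : ℝ) ^ ((m : ℕ) : ℝ) := by
    rw [Real.rpow_mul (by norm_num), Real.rpow_natCast, Real.rpow_natCast]
    exact pow_le_pow_left₀ (by positivity) hsqrt m
  rw [← hm] at hr
  have hT' : ((T (4 ^ (c + 1) + c + 1) m : ℕ) : ℝ) =
      (2 : ℝ) ^ ((Nat.log 2 m + (4 ^ (c + 1) + c + 1)) ^ (4 ^ (c + 1) + c + 1)) := by
    simp [T]
  have hpos : (1 : ℝ) ≤ 4 * (m : ℝ) ^ 4 := by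
    have h1m : (1 : ℝ) ≤ m := by exact_mod_cast (show 1 ≤ m by omega)
    have h14 : (1 : ℝ) ≤ (m : ℝ) ^ 4 := by
      have := pow_le_pow_left₀ zero_le_one h1m 4
      simpa using this
    linarith
  have hr1 : (2 : ℝ) ^ ((1 / 2 : ℝ) * ((m / 2 : ℕ) : ℝ)) ≤ r + 1 := by linarith
  have hlt : ((T (4 ^ (c + 1) + c + 1) m : ℕ) : ℝ) < r := by rw [hT']; linarith
  have hlt' : T (4 ^ (c + 1) + c + 1) m < r := by exact_mod_cast hlt
  calc T c h ≤ (T c h) ^ 4 := Nat.le_self_pow (by norm_num) _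
    _ ≤ T (4 ^ (c + 1) + c + 1) m := hT
    _ < r := hlt'

/-- **CLASS D — DIMENSION-DEFICIENT passenger families**: `dim aff Q ≤ h − lvl h`. -/
def DimDeficient (h : ℕ) {J : Type} (q : J → (Fin h × Fin h → ℝ)) : Prop :=
  Module.finrank ℝ ↥(vectorSpan ℝ (Set.range q)) + lvl h ≤ h

/-- ★ **CLASS D IS DECIDED (PROVED — val-idea-40's DIMENSION RUNG, §2b)**: `(3/2)^{lvl h} ≤ xc + 1`. -/
theorem dimDeficient_three_halves_pow_le (h : ℕ) {J : Type} [Fintype J] [Nonempty J]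
    (q : J → (Fin h × Fin h → ℝ)) (r : ℕ) (hD : DimDeficient h q)
    (hEF : HasEFOfSize (corPolytopeGraph (⊤ : SimpleGraph (Fin h)) + convexHull ℝ (Set.range q)) r) :
    (3 / 2 : ℝ) ^ ((lvl h : ℕ) : ℝ) ≤ r + 1 := by
  classical
  have h40 := Summit.ValiantsHypothesis.ValiantsHypothesis.Theorems.FifoMatching.LowDim.corPolytopeGraph_top_add_hull_three_pow_le_of_finrank
    q hEF
  set d := Module.finrank ℝ ↥(vectorSpan ℝ (Set.range q)) with hd
  have hle : lvl h ≤ h - d := by unfold DimDeficient at hD; omega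
  have h40R : (3 / 2 : ℝ) ^ (h - d) ≤ r + 1 := by
    rw [div_pow, div_le_iff₀ (by positivity)]
    exact_mod_cast h40
  rw [Real.rpow_natCast]
  exact le_trans (pow_le_pow_right₀ (by norm_num) hle) h40R

/-- **CLASS E — BLOCK-BLIND passenger families** (crit-9 L-P1 / ADVISORY #2; «not π-saturating for some coarse π»): some block map
`β : [h] → [lvl h + 1]` with a section sees no symmetric β-block-constant vertex difference other than multiples of `J` — exactly the
hypothesis of val-idea-38's `LocatedFaceExposureRung` at `m = lvl h + 1`. ⟨abr.⟩ -/
def BlockBlind (h : ℕ) {J : Type} (q : J → (Fin h × Fin h → ℝ)) : Prop :=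
  ∃ (β : Fin h → Fin (lvl h + 1)) (ρ : Fin (lvl h + 1) → Fin h), (∀ t, β (ρ t) = t) ∧
    ∀ j j', Blocks38.BlockConstSymGen β (q j - q j') → ∃ α : ℝ, q j - q j' = α • Blocks38.Jdir h

/-- ★ **CLASS E IS DECIDED** (rev 3: the rung `hL` is the THEOREM `locatedFaceExposureRung` of §2d) — PROVED composition: the rung gives
`COR(K_{lvl h+1}) + (segment or point)` with an EF of size `r`, PROP A (`corPolytopeGraph_top_add_hull_three_pow_le`, `K = 2`) gives
`3^{lvl h+1} ≤ 2(r+1)·2^{lvl h+1}`. -/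
theorem blockBlind_three_halves_pow_le (hL : Blocks38.LocatedFaceExposureRung) (h K : ℕ)
    (q : Fin (K + 1) → (Fin h × Fin h → ℝ)) (r : ℕ) (hE : BlockBlind h q)
    (hEF : HasEFOfSize (corPolytopeGraph (⊤ : SimpleGraph (Fin h)) + convexHull ℝ (Set.range q)) r) :
    (3 / 2 : ℝ) ^ ((lvl h : ℕ) : ℝ) ≤ 2 * (r + 1) := by
  obtain ⟨β, ρ, hρ, hal⟩ := hE
  obtain ⟨q', hq'⟩ := hL h (lvl h + 1) β ρ hρ K q r hal hEF
  have hA := Summit.ValiantsHypothesis.ValiantsHypothesis.Cruxes.NNLinearDegreeCofactorHard.XcDivision.corPolytopeGraph_top_add_hull_three_pow_le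
    q' two_pos hq'
  have hAR : (3 / 2 : ℝ) ^ (lvl h + 1) ≤ 2 * (r + 1) := by
    rw [div_pow, div_le_iff₀ (by positivity)]
    have : ((3 ^ (lvl h + 1) : ℕ) : ℝ) ≤ ((2 * (r + 1) * 2 ^ (lvl h + 1) : ℕ) : ℝ) := by exact_mod_cast hA
    push_cast at this
    linarith
  rw [Real.rpow_natCast]
  exact le_trans (pow_le_pow_right₀ (by norm_num) (Nat.le_succ _)) hAR

/-- ★ FORMER STUB E — NOW A THEOREM (rev 3; director R288 target (i) / crit-9 L-P1 CLOSED by val-idea-42): val-idea-38's located-face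
exposure rung, proved by the ITERATED-FACE read (originally §2d `BlockRead`, landed as `Theorems/FifoMatchingNNDivisionHardLocatedFaceExposure.lean`
✓ p660179, cited here by name since rev 8; the in-file copy was deleted in rev 12). -/
theorem locatedFaceExposureRung : Blocks38.LocatedFaceExposureRung :=
  Summit.ValiantsHypothesis.ValiantsHypothesis.Theorems.FifoMatching.LocatedFaceExposure.locatedFaceExposureRung_holds

/-- **CLASS E♭ — EXPOSED-FIBRE-BLIND passenger families** (rev 15 intake of val-idea-40 g3's `ExposedFibre.lean` REV 3, §2e above): some
block map `β : [h] → [lvl h + 1]` with a section and some ADMISSIBLE (`F_β`-locating) direction `c` whose `c`-maximising generators pairwise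
differ by multiples of `J` — ONE cut instead of E's «all block-constant differences in ℝJ». ⟨abr.⟩ -/
def FibreBlind (h : ℕ) {J : Type} (q : J → (Fin h × Fin h → ℝ)) : Prop :=
  ∃ (β : Fin h → Fin (lvl h + 1)) (ρ : Fin (lvl h + 1) → Fin h), (∀ t, β (ρ t) = t) ∧ ExposedFibre40.ExposedFibreBlind β q

/-- constructor form. -/
theorem fibreBlind_of_exposedFibreBlind {h : ℕ} {J : Type} {q : J → (Fin h × Fin h → ℝ)} {β : Fin h → Fin (lvl h + 1)}
    {ρ : Fin (lvl h + 1) → Fin h} (hρ : ∀ t, β (ρ t) = t) (hE : ExposedFibre40.ExposedFibreBlind β q) : FibreBlind h q :=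
  ⟨β, ρ, hρ, hE⟩

/-- ★ **CLASS E♭ IS DECIDED (PROVED — 40 g3's one-cut rung `exposedFibreDecided_holds`, TREE lemmas only)**: `(3/2)^{lvl h} ≤ 2(xc + 1)`. -/
theorem fibreBlind_three_halves_pow_le (h K : ℕ) (q : Fin (K + 1) → (Fin h × Fin h → ℝ)) (r : ℕ) (hE : FibreBlind h q)
    (hEF : HasEFOfSize (corPolytopeGraph (⊤ : SimpleGraph (Fin h)) + convexHull ℝ (Set.range q)) r) :
    (3 / 2 : ℝ) ^ ((lvl h : ℕ) : ℝ) ≤ 2 * (r + 1) := by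
  obtain ⟨β, ρ, hρ, hbl⟩ := hE
  have hA := ExposedFibre40.exposedFibreDecided_holds h (lvl h + 1) β ρ hρ K q r hbl hEF
  have hAR : (3 / 2 : ℝ) ^ (lvl h + 1) ≤ 2 * (r + 1) := by
    rw [div_pow, div_le_iff₀ (by positivity)]
    have h1 : ((3 ^ (lvl h + 1) : ℕ) : ℝ) ≤ (((r + 1) * 2 ^ (lvl h + 1 + 1) : ℕ) : ℝ) := by exact_mod_cast hA
    have e : (((r + 1) * 2 ^ (lvl h + 1 + 1) : ℕ) : ℝ) = 2 * ((r : ℝ) + 1) * 2 ^ (lvl h + 1) := by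
      push_cast; ring
    rw [e] at h1
    exact_mod_cast h1
  rw [Real.rpow_natCast]
  exact le_trans (pow_le_pow_right₀ (by norm_num) (Nat.le_succ _)) hAR



/-! ### §3a″ CLASS L (rev 16): BRAID-COARSE passengers ⊆ E♭, DECIDED -/

/-- the balanced residue block map `p ↦ p mod (lvl h + 1)` (every block has two elements once `2 ≤ h`). -/
def braidβ (h : ℕ) : Fin h → Fin (lvl h + 1) := fun p => ⟨p.val % (lvl h + 1), Nat.mod_lt _ (Nat.succ_pos _)⟩

theorem two_mul_lvl_succ_le {h : ℕ} (hh : 2 ≤ h) : 2 * (lvl h + 1) ≤ h := by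
  unfold lvl
  have hs := Nat.sqrt_le h
  rcases Nat.lt_or_ge (Nat.sqrt h) 2 with h2 | h2
  · have : Nat.sqrt h - 2 = 0 := by omega
    omega
  · have : 2 * (Nat.sqrt h - 2 + 1) ≤ Nat.sqrt h * Nat.sqrt h :=
      calc 2 * (Nat.sqrt h - 2 + 1) ≤ 2 * Nat.sqrt h := by omega
        _ ≤ Nat.sqrt h * Nat.sqrt h := Nat.mul_le_mul_right _ h2
    omega

theorem braidβ_pair {h : ℕ} (hh : 2 ≤ h) (p : Fin h) : ∃ p', p' ≠ p ∧ braidβ h p' = braidβ h p := by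
  have hL := two_mul_lvl_succ_le hh
  by_cases hp : p.val + (lvl h + 1) < h
  · refine ⟨⟨p.val + (lvl h + 1), hp⟩, fun he => ?_, Fin.ext ?_⟩
    · simp only [Fin.ext_iff] at he
      omega
    · simp only [braidβ, Nat.add_mod_right]
  · refine ⟨⟨p.val - (lvl h + 1), by omega⟩, fun he => ?_, Fin.ext ?_⟩
    · simp only [Fin.ext_iff] at he
      omega
    · simp only [braidβ]
      conv_rhs => rw [show p.val = (p.val - (lvl h + 1)) + (lvl h + 1) by omega]
      exact (Nat.add_mod_right _ _).symm

/-- ★ **L ⊆ E♭ (PROVED)**: a braid-coarse family is fibre-blind (`2 ≤ h`; `β = braidβ h`, generic injective admissible cut, ZERO fibre). -/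
theorem fibreBlind_of_braidCoarse {h : ℕ} (hh : 2 ≤ h) {J : Type} {q : J → (Fin h × Fin h → ℝ)}
    (hq : Braid42.BraidCoarse h q) : FibreBlind h q := by
  have hL := two_mul_lvl_succ_le hh
  refine ⟨braidβ h, fun t => ⟨t.val, lt_of_lt_of_le t.isLt (by omega)⟩, fun t => Fin.ext ?_,
    Braid42.exposedFibreBlind_of_braidCoarse (braidβ h) (braidβ_pair hh) q hq⟩
  simp only [braidβ]
  exact Nat.mod_eq_of_lt t.isLt

/-- ★ **CLASS L IS DECIDED (PROVED)**: eventually in `h`, every braid-coarse passenger family costs `> T c h` next to `COR(K_h)`. -/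
theorem braidCoarse_decided (c : ℕ) : ∃ h₀ : ℕ, ∀ h ≥ h₀, ∀ (K : ℕ) (q : Fin (K + 1) → (Fin h × Fin h → ℝ)) (r : ℕ),
    Braid42.BraidCoarse h q → HasEFOfSize (corPolytopeGraph (⊤ : SimpleGraph (Fin h)) + convexHull ℝ (Set.range q)) r →
    T c h < r := by
  obtain ⟨h₁, hh₁⟩ := rate_of_lvl c
  refine ⟨h₁ + 2, fun h hh K q r hq hEF => hh₁ h (by omega) r ?_⟩
  exact fibreBlind_three_halves_pow_le h K q r (fibreBlind_of_braidCoarse (by omega) hq) hEF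

/-- ★ **THE LENS PAYOFF IN THE CRUX'S TERMS (PROVED)**: the SIMPLEX-SUM passengers — Newton polytopes of (monomial ×) products of
nonnegative linear forms, in particular every FGK / star–mesh denominator — are decided: eventually in `h` they cost `> T c h`. -/
theorem simplexSum_decided (c : ℕ) : ∃ h₀ : ℕ, ∀ h ≥ h₀, ∀ (N : ℕ) (S : Fin N → Finset (Fin h × Fin h)), (∀ k, (S k).Nonempty) →
    ∀ (a : Fin N → ℝ), (∀ k, 0 ≤ a k) → ∀ (w : Fin h × Fin h → ℝ) (r : ℕ),
    HasEFOfSize (corPolytopeGraph (⊤ : SimpleGraph (Fin h)) + convexHull ℝ (Set.range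
      fun φ : ((k : Fin N) → S k) => w + ∑ k, a k • (Pi.single (φ k : Fin h × Fin h) (1 : ℝ) : Fin h × Fin h → ℝ))) r →
    T c h < r := by
  classical
  obtain ⟨h₀, hh₀⟩ := braidCoarse_decided c
  refine ⟨h₀, fun h hh N S hS a ha w r hEF => ?_⟩
  haveI : Nonempty ((k : Fin N) → S k) := ⟨fun k => ⟨(hS k).choose, (hS k).choose_spec⟩⟩
  obtain ⟨K, ⟨e⟩⟩ : ∃ K, Nonempty (((k : Fin N) → S k) ≃ Fin (K + 1)) := by
    refine ⟨Fintype.card ((k : Fin N) → S k) - 1, ⟨(Fintype.equivFin _).trans (finCongr ?_)⟩⟩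
    have : 0 < Fintype.card ((k : Fin N) → S k) := Fintype.card_pos
    omega
  have hq := (Braid42.braidCoarse_simplexSum S a ha w).comp e.symm e.symm.surjective
  refine hh₀ h hh K _ r hq ?_
  rwa [Set.range_comp, e.symm.surjective.range_eq, Set.image_univ]

/-! ### §3a‴′ CENSUS LEMMA (rev 18, pen): OFF-DIAGONAL-CONSTANT passenger families — every DIAGONAL passenger, in particular
the wave-6 enemy `Q^Π_λ + W` (diagonal permutahedron, crit-9 22:52:44Z / val-idea-41 g3 N(41-R1)) and `Q^{w*} + W` — are CLASS E -/

/-- ★ **CENSUS LEMMA (PROVED)**: a family all of whose points share their off-diagonal entries is `BlockBlind` once `2 ≤ h`: with the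
balanced block map `braidβ` (blocks of size ≥ 2) a symmetric block-constant difference vanishes on the diagonal too (`g(p,p) = g(p₂,p) = 0`
for the block partner `p₂ ≠ p`), so the only block-constant difference is `0 = 0 • J`.  So the `¬ BlockBlind` binder already excludes
every diagonal passenger (`Q^Π_λ` is moreover CLASS L).  Prior art at the top law: PROP D₀ `XcDivision.corPolytope_succ_add_diag_three_pow_le`. -/
theorem offDiagConst_blockBlind {h : ℕ} (hh : 2 ≤ h) {J : Type} (q : J → (Fin h × Fin h → ℝ))
    (hq : ∀ j j' (p p' : Fin h), p ≠ p' → q j (p, p') = q j' (p, p')) : BlockBlind h q := by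
  have hL := two_mul_lvl_succ_le hh
  refine ⟨braidβ h, fun t => ⟨t.val, lt_of_lt_of_le t.isLt (by omega)⟩, fun t => Fin.ext ?_, fun j j' hg => ⟨0, ?_⟩⟩
  · simp only [braidβ]
    exact Nat.mod_eq_of_lt t.isLt
  · ext ⟨p, p'⟩
    simp only [Pi.sub_apply, Pi.smul_apply, Blocks38.Jdir, smul_eq_mul, zero_mul]
    by_cases hpp : p = p'
    · subst hpp
      obtain ⟨p₂, hne, hβ⟩ := braidβ_pair hh p
      have h2 := hg.2 p p p₂ p hβ.symm rfl
      simp only [Pi.sub_apply] at h2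
      rw [h2]
      simpa [sub_eq_zero] using hq j j' p₂ p hne
    · simpa [sub_eq_zero] using hq j j' p p' hpp

/-- ★ **DIAGONAL PASSENGERS ARE DECIDED (PROVED)**: eventually in `h`, every off-diagonal-constant family costs `> T c h` next to `COR(K_h)`. -/
theorem offDiagConst_decided (c : ℕ) : ∃ h₀ : ℕ, ∀ h ≥ h₀, ∀ (K : ℕ) (q : Fin (K + 1) → (Fin h × Fin h → ℝ)) (r : ℕ),
    (∀ j j' (p p' : Fin h), p ≠ p' → q j (p, p') = q j' (p, p')) →
    HasEFOfSize (corPolytopeGraph (⊤ : SimpleGraph (Fin h)) + convexHull ℝ (Set.range q)) r → T c h < r := by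
  obtain ⟨h₁, hh₁⟩ := rate_of_lvl c
  refine ⟨h₁ + 2, fun h hh K q r hq hEF => hh₁ h (by omega) r ?_⟩
  exact blockBlind_three_halves_pow_le locatedFaceExposureRung h K q r (offDiagConst_blockBlind (by omega) q hq) hEF

/-- ★ **CENSUS LEMMA 2 (PROVED, rev 19.1)**: a family whose points share their DIAGONAL (every ZERO-DIAGONAL passenger: cut / metric / `Q^∘` /
val-idea-38 g2's interaction cube `Q_II`) is CLASS A⁺ once `2 ≤ h` — every difference has a dead diagonal at ANY gadget placement. -/
theorem diagConst_gadgetBlind {h : ℕ} (hh : 2 ≤ h) {J : Type} (q : J → (Fin h × Fin h → ℝ))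
    (hq : ∀ j j' (p : Fin h), q j (p, p) = q j' (p, p)) : GadgetBlind h q := by
  have hcard : (lvl h + 1) + (lvl h + 1) * (lvl h + 1) ≤ h := by
    have hs := Nat.sqrt_le h
    unfold lvl
    rcases Nat.lt_or_ge (Nat.sqrt h) 2 with h2 | h2
    · have h3 : Nat.sqrt h - 2 = 0 := by omega
      rw [h3]
      omega
    · obtain ⟨t, ht⟩ : ∃ t, Nat.sqrt h = t + 2 := ⟨Nat.sqrt h - 2, by omega⟩
      rw [ht] at hs ⊢
      have h3 : t + 2 - 2 + 1 = t + 1 := by omega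
      rw [h3]
      nlinarith
  let e : Fin (lvl h + 1) ⊕ (Fin (lvl h + 1) × Fin (lvl h + 1)) ≃ Fin ((lvl h + 1) + (lvl h + 1) * (lvl h + 1)) :=
    (Equiv.sumCongr (Equiv.refl _) finProdFinEquiv).trans finSumFinEquiv
  refine ⟨e.toEmbedding.trans (Fin.castLEEmb hcard), fun j j' _ g _ => ?_⟩
  rw [Pi.sub_apply, hq j j', sub_self]

/-- ★ COROLLARY (PROVED): every diagonal-constant family obeys the top law (so the wave-7 seed S1 `Q_II` is a C′-question only). -/
theorem diagConst_decided (c : ℕ) : ∃ h₀ : ℕ, ∀ h ≥ h₀, ∀ (K : ℕ) (q : Fin (K + 1) → (Fin h × Fin h → ℝ)) (r : ℕ),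
    (∀ j j' (p : Fin h), q j (p, p) = q j' (p, p)) →
    HasEFOfSize (corPolytopeGraph (⊤ : SimpleGraph (Fin h)) + convexHull ℝ (Set.range q)) r → T c h < r := by
  obtain ⟨h₁, hh₁⟩ := rate_of_lvl c
  refine ⟨h₁ + 2, fun h hh K q r hq hEF =>
    hh₁ h (by omega) r (le_trans (gadgetBlind_three_halves_pow_le h q r (diagConst_gadgetBlind (by omega) q hq) hEF) ?_)⟩
  have h0 : (0 : ℝ) ≤ r := by positivity
  linarith

/-! ### §3a‴ CLASS W (rev 17): SWITCH-EXPOSED families — val-idea-38 g1's SWITCHED-FACE RUNG, now in Theorems (val-port-1 g3 transplant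
✓ p671569 / ✓ p671797 / ✓ p672139 / ✓ p672795 `…Theorems.FifoMatching.SwitchFace`; crit-9 g2 BOOKING B1) — enters BY THEOREM, never as a stub (P-P2b) -/

/-- **CLASS W — SWITCH-EXPOSED passenger families** (the shape of `SwitchFace.SwitchExposed`, stated at size `h`; at `h = n + 1` it is
δ-equal to `SwitchExposed n q`): some index `a`, some functional `C` valid on `COR(K_h)` and tight EXACTLY on the switched face
`F_a = {b : b a}`, with a UNIQUE maximising passenger point (ties only between equal points).  Not inside A⁺ … E♭: `F_a` is not a
contraction face `F_β` and `C` need not be a clique row. -/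
def SwitchLocated (h : ℕ) {K : ℕ} (q : Fin (K + 1) → (Fin h × Fin h → ℝ)) : Prop :=
  ∃ (a : Fin h) (C : Fin h × Fin h → ℝ) (M : ℝ),
    (∀ b : Fin h → Bool, C ⬝ᵥ corVec ⊤ b ≤ M) ∧ (∀ b : Fin h → Bool, C ⬝ᵥ corVec ⊤ b = M ↔ b a = true) ∧
      ∃ j₀, ∀ j, C ⬝ᵥ q j < C ⬝ᵥ q j₀ ∨ q j = q j₀

/-- ★ **CLASS W IS DECIDED (PROVED — the tree theorem `SwitchFace.switchExposed_three_pow_le`, Kaibel–Weltge rate `3^{h-1} ≤ (r+1)·2^{h-1}`)**,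
at the line's rate. -/
theorem switchLocated_three_halves_pow_le (h : ℕ) {K : ℕ} (q : Fin (K + 1) → (Fin h × Fin h → ℝ)) (r : ℕ)
    (hSw : SwitchLocated h q)
    (hEF : HasEFOfSize (corPolytopeGraph (⊤ : SimpleGraph (Fin h)) + convexHull ℝ (Set.range q)) r) :
    (3 / 2 : ℝ) ^ ((lvl h : ℕ) : ℝ) ≤ 2 * (r + 1) := by
  obtain ⟨n, rfl⟩ : ∃ n, h = n + 1 := by
    obtain ⟨a, -⟩ := hSw
    exact ⟨h - 1, by have := a.pos; omega⟩
  have hA : 3 ^ n ≤ (r + 1) * 2 ^ n :=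
    Summit.ValiantsHypothesis.ValiantsHypothesis.Theorems.FifoMatching.SwitchFace.switchExposed_three_pow_le n K q r hSw hEF
  have hAR : (3 / 2 : ℝ) ^ n ≤ r + 1 := by
    rw [div_pow, div_le_iff₀ (by positivity)]
    have : ((3 ^ n : ℕ) : ℝ) ≤ (((r + 1) * 2 ^ n : ℕ) : ℝ) := by exact_mod_cast hA
    push_cast at this
    linarith
  have hlvl : lvl (n + 1) ≤ n := by
    have := Nat.sqrt_le_self (n + 1)
    unfold lvl
    omega
  have hr : (0 : ℝ) ≤ r := by positivity
  rw [Real.rpow_natCast]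
  calc (3 / 2 : ℝ) ^ lvl (n + 1) ≤ (3 / 2 : ℝ) ^ n := pow_le_pow_right₀ (by norm_num) hlvl
    _ ≤ r + 1 := hAR
    _ ≤ 2 * (r + 1) := by linarith

/-! ### §3a⁗ CLASS Z♭ (rev 18): ZONE-BLIND ZONOTOPAL families — val-idea-41 g3's ONE-CUT RUNG FOR ZONOTOPES (`FaceBlind.lean` §11,
crit-9 V#35 P-R1b PAID / V#43), BY IMPORT of val-port-1 g3's Theorems port `…Theorems.FifoMatching.FaceBlind` (parts 1–2) — decided BY THEOREM -/

/-- **CLASS Z♭_c — ZONE-BLIND ZONOTOPAL families at level `m′ = 2(log₂ h + c)^c + 4`** (= `FaceBlind.ZonoGenBlindAt h m′ q`: the hull is a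
zonotope some surjection `β : [h] ↠ [m′]` sees no symmetric block-constant zone of, off `ℝJ`); contains `Π_G`, Π\*, Π♮, `Z_mix`, `Z_s`, every
few-zones zonotope; EXACT predicate, excluded as a DECIDED sub-population only (the COR-free residue is 41's `CovZonoHard`). -/
def ZonoBlind (c h : ℕ) {J : Type} (q : J → (Fin h × Fin h → ℝ)) : Prop :=
  Summit.ValiantsHypothesis.ValiantsHypothesis.Theorems.FifoMatching.FaceBlind.ZonoGenBlindAt h (2 * (Nat.log 2 h + c) ^ c + 4) q

/-- rate arithmetic: `(3/2)^(2L+3) ≤ 2(r+1)` forces `2^L < r` (`L = (log₂ h + c)^c ≥ 1`). -/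
theorem T_lt_of_zonoRate (c h r : ℕ) (hr : (3 / 2 : ℝ) ^ (2 * (Nat.log 2 h + c) ^ c + 4 - 1) ≤ 2 * (r + 1)) : T c h < r := by
  have hL1 : 1 ≤ (Nat.log 2 h + c) ^ c := by
    rcases Nat.eq_zero_or_pos c with rfl | hc
    · simp
    · exact Nat.one_le_pow _ _ (by omega)
  have hexp : 2 * (Nat.log 2 h + c) ^ c + 4 - 1 = 2 * (Nat.log 2 h + c) ^ c + 3 := by omega
  rw [hexp, pow_add, pow_mul, show ((3 : ℝ) / 2) ^ 2 = 9 / 4 by norm_num, show ((3 : ℝ) / 2) ^ 3 = 27 / 8 by norm_num] at hr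
  have h94 : (2 : ℝ) ^ ((Nat.log 2 h + c) ^ c) ≤ (9 / 4 : ℝ) ^ ((Nat.log 2 h + c) ^ c) :=
    pow_le_pow_left₀ (by norm_num) (by norm_num) _
  have h2L : (2 : ℝ) ≤ 2 ^ ((Nat.log 2 h + c) ^ c) := by
    calc (2 : ℝ) = 2 ^ 1 := by norm_num
      _ ≤ 2 ^ ((Nat.log 2 h + c) ^ c) := pow_le_pow_right₀ (by norm_num) hL1
  have key : (2 : ℝ) ^ ((Nat.log 2 h + c) ^ c) < r := by linarith
  show 2 ^ ((Nat.log 2 h + c) ^ c) < r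
  exact_mod_cast key

/-- ★ **CLASS Z♭_c IS DECIDED (PROVED — the tree theorem `FaceBlind.zonoGenBlindAtDecided_holds`, val-idea-41 g3 / val-port-1 g3)**. -/
theorem zonoBlind_decided (c h K : ℕ) (q : Fin (K + 1) → (Fin h × Fin h → ℝ)) (r : ℕ) (hZ : ZonoBlind c h q)
    (hEF : HasEFOfSize (corPolytopeGraph (⊤ : SimpleGraph (Fin h)) + convexHull ℝ (Set.range q)) r) : T c h < r :=
  T_lt_of_zonoRate c h r
    (Summit.ValiantsHypothesis.ValiantsHypothesis.Theorems.FifoMatching.FaceBlind.zonoGenBlindAtDecided_holds h _ K q r hZ hEF)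

/-! ### §3b CLASS B (B ⊆ E; cited from ✓ p661905 `SparseEdgePassenger.sparseEdgePassengerLaw_holds`) -/

/-! ### §3c CLASS F (rev 5; crit-9 ADVISORY #3): COMMON-EXTREMISER families are decided by PROP A♯

If one generator `q j₀` maximises EVERY clique row `udRow a` (`L_a(y) = Σ_{i∈a} y_ii − 2 Σ_{i<j∈a} y_ij`, read in the graph currency through
`finProdFinEquiv`) over the family, then the UDISJ certificate of `COR` survives whole: `3^h ≤ (r+1)·2^h`. ⟨abr.⟩ -/

/-- the clique row `udRow a` in the graph currency `Fin h × Fin h → ℝ`. -/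
noncomputable def udRowG {h : ℕ} (a : Finset (Fin h)) : Fin h × Fin h → ℝ :=
  fun ij => Summit.ValiantsHypothesis.ValiantsHypothesis.Cruxes.NNLinearDegreeCofactorHard.XcDivision.udRow a
    (finProdFinEquiv ij)

/-- **CLASS F — COMMON-EXTREMISER passenger families** (PROP A♯'s hypothesis on the generators): one generator maximises every
clique row over the family. -/
def CommonExtremiser (h : ℕ) {J : Type} (q : J → (Fin h × Fin h → ℝ)) : Prop :=
  ∃ j₀, ∀ (a : Finset (Fin h)) (j : J), udRowG a ⬝ᵥ q j ≤ udRowG a ⬝ᵥ q j₀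

theorem udRow_dotProduct_funCongrLeft {h : ℕ} (a : Finset (Fin h)) (x : Fin h × Fin h → ℝ) :
    Summit.ValiantsHypothesis.ValiantsHypothesis.Cruxes.NNLinearDegreeCofactorHard.XcDivision.udRow a ⬝ᵥ
      (LinearEquiv.funCongrLeft ℝ ℝ (finProdFinEquiv (m := h) (n := h)).symm x) = udRowG a ⬝ᵥ x := by
  unfold udRowG dotProduct
  rw [← (finProdFinEquiv (m := h) (n := h)).sum_comp]
  refine Finset.sum_congr rfl fun ij _ => ?_
  simp [LinearEquiv.funCongrLeft_apply, LinearMap.funLeft_apply]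

/-- ★ **CLASS F IS DECIDED** (PROP A♯ transported to the graph currency): `3^h ≤ (r+1)·2^h`. -/
theorem commonExtremiser_three_pow_le (h : ℕ) {K : ℕ} (q : Fin (K + 1) → (Fin h × Fin h → ℝ)) (r : ℕ)
    (hF : CommonExtremiser h q)
    (hEF : HasEFOfSize (corPolytopeGraph (⊤ : SimpleGraph (Fin h)) + convexHull ℝ (Set.range q)) r) :
    3 ^ h ≤ (r + 1) * 2 ^ h := by
  classical
  obtain ⟨j₀, hj₀⟩ := hF
  let e : (Fin h × Fin h → ℝ) ≃ₗ[ℝ] (Fin (h * h) → ℝ) :=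
    LinearEquiv.funCongrLeft ℝ ℝ (finProdFinEquiv (m := h) (n := h)).symm
  have himg : e '' (corPolytopeGraph (⊤ : SimpleGraph (Fin h)) + convexHull ℝ (Set.range q)) =
      Literature.Combinatorics.Optimization.FixedSizePsdRank.corPolytope h + convexHull ℝ (Set.range (e ∘ q)) := by
    rw [Set.image_add, Literature.Barriers.PneNP.corPolytope_eq_image_corPolytopeGraph_top, Set.range_comp]
    congr 1
    exact e.toLinearMap.image_convexHull (Set.range q)
  have h' : HasEFOfSize (Literature.Combinatorics.Optimization.FixedSizePsdRank.corPolytope h +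
      convexHull ℝ (Set.range (e ∘ q))) r := by
    rw [← himg]; exact (HasEFOfSize.image_linearEquiv_iff e).2 hEF
  refine Summit.ValiantsHypothesis.ValiantsHypothesis.Cruxes.NNLinearDegreeCofactorHard.XcDivision.corPolytope_add_three_pow_le_of_common
    h' (y₀ := e (q j₀)) (subset_convexHull ℝ _ ⟨j₀, rfl⟩) fun a y hy => ?_
  have hgen : ∀ z ∈ Set.range (e ∘ q),
      Summit.ValiantsHypothesis.ValiantsHypothesis.Cruxes.NNLinearDegreeCofactorHard.XcDivision.udRow a ⬝ᵥ z ≤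
      Summit.ValiantsHypothesis.ValiantsHypothesis.Cruxes.NNLinearDegreeCofactorHard.XcDivision.udRow a ⬝ᵥ e (q j₀) := by
    rintro _ ⟨j, rfl⟩
    show _ ⬝ᵥ e (q j) ≤ _
    rw [udRow_dotProduct_funCongrLeft, udRow_dotProduct_funCongrLeft]
    exact hj₀ a j
  exact dot_le_of_mem_convexHull _ _ _ hgen y hy

/-- class F at the line's rate. -/
theorem commonExtremiser_three_halves_pow_le (h : ℕ) {K : ℕ} (q : Fin (K + 1) → (Fin h × Fin h → ℝ)) (r : ℕ)
    (hF : CommonExtremiser h q)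
    (hEF : HasEFOfSize (corPolytopeGraph (⊤ : SimpleGraph (Fin h)) + convexHull ℝ (Set.range q)) r) :
    (3 / 2 : ℝ) ^ ((lvl h : ℕ) : ℝ) ≤ 2 * (r + 1) := by
  have hA := commonExtremiser_three_pow_le h q r hF hEF
  have hAR : (3 / 2 : ℝ) ^ h ≤ r + 1 := by
    rw [div_pow, div_le_iff₀ (by positivity)]
    have : ((3 ^ h : ℕ) : ℝ) ≤ (((r + 1) * 2 ^ h : ℕ) : ℝ) := by exact_mod_cast hA
    push_cast at this
    linarith
  have hlvl : lvl h ≤ h := le_trans (Nat.sub_le _ _) (Nat.sqrt_le_self h)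
  have hr : (0 : ℝ) ≤ r := by positivity
  rw [Real.rpow_natCast]
  calc (3 / 2 : ℝ) ^ lvl h ≤ (3 / 2 : ℝ) ^ h := pow_le_pow_right₀ (by norm_num) hlvl
    _ ≤ r + 1 := hAR
    _ ≤ 2 * (r + 1) := by linarith

/-! ### §3d CLASS G (rev 6): DIAGONAL-FACE-POOR families are decided by PROP A / PROP B (vertex counting on a located face)

PROP B (`corPolytope_add_face_three_pow_le'`, xc_division §5): for disjoint `S, S' ⊆ [h]` the points of the family maximising the signed
diagonal direction `E_S − E_{S'}` span the passenger's face in that direction, the face of `COR` th ⟨abr.⟩ -/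

/-- the signed diagonal direction `E_S − E_{S'}` in the graph currency: `(i, i) ↦ 1` on `S`, `↦ −1` on `S'`, `0` elsewhere. -/
noncomputable def diagDirG {h : ℕ} (S S' : Finset (Fin h)) : Fin h × Fin h → ℝ :=
  fun ij => Summit.ValiantsHypothesis.ValiantsHypothesis.Cruxes.NNLinearDegreeCofactorHard.XcDivision.diagDir S S' (finProdFinEquiv ij)

theorem diagDirG_apply {h : ℕ} (S S' : Finset (Fin h)) (i j : Fin h) :
    diagDirG S S' (i, j) = if i = j then (if i ∈ S then (1 : ℝ) else if i ∈ S' then -1 else 0) else 0 := by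
  unfold diagDirG Summit.ValiantsHypothesis.ValiantsHypothesis.Cruxes.NNLinearDegreeCofactorHard.XcDivision.diagDir Literature.Combinatorics.Optimization.FixedSizePsdRank.flat
  simp only [Equiv.symm_apply_apply, Matrix.diagonal_apply]

/-- **CLASS G — DIAGONAL-FACE-POOR passenger families**: for some disjoint `S, S'`, the distinct points of the family maximising
`E_S − E_{S'}` are covered by a finset `s` with `#s · 3^{lvl h} · 2^m ≤ 3^m · 2^{lvl h}`, `m = h − |S| − |S'|`
(i.e. `#s ≤ 1.5^{m − lvl h}`). -/
def DiagFacePoor (h : ℕ) {J : Type} (q : J → (Fin h × Fin h → ℝ)) : Prop :=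
  ∃ (S S' : Finset (Fin h)) (s : Finset (Fin h × Fin h → ℝ)), Disjoint S S' ∧
    (∀ j, (∀ j', diagDirG S S' ⬝ᵥ q j' ≤ diagDirG S S' ⬝ᵥ q j) → q j ∈ s) ∧
    s.card * 3 ^ lvl h * 2 ^ (h - (S.card + S'.card)) ≤ 3 ^ (h - (S.card + S'.card)) * 2 ^ lvl h

/-- transport of a flat functional to the graph currency (general form of `udRow_dotProduct_funCongrLeft`). -/
theorem dotProduct_funCongrLeft_finProdFinEquiv {h : ℕ} (w : Fin (h * h) → ℝ) (x : Fin h × Fin h → ℝ) :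
    w ⬝ᵥ (LinearEquiv.funCongrLeft ℝ ℝ (finProdFinEquiv (m := h) (n := h)).symm x) =
      (fun ij => w (finProdFinEquiv ij)) ⬝ᵥ x := by
  unfold dotProduct
  rw [← (finProdFinEquiv (m := h) (n := h)).sum_comp]
  refine Finset.sum_congr rfl fun ij _ => ?_
  simp [LinearEquiv.funCongrLeft_apply, LinearMap.funLeft_apply]

/-- ★ **CLASS G IS DECIDED** (PROP B transported to the graph currency, counted over distinct points): `3^{lvl h} ≤ (r+1)·2^{lvl h}`. -/
theorem diagFacePoor_three_pow_le (h : ℕ) {K : ℕ} (q : Fin (K + 1) → (Fin h × Fin h → ℝ)) (r : ℕ)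
    (hG : DiagFacePoor h q)
    (hEF : HasEFOfSize (corPolytopeGraph (⊤ : SimpleGraph (Fin h)) + convexHull ℝ (Set.range q)) r) :
    3 ^ lvl h ≤ (r + 1) * 2 ^ lvl h := by
  classical
  obtain ⟨S, S', s, hSS', hcover, hcard⟩ := hG
  set m := h - (S.card + S'.card) with hm
  let e : (Fin h × Fin h → ℝ) ≃ₗ[ℝ] (Fin (h * h) → ℝ) :=
    LinearEquiv.funCongrLeft ℝ ℝ (finProdFinEquiv (m := h) (n := h)).symm
  have himg : e '' (corPolytopeGraph (⊤ : SimpleGraph (Fin h)) + convexHull ℝ (Set.range q)) =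
      Literature.Combinatorics.Optimization.FixedSizePsdRank.corPolytope h + convexHull ℝ (Set.range (e ∘ q)) := by
    rw [Set.image_add, Literature.Barriers.PneNP.corPolytope_eq_image_corPolytopeGraph_top, Set.range_comp]
    congr 1
    exact e.toLinearMap.image_convexHull (Set.range q)
  have h' : HasEFOfSize (Literature.Combinatorics.Optimization.FixedSizePsdRank.corPolytope h +
      convexHull ℝ (Set.range (e ∘ q))) r := by
    rw [← himg]; exact (HasEFOfSize.image_linearEquiv_iff e).2 hEF
  -- the distinct points of the family, as an index type
  let P : Finset (Fin h × Fin h → ℝ) := Finset.univ.image q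
  haveI : Nonempty ↥P := ⟨⟨q 0, Finset.mem_image_of_mem q (Finset.mem_univ 0)⟩⟩
  let q' : ↥P → (Fin (h * h) → ℝ) := fun p => e p.1
  have hrange : Set.range q' = Set.range (e ∘ q) := by
    ext z
    constructor
    · rintro ⟨p, rfl⟩
      obtain ⟨j, -, hj⟩ := Finset.mem_image.1 p.2
      exact ⟨j, by simp [q', ← hj]⟩
    · rintro ⟨j, rfl⟩
      exact ⟨⟨q j, Finset.mem_image_of_mem q (Finset.mem_univ j)⟩, rfl⟩
  have hq' : ∀ p, q' p ∈ convexHull ℝ (Set.range (e ∘ q)) := fun p =>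
    subset_convexHull ℝ _ (hrange ▸ ⟨p, rfl⟩)
  have hQ : convexHull ℝ (Set.range (e ∘ q)) ⊆ convexHull ℝ (Set.range q') := by rw [hrange]
  obtain ⟨p₀, hmax, hcnt⟩ := Summit.ValiantsHypothesis.ValiantsHypothesis.Cruxes.NNLinearDegreeCofactorHard.XcDivision.corPolytope_add_face_three_pow_le' h' q' hq' hQ S S' hSS'
  -- every maximising point is a maximising `q j`, hence lies in `s`
  have hdot : ∀ x : Fin h × Fin h → ℝ, Summit.ValiantsHypothesis.ValiantsHypothesis.Cruxes.NNLinearDegreeCofactorHard.XcDivision.diagDir S S' ⬝ᵥ e x = diagDirG S S' ⬝ᵥ x := fun x =>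
    dotProduct_funCongrLeft_finProdFinEquiv _ x
  have hinj : Fintype.card {p : ↥P // Summit.ValiantsHypothesis.ValiantsHypothesis.Cruxes.NNLinearDegreeCofactorHard.XcDivision.diagDir S S' ⬝ᵥ q' p = Summit.ValiantsHypothesis.ValiantsHypothesis.Cruxes.NNLinearDegreeCofactorHard.XcDivision.diagDir S S' ⬝ᵥ q' p₀} ≤ s.card := by
    let f : {p : ↥P // Summit.ValiantsHypothesis.ValiantsHypothesis.Cruxes.NNLinearDegreeCofactorHard.XcDivision.diagDir S S' ⬝ᵥ q' p = Summit.ValiantsHypothesis.ValiantsHypothesis.Cruxes.NNLinearDegreeCofactorHard.XcDivision.diagDir S S' ⬝ᵥ q' p₀} → ↥s := fun p =>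
      ⟨p.1.1, by
        obtain ⟨j, -, hj⟩ := Finset.mem_image.1 p.1.2
        rw [← hj]
        refine hcover j fun j' => ?_
        have h1 : Summit.ValiantsHypothesis.ValiantsHypothesis.Cruxes.NNLinearDegreeCofactorHard.XcDivision.diagDir S S' ⬝ᵥ q' ⟨q j', Finset.mem_image_of_mem q (Finset.mem_univ j')⟩ ≤
            Summit.ValiantsHypothesis.ValiantsHypothesis.Cruxes.NNLinearDegreeCofactorHard.XcDivision.diagDir S S' ⬝ᵥ q' p₀ := hmax _
        have h2 : Summit.ValiantsHypothesis.ValiantsHypothesis.Cruxes.NNLinearDegreeCofactorHard.XcDivision.diagDir S S' ⬝ᵥ q' p₀ = Summit.ValiantsHypothesis.ValiantsHypothesis.Cruxes.NNLinearDegreeCofactorHard.XcDivision.diagDir S S' ⬝ᵥ e (q j) := by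
          rw [← p.2]; simp [q', hj]
        rw [h2] at h1
        simpa [q', hdot] using h1⟩
    have hf : Function.Injective f := by
      rintro ⟨⟨a, ha⟩, ha'⟩ ⟨⟨b, hb⟩, hb'⟩ hab
      have : a = b := congrArg (fun z : ↥s => (z : Fin h × Fin h → ℝ)) hab
      subst this
      rfl
    simpa using Fintype.card_le_of_injective f hf
  -- arithmetic: 3^m ≤ #max·(r+1)·2^m ≤ s.card·(r+1)·2^m and s.card·3^L·2^m ≤ 3^m·2^L
  have h3 : 3 ^ m * 3 ^ lvl h ≤ 3 ^ m * ((r + 1) * 2 ^ lvl h) := by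
    calc 3 ^ m * 3 ^ lvl h ≤ s.card * (r + 1) * 2 ^ m * 3 ^ lvl h := by
          have := le_trans hcnt (Nat.mul_le_mul_right _ (Nat.mul_le_mul_right _ hinj))
          exact Nat.mul_le_mul_right _ this
      _ = (s.card * 3 ^ lvl h * 2 ^ m) * (r + 1) := by ring
      _ ≤ (3 ^ m * 2 ^ lvl h) * (r + 1) := Nat.mul_le_mul_right _ hcard
      _ = 3 ^ m * ((r + 1) * 2 ^ lvl h) := by ring
  exact Nat.le_of_mul_le_mul_left h3 (by positivity)

/-- class G at the line's rate. -/
theorem diagFacePoor_three_halves_pow_le (h : ℕ) {K : ℕ} (q : Fin (K + 1) → (Fin h × Fin h → ℝ)) (r : ℕ)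
    (hG : DiagFacePoor h q)
    (hEF : HasEFOfSize (corPolytopeGraph (⊤ : SimpleGraph (Fin h)) + convexHull ℝ (Set.range q)) r) :
    (3 / 2 : ℝ) ^ ((lvl h : ℕ) : ℝ) ≤ 2 * (r + 1) := by
  have hA := diagFacePoor_three_pow_le h q r hG hEF
  have hAR : (3 / 2 : ℝ) ^ lvl h ≤ r + 1 := by
    rw [div_pow, div_le_iff₀ (by positivity)]
    have : ((3 ^ lvl h : ℕ) : ℝ) ≤ (((r + 1) * 2 ^ lvl h : ℕ) : ℝ) := by exact_mod_cast hA
    push_cast at this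
    linarith
  have hr : (0 : ℝ) ≤ r := by positivity
  rw [Real.rpow_natCast]
  linarith

/-! ### §3e CLASS H (rev 7): COLUMN-WISE ROOTED EXTREMISERS — PROP A♭, a new covering theorem (strictly contains CLASS F)

PROP A♯ pairs every clique row with ONE common maximiser. ⟨abr.⟩ -/

/-- **PROP A♭ (column-wise rooted maximisers; flat currency; NEW).**  `COR(n) + Q` with an extended formulation of size `r`; every
clique row attains its max over `Q`; and for every `b` a point `y_b ∈ Q` maximising all rows `udRow a`, `|a ∩ b| = 1`.  Then
`3ⁿ ≤ (r+1)·2ⁿ`. -/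
theorem corPolytope_add_three_pow_le_of_rooted {n r : ℕ} {Q : Set (Fin (n * n) → ℝ)}
    (h : HasEFOfSize (Literature.Combinatorics.Optimization.FixedSizePsdRank.corPolytope n + Q) r)
    (hm : ∀ a : Finset (Fin n), ∃ z₀ ∈ Q, ∀ z ∈ Q, Summit.ValiantsHypothesis.ValiantsHypothesis.Cruxes.NNLinearDegreeCofactorHard.XcDivision.udRow a ⬝ᵥ z ≤ Summit.ValiantsHypothesis.ValiantsHypothesis.Cruxes.NNLinearDegreeCofactorHard.XcDivision.udRow a ⬝ᵥ z₀)
    (y : Finset (Fin n) → (Fin (n * n) → ℝ)) (hy : ∀ b, y b ∈ Q)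
    (hroot : ∀ a b : Finset (Fin n), (a ∩ b).card = 1 → ∀ z ∈ Q, Summit.ValiantsHypothesis.ValiantsHypothesis.Cruxes.NNLinearDegreeCofactorHard.XcDivision.udRow a ⬝ᵥ z ≤ Summit.ValiantsHypothesis.ValiantsHypothesis.Cruxes.NNLinearDegreeCofactorHard.XcDivision.udRow a ⬝ᵥ y b) :
    3 ^ n ≤ (r + 1) * 2 ^ n := by
  classical
  obtain ⟨pt_mem, cc_valid, slack, -⟩ := Summit.ValiantsHypothesis.ValiantsHypothesis.Cruxes.NNLinearDegreeCofactorHard.XcDivision.ud_data n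
  choose z₀ hz₀Q hz₀ using hm
  let v' : Finset (Fin n) → (Fin (n * n) → ℝ) := fun b => Summit.ValiantsHypothesis.ValiantsHypothesis.Cruxes.NNLinearDegreeCofactorHard.XcDivision.udPt b + y b
  have hv' : ∀ b, v' b ∈ Literature.Combinatorics.Optimization.FixedSizePsdRank.corPolytope n + Q := fun b => Set.add_mem_add (pt_mem b) (hy b)
  have hvalid' : ∀ a, ∀ z ∈ Literature.Combinatorics.Optimization.FixedSizePsdRank.corPolytope n + Q, Summit.ValiantsHypothesis.ValiantsHypothesis.Cruxes.NNLinearDegreeCofactorHard.XcDivision.udRow a ⬝ᵥ z ≤ 1 + Summit.ValiantsHypothesis.ValiantsHypothesis.Cruxes.NNLinearDegreeCofactorHard.XcDivision.udRow a ⬝ᵥ z₀ a := by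
    intro a z hz
    obtain ⟨x, hx, w, hw, rfl⟩ := Set.mem_add.1 hz
    rw [dotProduct_add]
    exact add_le_add (cc_valid a x hx) (hz₀ a w hw)
  obtain ⟨RA, RB, hin, hcov⟩ :=
    h.exists_cover_option v' hv' Summit.ValiantsHypothesis.ValiantsHypothesis.Cruxes.NNLinearDegreeCofactorHard.XcDivision.udRow (fun a => 1 + Summit.ValiantsHypothesis.ValiantsHypothesis.Cruxes.NNLinearDegreeCofactorHard.XcDivision.udRow a ⬝ᵥ z₀ a) hvalid'
  have key := Literature.Barriers.PneNP.three_pow_le_card_mul_two_pow_of_cover_univ (α := Fin n)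
    (Finset.univ : Finset (Option (Fin r))) RA RB
    (fun i _ a ha b hb hab => by
      have hlt := hin i a ha b hb
      have hsplit : Summit.ValiantsHypothesis.ValiantsHypothesis.Cruxes.NNLinearDegreeCofactorHard.XcDivision.udRow a ⬝ᵥ v' b = Summit.ValiantsHypothesis.ValiantsHypothesis.Cruxes.NNLinearDegreeCofactorHard.XcDivision.udRow a ⬝ᵥ Summit.ValiantsHypothesis.ValiantsHypothesis.Cruxes.NNLinearDegreeCofactorHard.XcDivision.udPt b + Summit.ValiantsHypothesis.ValiantsHypothesis.Cruxes.NNLinearDegreeCofactorHard.XcDivision.udRow a ⬝ᵥ y b :=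
        dotProduct_add _ _ _
      have hs := slack a b
      rw [hab] at hs
      norm_num at hs
      have h1 := hroot a b hab (z₀ a) (hz₀Q a)
      rw [hsplit] at hlt
      linarith)
    (fun a b hab => by
      have hs := slack a b
      rw [Finset.disjoint_iff_inter_eq_empty.1 hab, Finset.card_empty] at hs
      norm_num at hs
      have hlt : Summit.ValiantsHypothesis.ValiantsHypothesis.Cruxes.NNLinearDegreeCofactorHard.XcDivision.udRow a ⬝ᵥ v' b < 1 + Summit.ValiantsHypothesis.ValiantsHypothesis.Cruxes.NNLinearDegreeCofactorHard.XcDivision.udRow a ⬝ᵥ z₀ a := by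
        show Summit.ValiantsHypothesis.ValiantsHypothesis.Cruxes.NNLinearDegreeCofactorHard.XcDivision.udRow a ⬝ᵥ (Summit.ValiantsHypothesis.ValiantsHypothesis.Cruxes.NNLinearDegreeCofactorHard.XcDivision.udPt b + y b) < _
        rw [dotProduct_add]
        linarith [hz₀ a (y b) (hy b)]
      obtain ⟨i, ha, hb⟩ := hcov a b hlt
      exact ⟨i, Finset.mem_univ _, ha, hb⟩)
  simp only [Finset.card_univ, Fintype.card_option, Fintype.card_fin] at key
  exact key

/-- **CLASS H — COLUMN-WISE ROOTED EXTREMISERS**: for every `b ⊆ [h]` one generator maximises, over the family, every clique row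
`udRow a` with `|a ∩ b| = 1`.  (CLASS F ⊆ CLASS H.) -/
def RootedExtremisers (h : ℕ) {J : Type} (q : J → (Fin h × Fin h → ℝ)) : Prop :=
  ∀ b : Finset (Fin h), ∃ j₀ : J, ∀ a : Finset (Fin h), (a ∩ b).card = 1 → ∀ j : J,
    udRowG a ⬝ᵥ q j ≤ udRowG a ⬝ᵥ q j₀

theorem rootedExtremisers_of_commonExtremiser (h : ℕ) {J : Type} (q : J → (Fin h × Fin h → ℝ))
    (hF : CommonExtremiser h q) : RootedExtremisers h q := by
  obtain ⟨j₀, hj₀⟩ := hF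
  exact fun b => ⟨j₀, fun a _ j => hj₀ a j⟩

/-- ★ **CLASS H IS DECIDED** (PROP A♭ transported to the graph currency): `3^h ≤ (r+1)·2^h`. -/
theorem rootedExtremisers_three_pow_le (h : ℕ) {K : ℕ} (q : Fin (K + 1) → (Fin h × Fin h → ℝ)) (r : ℕ)
    (hH : RootedExtremisers h q)
    (hEF : HasEFOfSize (corPolytopeGraph (⊤ : SimpleGraph (Fin h)) + convexHull ℝ (Set.range q)) r) :
    3 ^ h ≤ (r + 1) * 2 ^ h := by
  classical
  let e : (Fin h × Fin h → ℝ) ≃ₗ[ℝ] (Fin (h * h) → ℝ) :=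
    LinearEquiv.funCongrLeft ℝ ℝ (finProdFinEquiv (m := h) (n := h)).symm
  have himg : e '' (corPolytopeGraph (⊤ : SimpleGraph (Fin h)) + convexHull ℝ (Set.range q)) =
      Literature.Combinatorics.Optimization.FixedSizePsdRank.corPolytope h + convexHull ℝ (Set.range (e ∘ q)) := by
    rw [Set.image_add, Literature.Barriers.PneNP.corPolytope_eq_image_corPolytopeGraph_top, Set.range_comp]
    congr 1
    exact e.toLinearMap.image_convexHull (Set.range q)
  have h' : HasEFOfSize (Literature.Combinatorics.Optimization.FixedSizePsdRank.corPolytope h + convexHull ℝ (Set.range (e ∘ q))) r := by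
    rw [← himg]; exact (HasEFOfSize.image_linearEquiv_iff e).2 hEF
  have hdot : ∀ (a : Finset (Fin h)) (x : Fin h × Fin h → ℝ), Summit.ValiantsHypothesis.ValiantsHypothesis.Cruxes.NNLinearDegreeCofactorHard.XcDivision.udRow a ⬝ᵥ e x = udRowG a ⬝ᵥ x :=
    fun a x => udRow_dotProduct_funCongrLeft a x
  have hull_le : ∀ (a : Finset (Fin h)) (j : Fin (K + 1)), (∀ j', udRowG a ⬝ᵥ q j' ≤ udRowG a ⬝ᵥ q j) →
      ∀ z ∈ convexHull ℝ (Set.range (e ∘ q)), Summit.ValiantsHypothesis.ValiantsHypothesis.Cruxes.NNLinearDegreeCofactorHard.XcDivision.udRow a ⬝ᵥ z ≤ Summit.ValiantsHypothesis.ValiantsHypothesis.Cruxes.NNLinearDegreeCofactorHard.XcDivision.udRow a ⬝ᵥ e (q j) := by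
    intro a j hj
    have hgen : ∀ z ∈ Set.range (e ∘ q), Summit.ValiantsHypothesis.ValiantsHypothesis.Cruxes.NNLinearDegreeCofactorHard.XcDivision.udRow a ⬝ᵥ z ≤ Summit.ValiantsHypothesis.ValiantsHypothesis.Cruxes.NNLinearDegreeCofactorHard.XcDivision.udRow a ⬝ᵥ e (q j) := by
      rintro _ ⟨j', rfl⟩
      show _ ⬝ᵥ e (q j') ≤ _
      rw [hdot, hdot]
      exact hj j'
    exact dot_le_of_mem_convexHull _ _ _ hgen
  have hm : ∀ a : Finset (Fin h), ∃ z₀ ∈ convexHull ℝ (Set.range (e ∘ q)),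
      ∀ z ∈ convexHull ℝ (Set.range (e ∘ q)), Summit.ValiantsHypothesis.ValiantsHypothesis.Cruxes.NNLinearDegreeCofactorHard.XcDivision.udRow a ⬝ᵥ z ≤ Summit.ValiantsHypothesis.ValiantsHypothesis.Cruxes.NNLinearDegreeCofactorHard.XcDivision.udRow a ⬝ᵥ z₀ := by
    intro a
    obtain ⟨j, -, hj⟩ :=
      Finset.exists_max_image Finset.univ (fun j => udRowG a ⬝ᵥ q j) Finset.univ_nonempty
    exact ⟨e (q j), subset_convexHull ℝ _ ⟨j, rfl⟩, hull_le a j fun j' => hj j' (Finset.mem_univ _)⟩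
  choose jb hjb using hH
  exact corPolytope_add_three_pow_le_of_rooted h' hm (fun b => e (q (jb b)))
    (fun b => subset_convexHull ℝ _ ⟨jb b, rfl⟩) fun a b hab => hull_le a (jb b) (hjb b a hab)

/-- class H at the line's rate. -/
theorem rootedExtremisers_three_halves_pow_le (h : ℕ) {K : ℕ} (q : Fin (K + 1) → (Fin h × Fin h → ℝ)) (r : ℕ)
    (hH : RootedExtremisers h q)
    (hEF : HasEFOfSize (corPolytopeGraph (⊤ : SimpleGraph (Fin h)) + convexHull ℝ (Set.range q)) r) :
    (3 / 2 : ℝ) ^ ((lvl h : ℕ) : ℝ) ≤ 2 * (r + 1) := by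
  have hA := rootedExtremisers_three_pow_le h q r hH hEF
  have hAR : (3 / 2 : ℝ) ^ h ≤ r + 1 := by
    rw [div_pow, div_le_iff₀ (by positivity)]
    have : ((3 ^ h : ℕ) : ℝ) ≤ (((r + 1) * 2 ^ h : ℕ) : ℝ) := by exact_mod_cast hA
    push_cast at this
    linarith
  have hlvl : lvl h ≤ h := le_trans (Nat.sub_le _ _) (Nat.sqrt_le_self h)
  have hr : (0 : ℝ) ≤ r := by positivity
  rw [Real.rpow_natCast]
  calc (3 / 2 : ℝ) ^ lvl h ≤ (3 / 2 : ℝ) ^ h := pow_le_pow_right₀ (by norm_num) hlvl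
    _ ≤ r + 1 := hAR
    _ ≤ 2 * (r + 1) := by linarith

/-! ### §3f CLASS R (rev 9): NEAR-ROOTED EXTREMISERS — the first VALUE-LEVEL class of the line, decided by a CORRUPTION pair for unique
disjointness (Razborov 1992a — `UDISJCorruption`, a THEOREM of the tree since rev 21: `udisjCorruption_known` ⇐ ✓ p682396) and the HYPERPLANE SEPARATION BOUND of the tree
(`Literature.Barriers.PneNP.HasEFOfSize.weight_slack_le`, Rothvoß 2017 Lemma 5 + Yannakakis, P ⟨abr.⟩ -/

/-- **RAZBOROV'S CORRUPTION LEMMA FOR UNIQUE DISJOINTNESS, rectangle form — the KNOWN stub of revs 9–20, a THEOREM since rev 21 (`udisjCorruption_known`,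
⇐ `Literature.Computability.Complexity.udisjCorruption_holds` ✓ p682396, whose statement is this one verbatim).**
There are constants `m ≥ 1`, `κ, A ≥ 0` and, for every `n`, weights `μ_d ≥ 0` supported on the DISJOINT pairs of `2^[n] × 2^[n]` with
total mass `1` and `μ_o ≥ 0` supported on the ONE-pairs (`|a ∩ b| = 1`) with total mass `≤ 1`, su ⟨abr.⟩ -/
def UDISJCorruption : Prop :=
  ∃ (m : ℕ) (κ A : ℝ), 0 < m ∧ 0 ≤ κ ∧ 0 ≤ A ∧ ∀ n : ℕ,
    ∃ μd μo : Finset (Fin n) → Finset (Fin n) → ℝ,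
      (∀ a b, 0 ≤ μd a b) ∧ (∀ a b, 0 ≤ μo a b) ∧
      (∀ a b, μd a b ≠ 0 → Disjoint a b) ∧ (∀ a b, μo a b ≠ 0 → (a ∩ b).card = 1) ∧
    (∀ a b, μo a b ≠ 0 → a.card = (n + 1) / 4 ∧ b.card = (n + 1) / 4) ∧
      (∑ a, ∑ b, μd a b = 1) ∧ (∑ a, ∑ b, μo a b ≤ 1) ∧
      ∀ X Y : Finset (Finset (Fin n)),
        ∑ a ∈ X, ∑ b ∈ Y, μd a b ≤ κ * ∑ a ∈ X, ∑ b ∈ Y, μo a b + A / 2 ^ (n / m)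

/-- **PROP R (corruption-robust rooted maximisers; flat currency; NEW).**  `COR(n) + Q` with an extended formulation of size `r`;
`M a` upper bounds of the clique rows on `Q`; points `y_b ∈ Q` within `τ` of `M a` on every rooted row (`|a ∩ b| = 1`) and within `D` of
`M a` on every row; and a corruption pair `(μ_d, μ_o, κ, ε)` for unique disjointness on `2^[n] ⟨abr.⟩ -/
theorem corPolytope_add_corruption_bound {n r : ℕ} {κ ε τ D : ℝ} {Q : Set (Fin (n * n) → ℝ)}
    (h : HasEFOfSize (Literature.Combinatorics.Optimization.FixedSizePsdRank.corPolytope n + Q) r)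
    (μd μo : Finset (Fin n) → Finset (Fin n) → ℝ) (hμd0 : ∀ a b, 0 ≤ μd a b) (hμo0 : ∀ a b, 0 ≤ μo a b)
    (hμd : ∀ a b, μd a b ≠ 0 → Disjoint a b) (hμo : ∀ a b, μo a b ≠ 0 → (a ∩ b).card = 1)
    (hμd1 : ∑ a, ∑ b, μd a b = 1) (_hμo1 : ∑ a, ∑ b, μo a b ≤ 1) (hκ : 0 ≤ κ)
    (hcorr : ∀ X Y : Finset (Finset (Fin n)), ∑ a ∈ X, ∑ b ∈ Y, μd a b ≤ κ * ∑ a ∈ X, ∑ b ∈ Y, μo a b + ε)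
    (M : Finset (Fin n) → ℝ)
    (hM : ∀ a, ∀ z ∈ Q, Summit.ValiantsHypothesis.ValiantsHypothesis.Cruxes.NNLinearDegreeCofactorHard.XcDivision.udRow a ⬝ᵥ z ≤ M a)
    (y : Finset (Fin n) → (Fin (n * n) → ℝ)) (hy : ∀ b, y b ∈ Q) (_hτ : 0 ≤ τ)
    (hroot : ∑ a, ∑ b, μo a b *
      (M a - Summit.ValiantsHypothesis.ValiantsHypothesis.Cruxes.NNLinearDegreeCofactorHard.XcDivision.udRow a ⬝ᵥ y b) ≤ τ)
    (hdiam : ∀ a b : Finset (Fin n),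
      M a ≤ Summit.ValiantsHypothesis.ValiantsHypothesis.Cruxes.NNLinearDegreeCofactorHard.XcDivision.udRow a ⬝ᵥ y b + D) :
    1 - 2 * κ * τ ≤ ε * ((n : ℝ) ^ 2 + 1 + D) * (r + 1) := by
  classical
  obtain ⟨pt_mem, cc_valid, slack, -⟩ := Summit.ValiantsHypothesis.ValiantsHypothesis.Cruxes.NNLinearDegreeCofactorHard.XcDivision.ud_data n
  set v' : Finset (Fin n) → (Fin (n * n) → ℝ) := fun b =>
    Summit.ValiantsHypothesis.ValiantsHypothesis.Cruxes.NNLinearDegreeCofactorHard.XcDivision.udPt b + y b with hv'def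
  have hv' : ∀ b, v' b ∈ Literature.Combinatorics.Optimization.FixedSizePsdRank.corPolytope n + Q :=
    fun b => Set.add_mem_add (pt_mem b) (hy b)
  set d : Finset (Fin n) → ℝ := fun a => 1 + M a with hddef
  have hvalid' : ∀ a, ∀ z ∈ Literature.Combinatorics.Optimization.FixedSizePsdRank.corPolytope n + Q,
      Summit.ValiantsHypothesis.ValiantsHypothesis.Cruxes.NNLinearDegreeCofactorHard.XcDivision.udRow a ⬝ᵥ z ≤ d a := by
    intro a z hz
    obtain ⟨x, hx, w, hw, rfl⟩ := Set.mem_add.1 hz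
    rw [dotProduct_add]
    exact add_le_add (cc_valid a x hx) (hM a w hw)
  -- the slack of row `a` at column `b`: UDISJ part + passenger gap
  have hsl : ∀ a b, d a - Summit.ValiantsHypothesis.ValiantsHypothesis.Cruxes.NNLinearDegreeCofactorHard.XcDivision.udRow a ⬝ᵥ v' b =
      (1 - ((a ∩ b).card : ℝ)) ^ 2 +
        (M a - Summit.ValiantsHypothesis.ValiantsHypothesis.Cruxes.NNLinearDegreeCofactorHard.XcDivision.udRow a ⬝ᵥ y b) := by
    intro a b
    have hs := slack a b
    show 1 + M a - Summit.ValiantsHypothesis.ValiantsHypothesis.Cruxes.NNLinearDegreeCofactorHard.XcDivision.udRow a ⬝ᵥ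
      (Summit.ValiantsHypothesis.ValiantsHypothesis.Cruxes.NNLinearDegreeCofactorHard.XcDivision.udPt b + y b) = _
    rw [dotProduct_add]
    linarith
  have hgap0 : ∀ a b, 0 ≤ M a - Summit.ValiantsHypothesis.ValiantsHypothesis.Cruxes.NNLinearDegreeCofactorHard.XcDivision.udRow a ⬝ᵥ y b :=
    fun a b => sub_nonneg.2 (hM a (y b) (hy b))
  have hD : 0 ≤ D := by
    have := hdiam ∅ ∅
    linarith [hgap0 ∅ ∅]
  have hU : ∀ a b : Finset (Fin n), (1 - ((a ∩ b).card : ℝ)) ^ 2 ≤ (n : ℝ) ^ 2 + 1 := by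
    intro a b
    have hk : ((a ∩ b).card : ℝ) ≤ n := by
      have : (a ∩ b).card ≤ n := le_trans (Finset.card_le_univ _) (by simp)
      exact_mod_cast this
    have hk0 : (0 : ℝ) ≤ (a ∩ b).card := by positivity
    nlinarith [mul_le_mul hk hk hk0 (Nat.cast_nonneg n)]
  -- Yannakakis + hyperplane separation with `W = μ_d − 2κ μ_o`
  have key := h.weight_slack_le v' hv' Summit.ValiantsHypothesis.ValiantsHypothesis.Cruxes.NNLinearDegreeCofactorHard.XcDivision.udRow
    d hvalid' (fun a b => μd a b - 2 * κ * μo a b) (α := ε) (s := (n : ℝ) ^ 2 + 1 + D) (add_nonneg (by positivity) hD)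
    (fun a b => by rw [hsl]; linarith [hU a b, hdiam a b])
    (fun X Y _ => by
      have hc := hcorr X Y
      have h2 : 0 ≤ κ * ∑ a ∈ X, ∑ b ∈ Y, μo a b :=
        mul_nonneg hκ (Finset.sum_nonneg fun a _ => Finset.sum_nonneg fun b _ => hμo0 a b)
      have hsplit : ∑ a ∈ X, ∑ b ∈ Y, (μd a b - 2 * κ * μo a b) =
          ∑ a ∈ X, ∑ b ∈ Y, μd a b - 2 * κ * ∑ a ∈ X, ∑ b ∈ Y, μo a b := by
        simp only [Finset.sum_sub_distrib, Finset.mul_sum]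
      rw [hsplit]
      linarith)
  -- the left-hand side is at least `1 − 2κτ` (the one-pair gaps enter only through their `μ_o`-AVERAGE)
  have hterm : ∀ a b, μd a b - 2 * κ * (μo a b *
      (M a - Summit.ValiantsHypothesis.ValiantsHypothesis.Cruxes.NNLinearDegreeCofactorHard.XcDivision.udRow a ⬝ᵥ y b)) ≤
      (μd a b - 2 * κ * μo a b) * (d a - Summit.ValiantsHypothesis.ValiantsHypothesis.Cruxes.NNLinearDegreeCofactorHard.XcDivision.udRow a ⬝ᵥ v' b) := by
    intro a b
    rw [hsl]
    have hg0 := hgap0 a b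
    by_cases hd0 : μd a b = 0
    · by_cases ho0 : μo a b = 0
      · rw [hd0, ho0]; ring_nf; exact le_rfl
      · have hk := hμo a b ho0
        rw [hd0, hk]
        push_cast
        nlinarith [hμo0 a b]
    · have hdisj := hμd a b hd0
      have hcard : (a ∩ b).card = 0 := by
        rw [Finset.disjoint_iff_inter_eq_empty.1 hdisj, Finset.card_empty]
      have ho0 : μo a b = 0 := by
        by_contra ho0
        have := hμo a b ho0
        omega
      rw [ho0, hcard]
      push_cast
      nlinarith [hμd0 a b, mul_nonneg (hμd0 a b) hg0]
  have hsum : ∑ a, ∑ b, (μd a b - 2 * κ * (μo a b *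
      (M a - Summit.ValiantsHypothesis.ValiantsHypothesis.Cruxes.NNLinearDegreeCofactorHard.XcDivision.udRow a ⬝ᵥ y b))) =
      1 - 2 * κ * ∑ a, ∑ b, μo a b *
        (M a - Summit.ValiantsHypothesis.ValiantsHypothesis.Cruxes.NNLinearDegreeCofactorHard.XcDivision.udRow a ⬝ᵥ y b) := by
    simp only [Finset.sum_sub_distrib, ← Finset.mul_sum]
    rw [hμd1]
  have h1 : 1 - 2 * κ * τ ≤ 1 - 2 * κ * ∑ a, ∑ b, μo a b *
      (M a - Summit.ValiantsHypothesis.ValiantsHypothesis.Cruxes.NNLinearDegreeCofactorHard.XcDivision.udRow a ⬝ᵥ y b) := by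
    nlinarith [hroot, hκ]
  calc 1 - 2 * κ * τ ≤ _ := h1
    _ = _ := hsum.symm
    _ ≤ ∑ a, ∑ b, (μd a b - 2 * κ * μo a b) *
          (d a - Summit.ValiantsHypothesis.ValiantsHypothesis.Cruxes.NNLinearDegreeCofactorHard.XcDivision.udRow a ⬝ᵥ v' b) :=
        Finset.sum_le_sum fun a _ => Finset.sum_le_sum fun b _ => hterm a b
    _ ≤ ε * ((n : ℝ) ^ 2 + 1 + D) * (r + 1) := key

/-- **CLASS R — NEAR-ROOTED EXTREMISERS** (value level; contains every CLASS-H family of c-diameter `≤ 2^{√h}`, e.g. `M·COR`, boxes,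
simplices): for every column `b` one generator is within `1/h` of the family maximum of every clique row ROOTED at `b` (`|a ∩ b| = 1`)
and within `2^{√h}` of the family maximum of every clique row. -/
def NearRooted (h : ℕ) {J : Type} (q : J → (Fin h × Fin h → ℝ)) : Prop :=
  ∀ b : Finset (Fin h), ∃ j₀ : J,
    (∀ a : Finset (Fin h), (a ∩ b).card = 1 → ∀ j : J, udRowG a ⬝ᵥ q j ≤ udRowG a ⬝ᵥ q j₀ + 1 / (h : ℝ)) ∧
    (∀ (a : Finset (Fin h)) (j : J), udRowG a ⬝ᵥ q j ≤ udRowG a ⬝ᵥ q j₀ + 2 ^ Nat.sqrt h)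

theorem nearRooted_of_rootedExtremisers (h : ℕ) {J : Type} (q : J → (Fin h × Fin h → ℝ)) (hH : RootedExtremisers h q)
    (hdiam : ∀ (a : Finset (Fin h)) (j j' : J), udRowG a ⬝ᵥ q j ≤ udRowG a ⬝ᵥ q j' + 2 ^ Nat.sqrt h) : NearRooted h q := by
  intro b
  obtain ⟨j₀, hj₀⟩ := hH b
  refine ⟨j₀, fun a hab j => ?_, fun a j => hdiam a j j₀⟩
  have : (0 : ℝ) ≤ 1 / (h : ℝ) := by positivity
  linarith [hj₀ a hab j]

/-- `n² ≤ 2ⁿ` for `n ≥ 4`. -/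
theorem sq_le_two_pow (n : ℕ) (hn : 4 ≤ n) : n * n ≤ 2 ^ n := by
  induction n, hn using Nat.le_induction with
  | base => norm_num
  | succ k hk ih =>
    have hk3 : 3 ≤ k := by omega
    calc (k + 1) * (k + 1) = k * k + 2 * k + 1 := by ring
      _ ≤ k * k + k * k := by nlinarith
      _ ≤ 2 ^ k + 2 ^ k := Nat.add_le_add ih ih
      _ = 2 ^ (k + 1) := by ring

/-- the rate arithmetic of CLASS R: `2^{√h} · 2^N · (h² + 1 + 2^{√h}) ≤ 2^{⌊h/m⌋}` for `h ≥ (2m(N+10))²`. -/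
theorem corruption_rate (m N : ℕ) (hm : 0 < m) :
    ∃ h₀ : ℕ, ∀ h ≥ h₀, 2 ^ Nat.sqrt h * 2 ^ N * (h ^ 2 + 1 + 2 ^ Nat.sqrt h) ≤ 2 ^ (h / m) := by
  refine ⟨(2 * m * (N + 10)) ^ 2, fun h hh => ?_⟩
  set t := Nat.sqrt h with htdef
  have ht : 2 * m * (N + 10) ≤ t := by
    rw [htdef, Nat.le_sqrt, ← pow_two]
    exact hh
  have ht20 : 20 ≤ t := le_trans (by nlinarith) ht
  have hlt : h < (t + 1) * (t + 1) := Nat.lt_succ_sqrt h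
  have hsq : (t + 1) * (t + 1) ≤ 2 ^ (t + 1) := sq_le_two_pow (t + 1) (by omega)
  have hh2 : h ^ 2 + 1 ≤ 2 ^ (2 * t + 2) := by
    have h1 : h * h < ((t + 1) * (t + 1)) * ((t + 1) * (t + 1)) := Nat.mul_self_lt_mul_self hlt
    have h2 : ((t + 1) * (t + 1)) * ((t + 1) * (t + 1)) ≤ 2 ^ (t + 1) * 2 ^ (t + 1) := Nat.mul_le_mul hsq hsq
    rw [← pow_add, show t + 1 + (t + 1) = 2 * t + 2 by ring] at h2
    rw [pow_two]
    exact Nat.succ_le_of_lt (lt_of_lt_of_le h1 h2)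
  have h2t : 2 ^ t ≤ 2 ^ (2 * t + 2) := Nat.pow_le_pow_right (by norm_num) (by omega)
  have hs : h ^ 2 + 1 + 2 ^ t ≤ 2 ^ (2 * t + 3) := by
    calc h ^ 2 + 1 + 2 ^ t ≤ 2 ^ (2 * t + 2) + 2 ^ (2 * t + 2) := Nat.add_le_add hh2 h2t
      _ = 2 ^ (2 * t + 3) := by ring
  have hexp : 3 * t + N + 3 ≤ h / m := by
    have hdiv : 2 * (N + 10) ≤ t / m := by
      rw [Nat.le_div_iff_mul_le hm]
      calc 2 * (N + 10) * m = 2 * m * (N + 10) := by ring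
        _ ≤ t := ht
    have h1 : t * (t / m) ≤ t * t / m := Nat.mul_div_le_mul_div_assoc t t m
    have h2 : t * t / m ≤ h / m := Nat.div_le_div_right (Nat.sqrt_le h)
    have h3 : t * (2 * (N + 10)) ≤ t * (t / m) := Nat.mul_le_mul_left t hdiv
    have h4 : N ≤ t * N := Nat.le_mul_of_pos_left N (by omega)
    have h5 : 3 * t + N + 3 ≤ t * (2 * (N + 10)) := by nlinarith [h4, ht20]
    exact le_trans h5 (le_trans h3 (le_trans h1 h2))
  calc 2 ^ t * 2 ^ N * (h ^ 2 + 1 + 2 ^ t) ≤ 2 ^ t * 2 ^ N * 2 ^ (2 * t + 3) := Nat.mul_le_mul_left _ hs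
    _ = 2 ^ (3 * t + N + 3) := by ring
    _ ≤ 2 ^ (h / m) := Nat.pow_le_pow_right (by norm_num) hexp

/-- **CLASS R\* — MIXED-ROOTED PASSENGERS** (rev 12; value level, TOLERANT AT CONSTANT SCALE ON AVERAGE, half-move-stable). ⟨abr.⟩ -/
def MixedRooted (τ : ℝ) (h : ℕ) {K : ℕ} (q : Fin (K + 1) → (Fin h × Fin h → ℝ)) : Prop :=
  ∃ p : (Finset (Fin h) → Fin (K + 1)) → ℝ, (∀ σ, 0 ≤ p σ) ∧ ∑ σ, p σ = 1 ∧
    (∀ σ, p σ ≠ 0 → ∀ (a b : Finset (Fin h)) (j : Fin (K + 1)), udRowG a ⬝ᵥ q j ≤ udRowG a ⬝ᵥ q (σ b) + 2 ^ Nat.sqrt h) ∧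
    ∀ a b : Finset (Fin h), a.card = (h + 1) / 4 → b.card = (h + 1) / 4 → (a ∩ b).card = 1 →
      ∀ j : Fin (K + 1), ∑ σ, p σ * (udRowG a ⬝ᵥ q j - udRowG a ⬝ᵥ q (σ b)) ≤ τ

/-- **CLASS R\* DECIDED modulo Razborov** (rev 12; rev 19: `τ₀ = 1/(4κ+4)` chosen before `c`): PROP R (averaged form) for each section `σ`
in the support of `p`, then the `p`-average (`μ_o` charges balanced rooted pairs only). -/
theorem mixedRooted_decided' (hU : UDISJCorruption) :
    ∃ τ₀ : ℝ, 0 < τ₀ ∧ ∀ c : ℕ, ∃ h₀ : ℕ, ∀ h ≥ h₀, ∀ (K : ℕ) (q : Fin (K + 1) → (Fin h × Fin h → ℝ)) (r : ℕ),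
      MixedRooted τ₀ h q →
      HasEFOfSize (corPolytopeGraph (⊤ : SimpleGraph (Fin h)) + convexHull ℝ (Set.range q)) r → T c h < r := by
  classical
  obtain ⟨m, κ, A, hm, hκ, hA, hcor⟩ := hU
  refine ⟨1 / (4 * κ + 4), by positivity, fun c => ?_⟩
  set A' : ℝ := max A 1 with hA'def
  have hA'1 : 1 ≤ A' := le_max_right _ _
  have hA'0 : 0 < A' := lt_of_lt_of_le one_pos hA'1
  obtain ⟨N, hN⟩ := pow_unbounded_of_one_lt A' (one_lt_two : (1 : ℝ) < 2)
  obtain ⟨h₁, hh₁⟩ := rate_of_lvl c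
  obtain ⟨h₂, hh₂⟩ := corruption_rate m N hm
  refine ⟨max h₁ h₂, fun h hh K q r hR hEF => ?_⟩
  have hh1 : h₁ ≤ h := le_trans (le_max_left _ _) hh
  have hh2 : h₂ ≤ h := le_trans (le_max_right _ _) hh
  -- transport to the flat currency
  let e : (Fin h × Fin h → ℝ) ≃ₗ[ℝ] (Fin (h * h) → ℝ) :=
    LinearEquiv.funCongrLeft ℝ ℝ (finProdFinEquiv (m := h) (n := h)).symm
  have himg : e '' (corPolytopeGraph (⊤ : SimpleGraph (Fin h)) + convexHull ℝ (Set.range q)) =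
      Literature.Combinatorics.Optimization.FixedSizePsdRank.corPolytope h + convexHull ℝ (Set.range (e ∘ q)) := by
    rw [Set.image_add, Literature.Barriers.PneNP.corPolytope_eq_image_corPolytopeGraph_top, Set.range_comp]
    congr 1
    exact e.toLinearMap.image_convexHull (Set.range q)
  have h' : HasEFOfSize (Literature.Combinatorics.Optimization.FixedSizePsdRank.corPolytope h + convexHull ℝ (Set.range (e ∘ q))) r := by
    rw [← himg]; exact (HasEFOfSize.image_linearEquiv_iff e).2 hEF
  have hdot : ∀ (a : Finset (Fin h)) (x : Fin h × Fin h → ℝ),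
      Summit.ValiantsHypothesis.ValiantsHypothesis.Cruxes.NNLinearDegreeCofactorHard.XcDivision.udRow a ⬝ᵥ e x = udRowG a ⬝ᵥ x :=
    fun a x => udRow_dotProduct_funCongrLeft a x
  -- row maxima over the family
  have hmax : ∀ a : Finset (Fin h), ∃ jm : Fin (K + 1), ∀ j, udRowG a ⬝ᵥ q j ≤ udRowG a ⬝ᵥ q jm := by
    intro a
    obtain ⟨j, -, hj⟩ := Finset.exists_max_image Finset.univ (fun j => udRowG a ⬝ᵥ q j) Finset.univ_nonempty
    exact ⟨j, fun j' => hj j' (Finset.mem_univ _)⟩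
  choose jm hjm using hmax
  let M : Finset (Fin h) → ℝ := fun a => udRowG a ⬝ᵥ q (jm a)
  have hM : ∀ a, ∀ z ∈ convexHull ℝ (Set.range (e ∘ q)),
      Summit.ValiantsHypothesis.ValiantsHypothesis.Cruxes.NNLinearDegreeCofactorHard.XcDivision.udRow a ⬝ᵥ z ≤ M a := by
    intro a
    refine dot_le_of_mem_convexHull _ _ _ ?_
    rintro _ ⟨j', rfl⟩
    show _ ⬝ᵥ e (q j') ≤ _
    rw [hdot]
    exact hjm a j'
  obtain ⟨p, hp0, hp1, hspread, havg⟩ := hR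
  obtain ⟨μd, μo, hμd0, hμo0, hμd, hμo, hbal, hμd1, hμo1, hcorr⟩ := hcor h
  have hcorr' : ∀ X Y : Finset (Finset (Fin h)),
      ∑ a ∈ X, ∑ b ∈ Y, μd a b ≤ κ * ∑ a ∈ X, ∑ b ∈ Y, μo a b + A' / 2 ^ (h / m) := by
    intro X Y
    have h1 := hcorr X Y
    have h2 : A / 2 ^ (h / m) ≤ A' / 2 ^ (h / m) := by
      gcongr
      exact le_max_left _ _
    linarith
  -- the `μ_o`-weighted gap of a section
  let G : (Finset (Fin h) → Fin (K + 1)) → ℝ := fun σ =>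
    ∑ a, ∑ b, μo a b * (M a - Summit.ValiantsHypothesis.ValiantsHypothesis.Cruxes.NNLinearDegreeCofactorHard.XcDivision.udRow a ⬝ᵥ e (q (σ b)))
  have hG0 : ∀ σ, 0 ≤ G σ := fun σ =>
    Finset.sum_nonneg fun a _ => Finset.sum_nonneg fun b _ =>
      mul_nonneg (hμo0 a b) (sub_nonneg.2 (hM a _ (subset_convexHull ℝ _ ⟨σ b, rfl⟩)))
  -- PROP R for every section in the support of `p`
  have hPσ : ∀ σ, p σ ≠ 0 → 1 - 2 * κ * G σ ≤ A' / 2 ^ (h / m) * ((h : ℝ) ^ 2 + 1 + 2 ^ Nat.sqrt h) * (r + 1) := by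
    intro σ hσ
    exact corPolytope_add_corruption_bound h' μd μo hμd0 hμo0 hμd hμo hμd1 hμo1 hκ hcorr' M hM
      (fun b => e (q (σ b))) (fun b => subset_convexHull ℝ _ ⟨σ b, rfl⟩) (τ := G σ) (D := 2 ^ Nat.sqrt h) (hG0 σ) le_rfl
      (fun a b => by
        show udRowG a ⬝ᵥ q (jm a) ≤ _ ⬝ᵥ e (q (σ b)) + _
        rw [hdot]; exact hspread σ hσ a b (jm a))
  -- the `p`-average of the weighted gaps is at most `τ₀`
  have hEG : ∑ σ, p σ * G σ ≤ 1 / (4 * κ + 4) := by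
    have hswap : ∑ σ, p σ * G σ = ∑ a, ∑ b, μo a b * ∑ σ, p σ *
        (M a - Summit.ValiantsHypothesis.ValiantsHypothesis.Cruxes.NNLinearDegreeCofactorHard.XcDivision.udRow a ⬝ᵥ e (q (σ b))) := by
      simp only [G, Finset.mul_sum]
      rw [Finset.sum_comm]
      refine Finset.sum_congr rfl fun a _ => ?_
      rw [Finset.sum_comm]
      refine Finset.sum_congr rfl fun b _ => Finset.sum_congr rfl fun σ _ => ?_
      ring
    rw [hswap]
    have hterm : ∀ a b, μo a b * ∑ σ, p σ *
        (M a - Summit.ValiantsHypothesis.ValiantsHypothesis.Cruxes.NNLinearDegreeCofactorHard.XcDivision.udRow a ⬝ᵥ e (q (σ b))) ≤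
        μo a b * (1 / (4 * κ + 4)) := by
      intro a b
      by_cases h0 : μo a b = 0
      · rw [h0]; simp
      · refine mul_le_mul_of_nonneg_left ?_ (hμo0 a b)
        have hab := hbal a b h0
        have h1 := havg a b hab.1 hab.2 (hμo a b h0) (jm a)
        refine le_trans (le_of_eq (Finset.sum_congr rfl fun σ _ => ?_)) h1
        show p σ * (udRowG a ⬝ᵥ q (jm a) - _ ⬝ᵥ e (q (σ b))) = _
        rw [hdot]
    calc ∑ a, ∑ b, μo a b * ∑ σ, p σ *
          (M a - Summit.ValiantsHypothesis.ValiantsHypothesis.Cruxes.NNLinearDegreeCofactorHard.XcDivision.udRow a ⬝ᵥ e (q (σ b)))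
        ≤ ∑ a, ∑ b, μo a b * (1 / (4 * κ + 4)) := Finset.sum_le_sum fun a _ => Finset.sum_le_sum fun b _ => hterm a b
      _ = (∑ a, ∑ b, μo a b) * (1 / (4 * κ + 4)) := by simp only [Finset.sum_mul]
      _ ≤ 1 * (1 / (4 * κ + 4)) := mul_le_mul_of_nonneg_right hμo1 (by positivity)
      _ = 1 / (4 * κ + 4) := one_mul _
  -- average PROP R over `p`
  have hP : 1 - 2 * κ * (1 / (4 * κ + 4)) ≤ A' / 2 ^ (h / m) * ((h : ℝ) ^ 2 + 1 + 2 ^ Nat.sqrt h) * (r + 1) := by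
    set B : ℝ := A' / 2 ^ (h / m) * ((h : ℝ) ^ 2 + 1 + 2 ^ Nat.sqrt h) * (r + 1) with hBdef
    have hsumσ : ∑ σ, p σ * (1 - 2 * κ * G σ) ≤ ∑ σ, p σ * B := by
      refine Finset.sum_le_sum fun σ _ => ?_
      by_cases hσ : p σ = 0
      · rw [hσ]; simp
      · exact mul_le_mul_of_nonneg_left (hPσ σ hσ) (hp0 σ)
    have hl : ∑ σ, p σ * (1 - 2 * κ * G σ) = 1 - 2 * κ * ∑ σ, p σ * G σ := by
      simp only [mul_sub, mul_one, Finset.sum_sub_distrib, hp1, Finset.mul_sum]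
      congr 1
      refine Finset.sum_congr rfl fun σ _ => ?_
      ring
    have hr : ∑ σ, p σ * B = B := by rw [← Finset.sum_mul, hp1, one_mul]
    rw [hl, hr] at hsumσ
    nlinarith [hEG, hκ]
  -- `1 − 2κ τ₀ ≥ 1/2`
  have hhalf : (1 : ℝ) / 2 ≤ 1 - 2 * κ * (1 / (4 * κ + 4)) := by
    rw [mul_one_div, show (1 : ℝ) - 2 * κ / (4 * κ + 4) = (2 * κ + 4) / (4 * κ + 4) by field_simp; ring,
      le_div_iff₀ (by positivity)]
    linarith
  -- the arithmetic
  have hs0 : (0 : ℝ) < (h : ℝ) ^ 2 + 1 + 2 ^ Nat.sqrt h := by positivity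
  have h2pow : (0 : ℝ) < 2 ^ (h / m) := by positivity
  have hrate : (2 : ℝ) ^ Nat.sqrt h * 2 ^ N * ((h : ℝ) ^ 2 + 1 + 2 ^ Nat.sqrt h) ≤ 2 ^ (h / m) := by
    exact_mod_cast hh₂ h hh2
  have hmain : (2 : ℝ) ^ (h / m) ≤ 2 * A' * ((h : ℝ) ^ 2 + 1 + 2 ^ Nat.sqrt h) * (r + 1) := by
    have := le_trans hhalf hP
    rw [div_mul_eq_mul_div, div_mul_eq_mul_div, le_div_iff₀ h2pow] at this
    linarith
  have hlvl : lvl h ≤ Nat.sqrt h := Nat.sub_le _ _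
  have h32 : (3 / 2 : ℝ) ^ lvl h ≤ 2 ^ Nat.sqrt h :=
    le_trans (pow_le_pow_left₀ (by norm_num) (by norm_num) _) (pow_le_pow_right₀ (by norm_num) hlvl)
  have hfin : (3 / 2 : ℝ) ^ lvl h * (A' * ((h : ℝ) ^ 2 + 1 + 2 ^ Nat.sqrt h)) ≤
      2 * (r + 1) * (A' * ((h : ℝ) ^ 2 + 1 + 2 ^ Nat.sqrt h)) := by
    have hr0 : (0 : ℝ) ≤ r := by positivity
    calc (3 / 2 : ℝ) ^ lvl h * (A' * ((h : ℝ) ^ 2 + 1 + 2 ^ Nat.sqrt h))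
        ≤ 2 ^ Nat.sqrt h * (2 ^ N * ((h : ℝ) ^ 2 + 1 + 2 ^ Nat.sqrt h)) := by
          refine mul_le_mul h32 ?_ (by positivity) (by positivity)
          exact mul_le_mul_of_nonneg_right hN.le hs0.le
      _ = 2 ^ Nat.sqrt h * 2 ^ N * ((h : ℝ) ^ 2 + 1 + 2 ^ Nat.sqrt h) := by ring
      _ ≤ 2 ^ (h / m) := hrate
      _ ≤ 2 * A' * ((h : ℝ) ^ 2 + 1 + 2 ^ Nat.sqrt h) * (r + 1) := hmain
      _ = 2 * (r + 1) * (A' * ((h : ℝ) ^ 2 + 1 + 2 ^ Nat.sqrt h)) := by ring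
  have hgoal : (3 / 2 : ℝ) ^ lvl h ≤ 2 * (r + 1) :=
    le_of_mul_le_mul_right hfin (by positivity)
  refine hh₁ h hh1 r ?_
  rw [Real.rpow_natCast]
  exact hgoal


/-- (the rev 12 shape, `τ₀` after `c`) -/
theorem mixedRooted_decided (hU : UDISJCorruption) :
    ∀ c : ℕ, ∃ τ₀ : ℝ, 0 < τ₀ ∧ ∃ h₀ : ℕ, ∀ h ≥ h₀, ∀ (K : ℕ) (q : Fin (K + 1) → (Fin h × Fin h → ℝ)) (r : ℕ),
      MixedRooted τ₀ h q →
      HasEFOfSize (corPolytopeGraph (⊤ : SimpleGraph (Fin h)) + convexHull ℝ (Set.range q)) r → T c h < r := fun c => by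
  obtain ⟨τ₀, hτ₀, hh⟩ := mixedRooted_decided' hU
  exact ⟨τ₀, hτ₀, hh c⟩
/-- CLASS R ⊆ CLASS R\*_τ once `h ≥ 1/τ` (point mass on the near-rooted section). -/
theorem mixedRooted_of_nearRooted {τ : ℝ} (hτ : 0 < τ) {h K : ℕ} (hh : 1 / τ ≤ h) (q : Fin (K + 1) → (Fin h × Fin h → ℝ))
    (hR : NearRooted h q) : MixedRooted τ h q := by
  classical
  choose jb hjb using hR
  refine ⟨fun σ => if σ = jb then 1 else 0, fun σ => by positivity, by simp, ?_, ?_⟩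
  · intro σ hσ a b j
    have : σ = jb := by by_contra hne; exact hσ (if_neg hne)
    subst this
    exact (hjb b).2 a j
  · intro a b _ _ hab j
    simp only [ite_mul, one_mul, zero_mul, Finset.sum_ite_eq', Finset.mem_univ, if_true]
    have hhpos : (0 : ℝ) < h := lt_of_lt_of_le (by positivity) hh
    have h1 : 1 / (h : ℝ) ≤ τ := by
      rw [div_le_iff₀ hhpos]
      have := (div_le_iff₀ hτ).1 hh
      linarith
    linarith [(hjb b).1 a hab j]

/-- ★ **CLASS R IS DECIDED modulo Razborov's corruption lemma** (rev 9; since rev 12 the point-mass corollary of `mixedRooted_decided`):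
near-rooted passengers do not make `COR(K_h) + Q` quasi-polynomially cheap. -/
theorem nearRooted_decided (hU : UDISJCorruption) :
    ∀ c : ℕ, ∃ h₀ : ℕ, ∀ h ≥ h₀, ∀ (K : ℕ) (q : Fin (K + 1) → (Fin h × Fin h → ℝ)) (r : ℕ),
      NearRooted h q →
      HasEFOfSize (corPolytopeGraph (⊤ : SimpleGraph (Fin h)) + convexHull ℝ (Set.range q)) r → T c h < r := by
  intro c
  obtain ⟨τ₀, hτ₀, h₀, hh₀⟩ := mixedRooted_decided hU c
  refine ⟨max h₀ ⌈1 / τ₀⌉₊, fun h hh K q r hR hEF => hh₀ h (le_trans (le_max_left _ _) hh) K q r ?_ hEF⟩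
  refine mixedRooted_of_nearRooted hτ₀ ?_ q hR
  exact le_trans (Nat.le_ceil _) (by exact_mod_cast le_trans (le_max_right _ _) hh)

/-! ### §3h CLASS S (rev 10): SHALLOW PASSENGERS — the approximate common extremiser at POLYNOMIAL tolerance, decided modulo the
Braun–Fiorini–Pokutta–Steurer SANDWICH theorem (approximate extended formulations of the hard pair `(COR(n), Q(n))`)

CLASS F asks for one generator maximising EVERY clique row exactly; CLASS S asks for one generator within `n^{1/4} ⟨abr.⟩ -/

/-- **KNOWN STUB (print theorem; Literature port wanted) — the BFPS SANDWICH BOUND for the correlation polytope at `ρ = 1 + n^{1/4}`**, flat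
currency: every `K` with `COR(n) ⊆ K ⊆ {x : udRow a ⬝ x ≤ 1 + ⌊n^{1/4}⌋ ∀ a}` that has an extended formulation of size `r` has `T c n < r`
eventually (print: `xc ≥ 2^{Ω(n^{1/2})}`). ⟨abr.⟩ -/
def CorSandwichHard : Prop :=
  ∀ c : ℕ, ∃ n₀ : ℕ, ∀ n ≥ n₀, ∀ (K : Set (Fin (n * n) → ℝ)) (r : ℕ),
    Literature.Combinatorics.Optimization.FixedSizePsdRank.corPolytope n ⊆ K →
    (∀ x ∈ K, ∀ a : Finset (Fin n),
      Summit.ValiantsHypothesis.ValiantsHypothesis.Cruxes.NNLinearDegreeCofactorHard.XcDivision.udRow a ⬝ᵥ x ≤ 1 + Nat.sqrt (Nat.sqrt n)) →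
    HasEFOfSize K r → T c n < r

/-- **CLASS S — SHALLOW PASSENGERS** (value level; ⊇ CLASS F; contains every family of clique-row extent `≤ h^{1/4}`, in particular every
0/1 family with `≤ h^{1/8}` nonzero diagonal entries per generator difference): one generator is within `⌊⌊√h⌋^{1/2}⌋` of the family maximum
of EVERY clique row. -/
def Shallow (h : ℕ) {J : Type} (q : J → (Fin h × Fin h → ℝ)) : Prop :=
  ∃ j₀ : J, ∀ (a : Finset (Fin h)) (j : J), udRowG a ⬝ᵥ q j ≤ udRowG a ⬝ᵥ q j₀ + Nat.sqrt (Nat.sqrt h)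

theorem shallow_of_commonExtremiser (h : ℕ) {J : Type} (q : J → (Fin h × Fin h → ℝ)) (hF : CommonExtremiser h q) : Shallow h q := by
  obtain ⟨j₀, hj₀⟩ := hF
  refine ⟨j₀, fun a j => ?_⟩
  have : (0 : ℝ) ≤ Nat.sqrt (Nat.sqrt h) := by positivity
  linarith [hj₀ a j]

/-- ★ **CLASS S IS DECIDED modulo the BFPS sandwich theorem**: translate the shallow base generator to the origin; `COR(K_h) + Q` is then
sandwiched between `COR` and `(1 + h^{1/4})·Q(h)`. -/
theorem shallow_decided (hS : CorSandwichHard) :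
    ∀ c : ℕ, ∃ h₀ : ℕ, ∀ h ≥ h₀, ∀ (K : ℕ) (q : Fin (K + 1) → (Fin h × Fin h → ℝ)) (r : ℕ),
      Shallow h q →
      HasEFOfSize (corPolytopeGraph (⊤ : SimpleGraph (Fin h)) + convexHull ℝ (Set.range q)) r → T c h < r := by
  classical
  intro c
  obtain ⟨h₀, hh₀⟩ := hS c
  refine ⟨h₀, fun h hh K q r hSh hEF => ?_⟩
  obtain ⟨j₀, hj₀⟩ := hSh
  obtain ⟨pt_mem, cc_valid, -, -⟩ := Summit.ValiantsHypothesis.ValiantsHypothesis.Cruxes.NNLinearDegreeCofactorHard.XcDivision.ud_data h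
  -- transport to the flat currency
  let e : (Fin h × Fin h → ℝ) ≃ₗ[ℝ] (Fin (h * h) → ℝ) :=
    LinearEquiv.funCongrLeft ℝ ℝ (finProdFinEquiv (m := h) (n := h)).symm
  have himg : e '' (corPolytopeGraph (⊤ : SimpleGraph (Fin h)) + convexHull ℝ (Set.range q)) =
      Literature.Combinatorics.Optimization.FixedSizePsdRank.corPolytope h + convexHull ℝ (Set.range (e ∘ q)) := by
    rw [Set.image_add, Literature.Barriers.PneNP.corPolytope_eq_image_corPolytopeGraph_top, Set.range_comp]
    congr 1
    exact e.toLinearMap.image_convexHull (Set.range q)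
  have h' : HasEFOfSize (Literature.Combinatorics.Optimization.FixedSizePsdRank.corPolytope h + convexHull ℝ (Set.range (e ∘ q))) r := by
    rw [← himg]; exact (HasEFOfSize.image_linearEquiv_iff e).2 hEF
  have hdot : ∀ (a : Finset (Fin h)) (x : Fin h × Fin h → ℝ),
      Summit.ValiantsHypothesis.ValiantsHypothesis.Cruxes.NNLinearDegreeCofactorHard.XcDivision.udRow a ⬝ᵥ e x = udRowG a ⬝ᵥ x :=
    fun a x => udRow_dotProduct_funCongrLeft a x
  -- translate the base generator to the origin
  set v : Fin (h * h) → ℝ := e (q j₀) with hvdef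
  have hK := h'.image_add_const (-v)
  refine hh₀ h hh _ r ?_ ?_ hK
  · -- `COR ⊆ K`
    intro p hp
    refine ⟨p + v, Set.add_mem_add hp (subset_convexHull ℝ _ ⟨j₀, rfl⟩), ?_⟩
    simp
  · -- `K ⊆ (1 + h^{1/4}) · Q(h)`
    rintro _ ⟨z, hz, rfl⟩ a
    obtain ⟨p, hp, y, hy, rfl⟩ := Set.mem_add.1 hz
    have hyle : Summit.ValiantsHypothesis.ValiantsHypothesis.Cruxes.NNLinearDegreeCofactorHard.XcDivision.udRow a ⬝ᵥ y ≤
        Summit.ValiantsHypothesis.ValiantsHypothesis.Cruxes.NNLinearDegreeCofactorHard.XcDivision.udRow a ⬝ᵥ v + Nat.sqrt (Nat.sqrt h) := by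
      refine dot_le_of_mem_convexHull _ _ _ ?_ y hy
      rintro _ ⟨j, rfl⟩
      show _ ⬝ᵥ e (q j) ≤ _ ⬝ᵥ e (q j₀) + _
      rw [hdot, hdot]
      exact hj₀ a j
    rw [dotProduct_add, dotProduct_add, dotProduct_neg]
    linarith [cc_valid a p hp]

/-- **CLASS C LAW — THE OPEN CORE OF COR-VIRTUAL (load-bearing stub; rev 2, sharpened rev 5 by `¬ CommonExtremiser`, rev 6 by `¬ DiagFacePoor`, rev 7 by `¬ RootedExtremisers`)**: FAN-SATURATING passenger families —
GADGET-SATURATED (¬A⁺: every gadget placement sees a consistent difference with a live AND-diagonal, hence the nonzero equal-entry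
pattern — `hasG ⟨abr.⟩ -/
def GadgetSaturatedBudgetedLaw : Prop :=
  ∀ c : ℕ, ∃ h₀ : ℕ, ∀ h ≥ h₀, ∀ (K : ℕ) (q : Fin (K + 1) → (Fin h × Fin h → ℝ)) (r : ℕ),
    ¬ GadgetBlind h q → ¬ DimDeficient h q → ¬ BlockBlind h q → ¬ SparseDiff h q → ¬ CommonExtremiser h q →
    ¬ DiagFacePoor h q → ¬ RootedExtremisers h q → HasEFOfSize (convexHull ℝ (Set.range q)) r →
    HasEFOfSize (corPolytopeGraph (⊤ : SimpleGraph (Fin h)) + convexHull ℝ (Set.range q)) r → T c h < r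


/-- ★ FORMER STUB B — NOW A TREE THEOREM (rev 4 in-file; δ-wired to ✓ p661905): class B ⊆ class E, decided by the located-face exposure rung. -/
theorem sparseEdgePassengerLaw : SparseEdgePassengerLaw :=
  Summit.ValiantsHypothesis.ValiantsHypothesis.Theorems.FifoMatching.SparseEdgePassenger.sparseEdgePassengerLaw_holds

/-! REV 11 (R293 (1) / R294 (3)): the statement C `GadgetSaturatedBudgetedLaw` is NO LONGER a registered stub and carries no `sorry`;
the registered research stub is C♭ `stub_coreLaw` (§5), and `NNDivisionHard_ofC` below records the PROVED implication C ⇒ crux. -/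

/-- ★ **THE PARTITION GLUE (PROVED; exhaustive in the types by `by_cases` on the seven class predicates)**:
C-law ⇒ `CorVirtualHard` (classes A⁺, D, E, B, F, G and H being decided in this file). -/
theorem corVirtualHard_of_partition
    (hC : GadgetSaturatedBudgetedLaw) : CorVirtualHard := by
  intro c
  obtain ⟨h₁, hh₁⟩ := rate_of_lvl c
  obtain ⟨h₂, hh₂⟩ := sparseEdgePassengerLaw c
  obtain ⟨h₃, hh₃⟩ := hC c
  refine ⟨max h₁ (max h₂ h₃), fun h hh K q r hBq hEF => ?_⟩
  have hh1 : h₁ ≤ h := le_trans (le_max_left _ _) hh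
  have hh2 : h₂ ≤ h := le_trans (le_trans (le_max_left _ _) (le_max_right _ _)) hh
  have hh3 : h₃ ≤ h := le_trans (le_trans (le_max_right _ _) (le_max_right _ _)) hh
  have h2r : ((r : ℝ) + 1) ≤ 2 * (r + 1) := by
    have : (0 : ℝ) ≤ r := by positivity
    linarith
  by_cases hA : GadgetBlind h q
  · exact hh₁ h hh1 r (le_trans (gadgetBlind_three_halves_pow_le h q r hA hEF) h2r)
  by_cases hD : DimDeficient h q
  · exact hh₁ h hh1 r (le_trans (dimDeficient_three_halves_pow_le h q r hD hEF) h2r)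
  by_cases hE : BlockBlind h q
  · exact hh₁ h hh1 r (blockBlind_three_halves_pow_le locatedFaceExposureRung h K q r hE hEF)
  by_cases hS : SparseDiff h q
  · exact hh₂ h hh2 K q r hS hEF
  by_cases hF : CommonExtremiser h q
  · exact hh₁ h hh1 r (commonExtremiser_three_halves_pow_le h q r hF hEF)
  by_cases hG : DiagFacePoor h q
  · exact hh₁ h hh1 r (diagFacePoor_three_halves_pow_le h q r hG hEF)
  by_cases hH : RootedExtremisers h q
  · exact hh₁ h hh1 r (rootedExtremisers_three_halves_pow_le h q r hH hEF)
  · exact hh₃ h hh3 K q r hA hD hE hS hF hG hH hBq hEF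

/-! ### Name-keyed aliases `Registered.stub_x` of the stub statements (the skeleton audit reads hypothesis heads by name) -/
namespace Registered

/-- Statement C `GadgetSaturatedBudgetedLaw` (hypothesis of `NNDivisionHard_ofC`; not a registered stub since rev 11). -/
abbrev stub_gadgetSaturatedBudgetedLaw : Prop := GadgetSaturatedBudgetedLaw

end Registered

/-- ★★ (rev 1–10 composition, kept PROVED; since rev 11 NOT the registered skeleton) C → the crux, stated through the defeq alias
`XcDivision.VPLine.Crux21181` (`corVirtualHard_of_partition` — classes A⁺, D, E, B, F, G, H decided by tree theorems — then the budgeted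
transport `nnDivisionHard_of_corVirtual` of §1).  No `sorry` on this path: C is a hypothesis. -/
theorem NNDivisionHard_ofC (hC : Registered.stub_gadgetSaturatedBudgetedLaw) :
    Summit.ValiantsHypothesis.ValiantsHypothesis.Cruxes.NNLinearDegreeCofactorHard.XcDivision.VPLine.Crux21181 :=
  nnDivisionHard_of_corVirtual (corVirtualHard_of_partition hC)


/-! ### §5 (rev 9; THE REGISTERED SKELETON since rev 11) THE FINER COMPOSITION — the open core MODULO PRINT: `NNDivisionHard_of`

`NNDivisionHard_ofC` (hypothesis C, every other class decided by TREE theorems; registered skeleton of revs 1–10) is kept PROVED. ⟨abr.⟩ -/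

/-- **CLASS C♭ LAW — THE OPEN CORE MODULO PRINT (rev 9; binders added revs 10–18; the registered research statement of revs 11–18,
superseded by the WEAKER `CoreLawLoc` in rev 19 — `coreLawLoc_of_coreLaw`).**  As C, and moreover outside the sixteen classes ¬K ¬K_θ ¬R
¬R*_τ ¬S ¬E♭ ¬W ¬K^aff_θ ¬Z♭_c.  Stated for every `θ < 1`, `τ > 0`. -/
def CoreLaw : Prop :=
  ∀ θ : ℝ, θ < 1 → ∀ τ : ℝ, 0 < τ → ∀ c : ℕ, ∃ h₀ : ℕ, ∀ h ≥ h₀, ∀ (K : ℕ) (q : Fin (K + 1) → (Fin h × Fin h → ℝ)) (r : ℕ),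
    ¬ GadgetBlind h q → ¬ DimDeficient h q → ¬ BlockBlind h q → ¬ SparseDiff h q → ¬ CommonExtremiser h q →
    ¬ DiagFacePoor h q → ¬ RootedExtremisers h q →
    ¬ Theorems.FifoMatching.MaxCutLP.CutDominant h q → ¬ Theorems.FifoMatching.MaxCutLP.GapThin θ h q → ¬ NearRooted h q → ¬ MixedRooted τ h q → ¬ Shallow h q →
    ¬ FibreBlind h q → ¬ SwitchLocated h q → ¬ Theorems.FifoMatching.MaxCutLP.AffThin θ h q → ¬ ZonoBlind c h q →
    HasEFOfSize (convexHull ℝ (Set.range q)) r →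
    HasEFOfSize (corPolytopeGraph (⊤ : SimpleGraph (Fin h)) + convexHull ℝ (Set.range q)) r → T c h < r

/-- C ⇒ C♭ (the finer residual is weaker). -/
theorem coreLaw_of_gadgetSaturated (hC : GadgetSaturatedBudgetedLaw) : CoreLaw := by
  intro θ _ τ _ c
  obtain ⟨h₀, hh₀⟩ := hC c
  exact ⟨h₀, fun h hh K q r hA hD hE hS hF hG hH _ _ _ _ _ _ _ _ _ hB hEF => hh₀ h hh K q r hA hD hE hS hF hG hH hB hEF⟩

/-- ★ FORMER KNOWN STUB `stub_corSandwichHard` (revs 10–15): since rev 16 a THEOREM modulo the named Literature fact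
`BFPS2012_corSandwichHard` (BFPS 2012 Thm 6, ✓ p669963; bridge ✓ p670369 `CorSandwich.corSandwichHard_of_bfps`, val-port-3 g3; crit-9 V#28). -/
theorem corSandwichHard (hB : Literature.Combinatorics.Optimization.BFPS2012_corSandwichHard) : CorSandwichHard :=
  Summit.ValiantsHypothesis.ValiantsHypothesis.Theorems.FifoMatching.CorSandwich.corSandwichHard_of_bfps hB

/-- ★ FORMER KNOWN STUB `stub_bfps2012` (revs 16–20; `stub_corSandwichHard` revs 10–15) — DISCHARGED BY NAME in rev 21: the Literature fact
`BFPS2012_corSandwichHard` (BFPS 2012 Thm 6, ✓ p669963) is a THEOREM of the tree since ✓ p682764 (`Literature/Combinatorics/Optimization/UdisjShiftNonnegativeRank.lean`,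
littype-FN2-1 g25: Thm 6 ⇐ Thm 5 `BFPS2012_udisjShiftRankHard_holds` ⇐ Razborov, via the tree's `BFPS2012_corSandwichHard_of_udisjShiftRankHard`). -/
theorem bfps2012_known : Literature.Combinatorics.Optimization.BFPS2012_corSandwichHard :=
  Literature.Combinatorics.Optimization.BFPS2012_corSandwichHard_holds

/-- ★ FORMER KNOWN STUB `stub_udisjCorruption` (revs 9–20) — DISCHARGED BY NAME in rev 21: Razborov's corruption pair is a THEOREM of the tree since
✓ p682396 (`Literature/Computability/Complexity/UniqueDisjointnessCorruption.lean`, littype-FN2-1 g25, from the frame functionals `UdisjFrames`, `m = 600`,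
`κ = 2`); its statement `Literature.Computability.Complexity.udisjCorruption` is `UDISJCorruption` VERBATIM, so the term elaborates by unfolding. -/
theorem udisjCorruption_known : UDISJCorruption :=
  Literature.Computability.Complexity.udisjCorruption_holds

/-- FORMER KNOWN STUB (revs 9–12), DISCHARGED in rev 13 by val-idea-43 g3's unconditional proof (§3g cont.; tree theorem
`KothariMekaRaghavendra2017_cor15_maxCut_holds`). -/
theorem maxCutLPApproxHard : Theorems.FifoMatching.MaxCutLP.MaxCutLPApproxHard := Theorems.FifoMatching.MaxCutLP.maxCutLPApproxHard_holds

/-! ### §5b (REV 19–20) DELETION- AND ORBIT-LOCALIZATION BY NAME — val-idea-43 g5's `Localization` (✓ `…Theorems.FifoMatchingNNDivisionHardLocalization`) -/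

/-- **THE CONE `X₁₅(θ, τ)`** — the fifteen `c`-free decided class predicates of the line as ONE `Localization.PClass`
(Z♭_c is kept apart: its level depends on `c`, and `Localization.Decided` is uniform in `c`). -/
def Cone (θ τ : ℝ) : Theorems.FifoMatching.Localization.PClass := fun h _ q =>
  GadgetBlind h q ∨ DimDeficient h q ∨ BlockBlind h q ∨ SparseDiff h q ∨ CommonExtremiser h q ∨ DiagFacePoor h q ∨
  RootedExtremisers h q ∨ Theorems.FifoMatching.MaxCutLP.CutDominant h q ∨ Theorems.FifoMatching.MaxCutLP.GapThin θ h q ∨ NearRooted h q ∨ MixedRooted τ h q ∨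
  Shallow h q ∨ FibreBlind h q ∨ SwitchLocated h q ∨ Theorems.FifoMatching.MaxCutLP.AffThin θ h q

/-- ★ **THE CONE IS DECIDED (PROVED)** at `θ = 1/2`, `τ = τ₀ = 1/(4κ+4)`: KMR-theorem, Razborov-fact, BFPS-fact and the tree rungs. -/
theorem cone_decided (hM : Theorems.FifoMatching.MaxCutLP.MaxCutLPApproxHard) (hU : UDISJCorruption) (hW : CorSandwichHard) :
    ∃ τ₀ : ℝ, 0 < τ₀ ∧ Theorems.FifoMatching.Localization.Decided (Cone (1 / 2) τ₀) := by
  obtain ⟨τ₀, hτ₀, hR⟩ := mixedRooted_decided' hU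
  refine ⟨τ₀, hτ₀, fun c => ?_⟩
  obtain ⟨h₁, hh₁⟩ := rate_of_lvl c
  obtain ⟨h₂, hh₂⟩ := sparseEdgePassengerLaw c
  obtain ⟨h₄, hh₄⟩ := Theorems.FifoMatching.MaxCutLP.gapThin_decided hM (1 / 2) (by norm_num) c
  obtain ⟨h₅, hh₅⟩ := nearRooted_decided hU c
  obtain ⟨h₆, hh₆⟩ := Theorems.FifoMatching.MaxCutLP.cutDominant_decided (Theorems.FifoMatching.MaxCutLP.maxCutLPHard_of_approx hM) c
  obtain ⟨h₇, hh₇⟩ := shallow_decided hW c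
  obtain ⟨h₈, hh₈⟩ := hR c
  obtain ⟨h₉, hh₉⟩ := Theorems.FifoMatching.MaxCutLP.affThin_decided_holds (1 / 2) (by norm_num) c
  refine ⟨h₁ + h₂ + h₄ + h₅ + h₆ + h₇ + h₈ + h₉, fun h hh K q r hX hEF => ?_⟩
  have hh1 : h₁ ≤ h := by omega
  have h2r : ((r : ℝ) + 1) ≤ 2 * (r + 1) := by
    have : (0 : ℝ) ≤ r := by positivity
    linarith
  rcases hX with hA | hD | hE | hS | hF | hG | hH | hKc | hKt | hRn | hRm | hSh | hEb | hSw | hKa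
  · exact hh₁ h hh1 r (le_trans (gadgetBlind_three_halves_pow_le h q r hA hEF) h2r)
  · exact hh₁ h hh1 r (le_trans (dimDeficient_three_halves_pow_le h q r hD hEF) h2r)
  · exact hh₁ h hh1 r (blockBlind_three_halves_pow_le locatedFaceExposureRung h K q r hE hEF)
  · exact hh₂ h (by omega) K q r hS hEF
  · exact hh₁ h hh1 r (commonExtremiser_three_halves_pow_le h q r hF hEF)
  · exact hh₁ h hh1 r (diagFacePoor_three_halves_pow_le h q r hG hEF)
  · exact hh₁ h hh1 r (rootedExtremisers_three_halves_pow_le h q r hH hEF)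
  · exact hh₆ h (by omega) K q r hKc hEF
  · exact hh₄ h (by omega) K q r hKt hEF
  · exact hh₅ h (by omega) K q r hRn hEF
  · exact hh₈ h (by omega) K q r hRm hEF
  · exact hh₇ h (by omega) K q r hSh hEF
  · exact hh₁ h hh1 r (fibreBlind_three_halves_pow_le h K q r hEb hEF)
  · exact hh₁ h hh1 r (switchLocated_three_halves_pow_le h q r hSw hEF)
  · exact hh₉ h (by omega) _ q r hKa hEF

/-! ### §5c CLASSES P / P′ (rev 21, pen g3 — BY IMPORT, BY NAME): val-idea-40 g5's PIN-EXPOSED passengers and COLUMN-COUPLED AFFINE CUBES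
(`Theorems.FifoMatching.LocatedRows.PinExposed` ✓ p681115 `…LocatedRowsPinExposed`, `LocatedRows.ColumnCoupled` / `cubePt` ✓ p681292
`…LocatedRowsColumnCoupled`; decided AT THE TOP LAW by `LocatedRows.pinExposed_decided` / `LocatedRows.columnCoupled_decided`, flat socket), read
through §1's flat currency map.  Both classes are `c`-free and decide at the route rate (`3^{h−|S|} ≤ (r+1)·2^{h−|S|}` with `2|S| ≤ h`;
`3^{h−1} ≤ (r+1)·2^{h−1}`); no print stub is involved.  Members (40 g5): N18's `Q^∘` (`pinExposed_qOff`, `columnCoupled_qOff`), the diagonal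
permutahedra through `rev` (`pinExposed_qPerm`), N20's single-column-coupled affine cubes.  HONEST LABEL: these species were already decided for the
located programme's law C′; the intake only moves them into the TOP cone by name — no distance to the crux is claimed. -/

/-- §1's flat currency map `(Fin h × Fin h → ℝ) ≃ₗ (Fin (h·h) → ℝ)` (re-indexing along `finProdFinEquiv`; the map of
`corVirtualHard_of_corVirtualHardN`), under which `COR(K_h) ↦ corPolytope h` (`Literature.Barriers.PneNP.corPolytope_eq_image_corPolytopeGraph_top`). -/
abbrev flatE (h : ℕ) : (Fin h × Fin h → ℝ) ≃ₗ[ℝ] (Fin (h * h) → ℝ) :=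
  LinearEquiv.funCongrLeft ℝ ℝ (finProdFinEquiv (m := h) (n := h)).symm

/-- transport of an extended formulation of `COR(K_h) + conv q` to the flat currency `corPolytope h + conv (flatE ∘ q)` (the steps of
`corVirtualHard_of_corVirtualHardN`, verbatim). -/
theorem hasEFOfSize_flatE {h K r : ℕ} (q : Fin (K + 1) → (Fin h × Fin h → ℝ))
    (hR : HasEFOfSize (corPolytopeGraph (⊤ : SimpleGraph (Fin h)) + convexHull ℝ (Set.range q)) r) :
    HasEFOfSize (Literature.Combinatorics.Optimization.FixedSizePsdRank.corPolytope h +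
      convexHull ℝ (Set.range fun j => flatE h (q j))) r := by
  let e : (Fin h × Fin h → ℝ) ≃ₗ[ℝ] (Fin (h * h) → ℝ) :=
    LinearEquiv.funCongrLeft ℝ ℝ (finProdFinEquiv (m := h) (n := h)).symm
  show HasEFOfSize (Literature.Combinatorics.Optimization.FixedSizePsdRank.corPolytope h + convexHull ℝ (Set.range (e ∘ q))) r
  have hQimg : e '' convexHull ℝ (Set.range q) = convexHull ℝ (Set.range (e ∘ q)) := by
    rw [Set.range_comp]; exact e.toLinearMap.image_convexHull (Set.range q)
  have himg : e '' (corPolytopeGraph (⊤ : SimpleGraph (Fin h)) + convexHull ℝ (Set.range q)) =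
      Literature.Combinatorics.Optimization.FixedSizePsdRank.corPolytope h + convexHull ℝ (Set.range (e ∘ q)) := by
    rw [Set.image_add, Literature.Barriers.PneNP.corPolytope_eq_image_corPolytopeGraph_top, hQimg]
  rw [← himg]; exact (HasEFOfSize.image_linearEquiv_iff e).2 hR

/-- CLASS P (rev 21): the flat image of the family is PIN-EXPOSED in the sense of val-idea-40 g5 (`LocatedRows.PinExposed`: pin data
`(S, w, j⋆)` — a valid inequality `w` for `corPolytope h` tight on the whole coordinate face `F_S = {x_b : b ⊇ S}`, `2|S| ≤ h`, and ONE member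
`q_{j⋆}` maximising every tilted clique row `udRow a + w`, `a ⊆ Sᶜ`). -/
def PinLocated : Theorems.FifoMatching.Localization.PClass := fun h K q =>
  Theorems.FifoMatching.LocatedRows.PinExposed h K (fun j => flatE h (q j))

/-- ★ CLASS P IS DECIDED (PROVED, by name: `LocatedRows.pinExposed_decided` + `hasEFOfSize_flatE`; rate `1.5^{h−|S|} ≥ 1.5^{h/2}`). -/
theorem pinLocated_decided : Theorems.FifoMatching.Localization.Decided PinLocated := by
  intro c
  obtain ⟨n₀, hn₀⟩ := Theorems.FifoMatching.LocatedRows.pinExposed_decided c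
  exact ⟨n₀, fun h hh K q r hP hR => hn₀ h hh K (fun j => flatE h (q j)) r hP (hasEFOfSize_flatE q hR)⟩

/-- CLASS P′ (rev 21): the flat image of the family is the FULL vertex family of a COLUMN-COUPLED AFFINE CUBE (val-idea-40 g5 / crit-9 N20:
`q = cubePt Q₀ G ∘ e` with `e` onto the subsets of the generator set, `LocatedRows.ColumnCoupled G` — a nonnegative column weight pairing with
every generator's column-`x₀` profile at absolute value `≥ 1`). -/
def CubeLocated : Theorems.FifoMatching.Localization.PClass := fun h K q =>
  ∃ (N : ℕ) (Q₀ : Matrix (Fin h) (Fin h) ℝ) (G : Fin N → Matrix (Fin h) (Fin h) ℝ) (e : Fin (K + 1) → Finset (Fin N)),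
    Function.Surjective e ∧ Theorems.FifoMatching.LocatedRows.ColumnCoupled G ∧
    (fun j => flatE h (q j)) = Theorems.FifoMatching.LocatedRows.cubePt Q₀ G ∘ e

/-- ★ CLASS P′ IS DECIDED (PROVED, by name: `LocatedRows.columnCoupled_decided` + `hasEFOfSize_flatE`; rate `1.5^{h−1}`). -/
theorem cubeLocated_decided : Theorems.FifoMatching.Localization.Decided CubeLocated := by
  intro c
  obtain ⟨n₀, hn₀⟩ := Theorems.FifoMatching.LocatedRows.columnCoupled_decided c
  refine ⟨n₀, fun h hh K q r hP hR => ?_⟩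
  obtain ⟨N, Q₀, G, e, he, hcc, hq⟩ := hP
  have hR' := hasEFOfSize_flatE q hR
  rw [hq] at hR'
  exact hn₀ h hh N K Q₀ G e r he hcc hR'

/-- CLASS T `TwinLocated` (rev 22; val-idea-41's TWIN GENUS BY NAME — ✓ `Theorems/FifoMatchingNNDivisionHardShadowConstReadTwinFibre.lean`
`ShadowConstRead.sTopFibre_decided`; crit-9 g3 V#97 §1 / V#101b (3): OUTSIDE X₁₈ BY CONTENT — witness the π-SYMMETRIC lists `Q_j = π Q_j π` for the
twin involution π, arbitrary otherwise): a near-perfect twin frame `ι₁, ι₂ : Fin k ↪ Fin h` (disjoint images, `h ≤ 2k+1`), a pin `P ≥ 0` supported in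
`ι₂ × ι₂`, and PARTIAL COMMON MAXIMISERS of the twin directions `udRow (ι₁ a) − udRow (ι₂ a)` on the top fibre of `⟨flat P, ·⟩`
(`ShadowConstRead.TwinPCMOnTop`; `P = 0`: twin-PCM ⊇ TWIN-BLIND lists, `twinPCMOnTop_zero` / `twinPCM_of_twinBlind`; unique top: `sTop` ⊇ species TEN,
which is ALSO ⊆ P `PinLocated` — pen 01:25Z / V#101b (2)).  Read in flat currency through `flatE`; relisting-robust (only values `flat P ⬝ q j` and
`twinRow a ⬝ q j` are compared).  Rate `(3/2)^{k−2}` (41's `T_lt_of_block_wide`). -/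
def TwinLocated : Theorems.FifoMatching.Localization.PClass := fun h _K q =>
  ∃ (k : ℕ) (ι₁ ι₂ : Fin k ↪ Fin h) (P : Matrix (Fin h) (Fin h) ℝ), (∀ i j, ι₁ i ≠ ι₂ j) ∧ h ≤ 2 * k + 1 ∧ (∀ x y, 0 ≤ P x y) ∧
    (∀ x y, P x y ≠ 0 → x ∈ (Finset.univ : Finset (Fin k)).map ι₂ ∧ y ∈ (Finset.univ : Finset (Fin k)).map ι₂) ∧
    Theorems.FifoMatching.ShadowConstRead.TwinPCMOnTop ι₁ ι₂ (fun j => flatE h (q j)) P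

/-- ★ CLASS T is DECIDED (PROVED := val-idea-41's `ShadowConstRead.sTopFibre_decided`, by name). -/
theorem twinLocated_decided : Theorems.FifoMatching.Localization.Decided TwinLocated := by
  intro c
  obtain ⟨n₀, hn₀⟩ := Theorems.FifoMatching.ShadowConstRead.sTopFibre_decided c
  exact ⟨n₀, fun h hh K q r ⟨k, ι₁, ι₂, P, hι, hk, hP0, hPS, htop⟩ hR =>
    hn₀ h hh k ι₁ ι₂ hι hk K (fun j => flatE h (q j)) r P hP0 hPS htop (hasEFOfSize_flatE q hR)⟩

/-- the twin-blind special case (`P = 0`), for the census: 41's part 3 `TwinBlind` ⊆ CLASS T. -/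
theorem twinLocated_of_twinBlind {h K k : ℕ} (q : Theorems.FifoMatching.Localization.Fam h K) (ι₁ ι₂ : Fin k ↪ Fin h)
    (hι : ∀ i j, ι₁ i ≠ ι₂ j) (hk : h ≤ 2 * k + 1)
    (hB : Theorems.FifoMatching.ShadowConstRead.TwinBlind ι₁ ι₂ (fun j => flatE h (q j))) : TwinLocated h K q :=
  ⟨k, ι₁, ι₂, 0, hι, hk, fun _ _ => le_rfl, fun _ _ hP => absurd rfl hP,
    Theorems.FifoMatching.ShadowConstRead.twinPCMOnTop_zero ι₁ ι₂ _ (Theorems.FifoMatching.ShadowConstRead.twinPCM_of_twinBlind ι₁ ι₂ hB)⟩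

/-- **THE ENLARGED CONE `X₂₀(θ, τ) := X₁₅(θ, τ) ∨ DelLocated ∨ PinLocated ∨ CubeLocated ∨ TwinLocated ∨ UPat`** (X₁₉ revs 23–24, X₁₈ through rev 21) (rev 20 `X₁₆ = X₁₅ ∨ DelLocated`, pen g3: val-idea-43 g5's
UNCONDITIONAL deletion-located class `Localization.delLocated_decided`, ✓ `…LocalizationDeletion` — one disjunct buys all of 43's unconditional species
under the orbit closure: `ColSep ⊆ DelLocated` (`delLocated_of_colSep`), `SwitchSep ⊆ Sw ColSep` (`sw_colSep_of_switchSep`), the switched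
diag-permutahedra (`qPerm_swDelLocated`); rev 21: + val-idea-40 g5's located species P `PinLocated` / P′ `CubeLocated` of §5c, BY IMPORT).  No print
stub is involved in the added classes; rev 22: + CLASS T `TwinLocated` (val-idea-41's twin genus, BY IMPORT); **rev 25: X₂₀ := X₁₉ ∨ CLASS U
`Localization.UPat`** (val-idea-43 g6's GENUS I OF RECORD, BY IMPORT of ✓ `…LocalizationUPat(Face)`: a unique-disjointness pattern of order `⌊√h⌋` in the slack
matrix of the SUM; ⊇ `Hull (Face Quiet)` ⊇ every budget-free located species, `hullFaceQuiet_le_coneD`). -/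
def ConeD (θ τ : ℝ) : Theorems.FifoMatching.Localization.PClass := fun h K q =>
  Cone θ τ h K q ∨ Theorems.FifoMatching.Localization.DelLocated h K q ∨ PinLocated h K q ∨ CubeLocated h K q ∨ TwinLocated h K q ∨
    Theorems.FifoMatching.Localization.UPat h K q

/-- ★ the enlarged cone is DECIDED (PROVED): `decided_or` over `cone_decided`, `delLocated_decided`, `pinLocated_decided`, `cubeLocated_decided`, `twinLocated_decided`,
`Localization.uPat_decided` (rev 25). -/
theorem coneD_decided (hM : Theorems.FifoMatching.MaxCutLP.MaxCutLPApproxHard) (hU : UDISJCorruption) (hW : CorSandwichHard) :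
    ∃ τ₀ : ℝ, 0 < τ₀ ∧ Theorems.FifoMatching.Localization.Decided (ConeD (1 / 2) τ₀) := by
  obtain ⟨τ₀, hτ₀, hdec⟩ := cone_decided hM hU hW
  exact ⟨τ₀, hτ₀, Theorems.FifoMatching.Localization.decided_or hdec
    (Theorems.FifoMatching.Localization.decided_or Theorems.FifoMatching.Localization.delLocated_decided
      (Theorems.FifoMatching.Localization.decided_or pinLocated_decided
        (Theorems.FifoMatching.Localization.decided_or cubeLocated_decided
          (Theorems.FifoMatching.Localization.decided_or twinLocated_decided Theorems.FifoMatching.Localization.uPat_decided))))⟩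

/-- CLASS U ≤ X₂₀ (rev 25, census): GENUS I OF RECORD is a disjunct of the enlarged cone. -/
theorem uPat_le_coneD (θ τ : ℝ) {h K : ℕ} {q : Theorems.FifoMatching.Localization.Fam h K}
    (hq : Theorems.FifoMatching.Localization.UPat h K q) : ConeD θ τ h K q :=
  Or.inr (Or.inr (Or.inr (Or.inr (Or.inr hq))))

/-- `Hull (Face Quiet) ≤ X₂₀` (rev 25, census, BY NAME `Localization.hullFaceQuiet_le_uPat`): the whole budget-free located genus «one top on a free face, up to
presentation» is inside the enlarged cone itself (not only inside its functor tower). -/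
theorem hullFaceQuiet_le_coneD (θ τ : ℝ) {h K : ℕ} {q : Theorems.FifoMatching.Localization.Fam h K}
    (hq : Theorems.FifoMatching.Localization.Hull (Theorems.FifoMatching.Localization.Face Theorems.FifoMatching.Localization.Quiet) h K q) :
    ConeD θ τ h K q :=
  uPat_le_coneD θ τ (Theorems.FifoMatching.Localization.hullFaceQuiet_le_uPat hq)

/-- `OrbStar` is monotone in the class (lists of switchings and deletion minors are shared). -/
theorem orbStar_mono {X Y : Theorems.FifoMatching.Localization.PClass} (hXY : ∀ h K (q : Theorems.FifoMatching.Localization.Fam h K), X h K q → Y h K q)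
    {h K : ℕ} {q : Theorems.FifoMatching.Localization.Fam h K} (hq : Theorems.FifoMatching.Localization.OrbStar X h K q) :
    Theorems.FifoMatching.Localization.OrbStar Y h K q :=
  Theorems.FifoMatching.Localization.locAt_mono Nat.sqrt (X := Theorems.FifoMatching.Localization.SwStar X) (Y := Theorems.FifoMatching.Localization.SwStar Y)
    (fun _ _ _ hx => hx.imp fun _ hL => hXY _ _ _ hL) hq

/-- `OrbStar X₁₅ ≤ OrbStar X₂₀` (the cone only grew; X₁₉ through rev 24). -/
theorem orbStar_cone_le_coneD (θ τ : ℝ) {h K : ℕ} {q : Theorems.FifoMatching.Localization.Fam h K}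
    (hq : Theorems.FifoMatching.Localization.OrbStar (Cone θ τ) h K q) : Theorems.FifoMatching.Localization.OrbStar (ConeD θ τ) h K q :=
  orbStar_mono (fun _ _ _ hx => Or.inl hx) hq

/-- **CLASS C♭_loc LAW — THE OPEN CORE, DELETION-LOCALIZED (rev 19; the registered research statement of rev 19, superseded by the WEAKER
`CoreLawOrb` in rev 20 — `coreLawOrb_of_coreLawLoc`).**  Hardness `T c h < xc` is asked
only of BUDGETED families that are HEREDITARILY WILD: no deletion minor `A × A`, `|A| ≥ ⌊√h⌋`, of the family lies in the cone `X₁₅(θ, τ)`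
(`¬ Localization.Loc (Cone θ τ)`), and the family is not zone-blind zonotopal at level `2(log₂ h + c)^c + 4` (¬Z♭_c).  WEAKER than `CoreLaw`
(`coreLawLoc_of_coreLaw`); sufficient by val-idea-43 g5's LOCALIZATION THEOREM `Localization.decided_loc` (a decided minor of size `≥ √h`
decides the family at `c ↦ 2c`, `T_le_T_double`).  Stated for every `θ < 1`, `τ > 0`.  Canonical candidates: NONE KNOWN. -/
def CoreLawLoc : Prop :=
  ∀ θ : ℝ, θ < 1 → ∀ τ : ℝ, 0 < τ → ∀ c : ℕ, ∃ h₀ : ℕ, ∀ h ≥ h₀, ∀ (K : ℕ) (q : Fin (K + 1) → (Fin h × Fin h → ℝ)) (r : ℕ),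
    ¬ Theorems.FifoMatching.Localization.Loc (Cone θ τ) h K q → ¬ ZonoBlind c h q →
    HasEFOfSize (convexHull ℝ (Set.range q)) r →
    HasEFOfSize (corPolytopeGraph (⊤ : SimpleGraph (Fin h)) + convexHull ℝ (Set.range q)) r → T c h < r

/-- ★ C♭ ⇒ C♭_loc (PROVED): the rev-18 research stub implies the rev-19 one (`X ≤ Loc X`, `Localization.le_loc`). -/
theorem coreLawLoc_of_coreLaw (hC : CoreLaw) : CoreLawLoc := by
  intro θ hθ τ hτ c
  obtain ⟨h₀, hh₀⟩ := hC θ hθ τ hτ c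
  refine ⟨h₀, fun h hh K q r hL hZ hBq hEF => ?_⟩
  have hX : ¬ Cone θ τ h K q := fun hx => hL (Theorems.FifoMatching.Localization.le_loc _ hx)
  simp only [Cone, not_or] at hX
  obtain ⟨hA, hD, hE, hS, hF, hG, hH, hKc, hKt, hRn, hRm, hSh, hEb, hSw, hKa⟩ := hX
  exact hh₀ h hh K q r hA hD hE hS hF hG hH hKc hKt hRn hRm hSh hEb hSw hKa hZ hBq hEF

/-- **CLASS C♭_orb⋆ LAW — THE OPEN CORE, ORBIT-LOCALIZED (rev 20; THE REGISTERED RESEARCH STATEMENT).**  Hardness `T c h < xc` is asked only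
of BUDGETED families that are HEREDITARILY WILD UNDER SWITCHING: NO composite switching `swList L ∘ q` of the family has a deletion minor
`A × A`, `|A| ≥ ⌊√h⌋`, in the ENLARGED cone `ConeD θ τ` = `X₁₉(θ, τ) = X₁₅ ∨ DelLocated ∨ PinLocated ∨ CubeLocated ∨ TwinLocated` since rev 22 (rev 21 `X₁₈`, rev 20 `X₁₆ = X₁₅ ∨ DelLocated`)
(`¬ Localization.OrbStar (ConeD θ τ)`, `OrbStar X = Loc (SwStar X)`; val-idea-43 g5 kernel
rev 6a §10 = ✓ `…Theorems.FifoMatchingNNDivisionHardLocalizationOrbit`), and the family is not zone-blind zonotopal (¬Z♭_c).  WEAKER than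
`CoreLawLoc` (`coreLawOrb_of_coreLawLoc`, by `Localization.orb_le_orbStar ∘ loc_le_orb`); sufficient by the ORBIT-LOCALIZATION THEOREM
`Localization.decided_orbStar` (switchings are EF-size-preserving linear automorphisms of `COR(K_h)`, `hasEFOfSize_pair_swList`; then
`decided_loc`, `c ↦ 2c`).  Stated for every `θ < 1`, `τ > 0`.  Canonical candidates: NONE KNOWN (the pair sieve `OrbStar ColSep` is decided,
`Localization.orbStar_colSep_decided`: an enemy has, on every `√h` minor after every composite switching, two members agreeing on every column). -/
def CoreLawOrb : Prop :=
  ∀ θ : ℝ, θ < 1 → ∀ τ : ℝ, 0 < τ → ∀ c : ℕ, ∃ h₀ : ℕ, ∀ h ≥ h₀, ∀ (K : ℕ) (q : Fin (K + 1) → (Fin h × Fin h → ℝ)) (r : ℕ),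
    ¬ Theorems.FifoMatching.Localization.OrbStar (ConeD θ τ) h K q → ¬ ZonoBlind c h q →
    HasEFOfSize (convexHull ℝ (Set.range q)) r →
    HasEFOfSize (corPolytopeGraph (⊤ : SimpleGraph (Fin h)) + convexHull ℝ (Set.range q)) r → T c h < r

/-- ★ C♭_loc ⇒ C♭_orb⋆ (PROVED): the rev-19 research stub implies the rev-20 one (`Loc X ≤ Orb X ≤ OrbStar X`). -/
theorem coreLawOrb_of_coreLawLoc (hC : CoreLawLoc) : CoreLawOrb := by
  intro θ hθ τ hτ c
  obtain ⟨h₀, hh₀⟩ := hC θ hθ τ hτ c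
  exact ⟨h₀, fun h hh K q r hO hZ hBq hEF => hh₀ h hh K q r
    (fun hL => hO (orbStar_cone_le_coneD θ τ (Theorems.FifoMatching.Localization.orb_le_orbStar (Theorems.FifoMatching.Localization.loc_le_orb hL)))) hZ hBq hEF⟩

/-- the full audit chain C ⇒ C♭ ⇒ C♭_loc ⇒ C♭_orb⋆ (PROVED). -/
theorem coreLawOrb_of_gadgetSaturated (hC : GadgetSaturatedBudgetedLaw) : CoreLawOrb :=
  coreLawOrb_of_coreLawLoc (coreLawLoc_of_coreLaw (coreLaw_of_gadgetSaturated hC))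

/-- **CLASS C♭_face⋆ LAW — THE OPEN CORE, FACE- AND AUTOMORPHISM-LOCALIZED (rev 23; THE REGISTERED RESEARCH STATEMENT since rev 23).**
Hardness `T c h < xc(COR(K_h) + Q)` is asked only of BUDGETED families `q` that are WILD ON EVERY FREE FACE IN EVERY ROOTING: the family is NOT in
`Localization.Face (Localization.AutStar (ConeD θ τ))` — i.e. there is NO valid inequality `(w, M)` of `COR(K_h)` with a FREE transversal
`ι : Fin ℓ ↪ Fin h`, `⌊√h⌋ ≤ ℓ` (every pattern on `ι` extends to a `w`-tight clique vertex), whose `w`-top sub-family, read on `ι × ι`, has a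
composite AUTOMORPHISM image (switchings `swLin a` AND re-rootings `rootLin i` — the full linear part of `Is(CUT□_(h+1)) = S_(h+1) ⋉ switchings`,
Deza–Laurent p. 135 / DGL91, val-idea-43 g6 (A)) with a `⌊√ℓ⌋`-deletion minor in the cone `ConeD θ τ` (X₁₉) — and the family is not zone-blind
zonotopal (¬Z♭_c).  WEAKER than `CoreLawOrb` (`coreLawFace_of_coreLawOrb`: `OrbStar X ≤ AutStar X ≤ Face (AutStar X)`, 43's
`orbStar_le_autStar` / `le_face`); sufficient by 43's FREE-FACE LOCALIZATION THEOREM `Localization.decided_face` (a free face of `COR(K_h)` reads ONTO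
`COR(K_ℓ)`, `delRead_image_corFace`; the top face of the passenger hull rides along with NO size loss, `HasEFOfSize.image_face_add_image_face₁`;
`c ↦ 2c`, `h₀ ↦ h₀²`) composed with `Localization.decided_autStar` (✓ `…LocalizationRoot` / `…LocalizationFace` / `…LocalizationFaceSpecies`,
p687218 / p687398 / p688217).  GENUS-I species are members of the excluded class BY NAME (43's instance lemmas: `face_of_uniqueTop`, `delLocated_le_faceQuiet`,
`face_of_stable`, `face_of_agree`, `faceQuiet_of_twoScaleTop` — so val-idea-38's ELEVEN / TWELVE lexicographic tops and 41's TEN pins are inside once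
their reads are).  Stated for every `θ < 1`, `τ > 0`.  Canonical candidates: NONE KNOWN. -/
def CoreLawFace : Prop :=
  ∀ θ : ℝ, θ < 1 → ∀ τ : ℝ, 0 < τ → ∀ c : ℕ, ∃ h₀ : ℕ, ∀ h ≥ h₀, ∀ (K : ℕ) (q : Fin (K + 1) → (Fin h × Fin h → ℝ)) (r : ℕ),
    ¬ Theorems.FifoMatching.Localization.Face (Theorems.FifoMatching.Localization.AutStar (ConeD θ τ)) h K q → ¬ ZonoBlind c h q →
    HasEFOfSize (convexHull ℝ (Set.range q)) r →
    HasEFOfSize (corPolytopeGraph (⊤ : SimpleGraph (Fin h)) + convexHull ℝ (Set.range q)) r → T c h < r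

/-- ★ C♭_orb⋆ ⇒ C♭_face⋆ (PROVED): the rev-20/22 research statement implies the rev-23 one (`OrbStar X ≤ AutStar X ≤ Face (AutStar X)`,
val-idea-43 g6's `orbStar_le_autStar` and `le_face`). -/
theorem coreLawFace_of_coreLawOrb (hC : CoreLawOrb) : CoreLawFace := by
  intro θ hθ τ hτ c
  obtain ⟨h₀, hh₀⟩ := hC θ hθ τ hτ c
  exact ⟨h₀, fun h hh K q r hF hZ hBq hEF => hh₀ h hh K q r
    (fun hO => hF (Theorems.FifoMatching.Localization.le_face (Theorems.FifoMatching.Localization.orbStar_le_autStar hO))) hZ hBq hEF⟩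

/-- the full audit chain C ⇒ C♭ ⇒ C♭_loc ⇒ C♭_orb⋆ ⇒ C♭_face⋆ (PROVED). -/
theorem coreLawFace_of_gadgetSaturated (hC : GadgetSaturatedBudgetedLaw) : CoreLawFace :=
  coreLawFace_of_coreLawOrb (coreLawOrb_of_gadgetSaturated hC)

/-- **CLASS C♭_hull LAW — THE OPEN CORE, HULL-CLOSED (rev 24; THE REGISTERED RESEARCH STATEMENT since rev 24).**  `CoreLawFace` with the
excluded class replaced by its HULL CLOSURE `Localization.Hull (Localization.Face (Localization.AutStar (ConeD θ τ)))`: hardness is asked only of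
budgeted, not zone-blind families `q` such that NO PRESENTATION `q'` OF THE SAME POLYTOPE `conv (range q') = conv (range q)` is face- or automorphism-
located in the cone X₁₉ (X₂₀ `= X₁₉ ∨ UPat` since rev 25) — the research statement is now a statement about PASSENGER POLYTOPES, not lists (val-idea-43 g6's `Hull`, `decided_hull`:
`Decided` only speaks of `conv (range q)`; ✓ `…LocalizationWeightedPin`).  WEAKER than `CoreLawFace` (`coreLawHull_of_coreLawFace`, `le_hull`);
sufficient by `decided_hull ∘ decided_face_autStar`.  Canonical candidates: NONE KNOWN. -/
def CoreLawHull : Prop :=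
  ∀ θ : ℝ, θ < 1 → ∀ τ : ℝ, 0 < τ → ∀ c : ℕ, ∃ h₀ : ℕ, ∀ h ≥ h₀, ∀ (K : ℕ) (q : Fin (K + 1) → (Fin h × Fin h → ℝ)) (r : ℕ),
    ¬ Theorems.FifoMatching.Localization.Hull (Theorems.FifoMatching.Localization.Face (Theorems.FifoMatching.Localization.AutStar (ConeD θ τ))) h K q → ¬ ZonoBlind c h q →
    HasEFOfSize (convexHull ℝ (Set.range q)) r →
    HasEFOfSize (corPolytopeGraph (⊤ : SimpleGraph (Fin h)) + convexHull ℝ (Set.range q)) r → T c h < r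

/-- ★ C♭_face⋆ ⇒ C♭_hull (PROVED): `X ≤ Hull X` (val-idea-43 g6's `le_hull`). -/
theorem coreLawHull_of_coreLawFace (hC : CoreLawFace) : CoreLawHull := by
  intro θ hθ τ hτ c
  obtain ⟨h₀, hh₀⟩ := hC θ hθ τ hτ c
  exact ⟨h₀, fun h hh K q r hH hZ hBq hEF => hh₀ h hh K q r (fun hF => hH (Theorems.FifoMatching.Localization.le_hull _ hF)) hZ hBq hEF⟩

/-- the full audit chain C ⇒ C♭ ⇒ C♭_loc ⇒ C♭_orb⋆ ⇒ C♭_face⋆ ⇒ C♭_hull (PROVED). -/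
theorem coreLawHull_of_gadgetSaturated (hC : GadgetSaturatedBudgetedLaw) : CoreLawHull :=
  coreLawHull_of_coreLawFace (coreLawFace_of_gadgetSaturated hC)

/-- ★ **RESEARCH STUB — C♭_hull since rev 24, over the cone X₂₀ since rev 25 (THE registered research stub `stub_coreLaw`; C♭_face⋆ rev 23; C♭_orb⋆ revs 20–22; C♭_loc rev 19; C♭ revs 11–18, R293 (1) /
R294 (3))** — the open core of COR-VIRTUAL modulo print, orbit-localized.  HONESTY CLAUSE (R294 (2); val-idea-40 `core_meets_every_orbit`): the excluded
classes are DECIDED SUB-POPULATIONS; every cheap pair still has a budgeted `nf` presentation outside the EXACT-extremiser classes, so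
C♭_orb⋆ ∧ BFPS ∧ Razborov ⟺ `CorVirtualHard` up to `r ↦ 2r + h` — the distance to the crux is UNCHANGED by every intake.  No explicit member
of the residual population is known (Negative lane ✓ p665973 · p670959 · p671347 · p674104 · p679540).  ⟨abr.⟩ -/
theorem stub_coreLaw : CoreLawHull := by
  sorry

/-- ★ **THE ORBIT-LOCALIZED PARTITION GLUE (PROVED, rev 20)**: KMR-theorem ⇒ Razborov-fact ⇒ BFPS-fact ⇒ C♭_orb⋆ ⇒ `CorVirtualHard` —
families some composite switching of which has a `⌊√h⌋`-minor in the enlarged cone are decided by `Localization.decided_orbStar (coneD_decided …)`,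
zone-blind ones by `zonoBlind_decided`, the hereditarily-wild-under-switching rest is the stub. -/
theorem corVirtualHard_of_partitionOrb (hM : Theorems.FifoMatching.MaxCutLP.MaxCutLPApproxHard) (hU : UDISJCorruption) (hW : CorSandwichHard)
    (hC : CoreLawOrb) : CorVirtualHard := by
  intro c
  obtain ⟨τ₀, hτ₀, hdec⟩ := coneD_decided hM hU hW
  obtain ⟨h₁, hh₁⟩ := Theorems.FifoMatching.Localization.decided_orbStar hdec c
  obtain ⟨h₃, hh₃⟩ := hC (1 / 2) (by norm_num) τ₀ hτ₀ c
  refine ⟨h₁ + h₃, fun h hh K q r hBq hEF => ?_⟩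
  by_cases hL : Theorems.FifoMatching.Localization.OrbStar (ConeD (1 / 2) τ₀) h K q
  · exact hh₁ h (by omega) K q r hL hEF
  by_cases hZ : ZonoBlind c h q
  · exact zonoBlind_decided c h K q r hZ hEF
  · exact hh₃ h (by omega) K q r hL hZ hBq hEF

/-- ★ **THE FACE-LOCALIZED PARTITION GLUE (PROVED, rev 23)**: families in `Face (AutStar (ConeD ½ τ₀))` are decided by val-idea-43 g6's
`Localization.decided_face_autStar (coneD_decided …)` (= `decided_face ∘ decided_autStar`), zone-blind ones by `zonoBlind_decided`, the rest is
the research stub C♭_face⋆. -/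
theorem corVirtualHard_of_partitionFace (hM : Theorems.FifoMatching.MaxCutLP.MaxCutLPApproxHard) (hU : UDISJCorruption) (hW : CorSandwichHard)
    (hC : CoreLawFace) : CorVirtualHard := by
  intro c
  obtain ⟨τ₀, hτ₀, hdec⟩ := coneD_decided hM hU hW
  obtain ⟨h₁, hh₁⟩ := Theorems.FifoMatching.Localization.decided_face_autStar hdec c
  obtain ⟨h₃, hh₃⟩ := hC (1 / 2) (by norm_num) τ₀ hτ₀ c
  refine ⟨h₁ + h₃, fun h hh K q r hBq hEF => ?_⟩
  by_cases hL : Theorems.FifoMatching.Localization.Face (Theorems.FifoMatching.Localization.AutStar (ConeD (1 / 2) τ₀)) h K q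
  · exact hh₁ h (by omega) K q r hL hEF
  by_cases hZ : ZonoBlind c h q
  · exact zonoBlind_decided c h K q r hZ hEF
  · exact hh₃ h (by omega) K q r hL hZ hBq hEF

/-- ★ **THE HULL-CLOSED PARTITION GLUE (PROVED, rev 24)**: polytopes with SOME presentation in `Face (AutStar (ConeD ½ τ₀))` are decided by
`Localization.decided_hull (decided_face_autStar (coneD_decided …))`, zone-blind lists by `zonoBlind_decided`, the rest is the research stub C♭_hull. -/
theorem corVirtualHard_of_partitionHull (hM : Theorems.FifoMatching.MaxCutLP.MaxCutLPApproxHard) (hU : UDISJCorruption) (hW : CorSandwichHard)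
    (hC : CoreLawHull) : CorVirtualHard := by
  intro c
  obtain ⟨τ₀, hτ₀, hdec⟩ := coneD_decided hM hU hW
  obtain ⟨h₁, hh₁⟩ := Theorems.FifoMatching.Localization.decided_hull (Theorems.FifoMatching.Localization.decided_face_autStar hdec) c
  obtain ⟨h₃, hh₃⟩ := hC (1 / 2) (by norm_num) τ₀ hτ₀ c
  refine ⟨h₁ + h₃, fun h hh K q r hBq hEF => ?_⟩
  by_cases hL : Theorems.FifoMatching.Localization.Hull (Theorems.FifoMatching.Localization.Face (Theorems.FifoMatching.Localization.AutStar (ConeD (1 / 2) τ₀))) h K q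
  · exact hh₁ h (by omega) K q r hL hEF
  by_cases hZ : ZonoBlind c h q
  · exact zonoBlind_decided c h K q r hZ hEF
  · exact hh₃ h (by omega) K q r hL hZ hBq hEF

/-- the rev-20 glue through the rev-23 statement (PROVED): C♭_orb⋆ ⇒ C♭_face⋆ ⇒ `CorVirtualHard`. -/
theorem corVirtualHard_of_partitionOrb' (hM : Theorems.FifoMatching.MaxCutLP.MaxCutLPApproxHard) (hU : UDISJCorruption) (hW : CorSandwichHard)
    (hC : CoreLawOrb) : CorVirtualHard :=
  corVirtualHard_of_partitionFace hM hU hW (coreLawFace_of_coreLawOrb hC)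

/-- ★ the rev-19 glue (PROVED): C♭_loc ⇒ `CorVirtualHard`, now through C♭_orb⋆. -/
theorem corVirtualHard_of_partitionLoc (hM : Theorems.FifoMatching.MaxCutLP.MaxCutLPApproxHard) (hU : UDISJCorruption) (hW : CorSandwichHard)
    (hC : CoreLawLoc) : CorVirtualHard :=
  corVirtualHard_of_partitionOrb hM hU hW (coreLawOrb_of_coreLawLoc hC)

/-- ★ the rev 11–18 glue (PROVED): C♭ ⇒ `CorVirtualHard`, now through C♭_loc. -/
theorem corVirtualHard_of_partition' (hM : Theorems.FifoMatching.MaxCutLP.MaxCutLPApproxHard) (hU : UDISJCorruption) (hW : CorSandwichHard)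
    (hC : CoreLaw) : CorVirtualHard :=
  corVirtualHard_of_partitionLoc hM hU hW (coreLawLoc_of_coreLaw hC)

namespace Registered

-- rev 21: the KNOWN stubs `stub_udisjCorruption` / `stub_bfps2012` are DISCHARGED (theorems `udisjCorruption_known` / `bfps2012_known`); their
-- `Registered` aliases are retired with them — the skeleton keeps ONE binder.
/-- Statement of the RESEARCH stub `stub_coreLaw` (rev 24: C♭_hull; C ⇒ C♭ ⇒ C♭_loc ⇒ C♭_orb⋆ ⇒ C♭_face⋆ ⇒ C♭_hull by `coreLawHull_of_gadgetSaturated`). -/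
abbrev stub_coreLaw : Prop := CoreLawHull

end Registered

/-- ★ HONESTY CLAUSE IN KERNEL (rev 21): COR-VIRTUAL implies the research stub by DROPPING the residual hypotheses … -/
theorem coreLawOrb_of_corVirtualHard (hV : CorVirtualHard) : CoreLawOrb := by
  intro θ _ τ _ c
  obtain ⟨h₀, hh₀⟩ := hV c
  exact ⟨h₀, fun h hh K q r _ _ hBq hEF => hh₀ h hh K q r hBq hEF⟩

/-- ★ … and the partition glue, UNCONDITIONAL since rev 21 (KMR theorem rev 13, Razborov ✓ p682396, BFPS ✓ p682764), gives the converse: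
**`CoreLawOrb ↔ CorVirtualHard`** — the research stub IS COR-VIRTUAL restated on its undecided residual (R294 (2) honesty clause, now a theorem). -/
theorem coreLawOrb_iff_corVirtualHard : CoreLawOrb ↔ CorVirtualHard :=
  ⟨corVirtualHard_of_partitionOrb maxCutLPApproxHard udisjCorruption_known (corSandwichHard bfps2012_known), coreLawOrb_of_corVirtualHard⟩

/-- ★ HONESTY CLAUSE IN KERNEL for the rev-23 statement: COR-VIRTUAL implies C♭_face⋆ by dropping the residual hypotheses … -/
theorem coreLawFace_of_corVirtualHard (hV : CorVirtualHard) : CoreLawFace :=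
  coreLawFace_of_coreLawOrb (coreLawOrb_of_corVirtualHard hV)

/-- ★ … and conversely by the face-localized partition glue: **`CoreLawFace ↔ CorVirtualHard`** — the re-typed research stub is STILL exactly
COR-VIRTUAL restated on its (smaller) undecided residual; no intake moves the distance to the crux (R294 (2)). -/
theorem coreLawFace_iff_corVirtualHard : CoreLawFace ↔ CorVirtualHard :=
  ⟨corVirtualHard_of_partitionFace maxCutLPApproxHard udisjCorruption_known (corSandwichHard bfps2012_known), coreLawFace_of_corVirtualHard⟩

/-- the two research statements are equivalent (both are COR-VIRTUAL). -/
theorem coreLawFace_iff_coreLawOrb : CoreLawFace ↔ CoreLawOrb :=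
  coreLawFace_iff_corVirtualHard.trans coreLawOrb_iff_corVirtualHard.symm

/-- ★ HONESTY CLAUSE IN KERNEL for the rev-24 statement: COR-VIRTUAL implies C♭_hull by dropping the residual hypotheses … -/
theorem coreLawHull_of_corVirtualHard (hV : CorVirtualHard) : CoreLawHull :=
  coreLawHull_of_coreLawFace (coreLawFace_of_corVirtualHard hV)

/-- ★ … and conversely by the hull-closed partition glue: **`CoreLawHull ↔ CorVirtualHard`** — the re-typed research stub is STILL exactly
COR-VIRTUAL restated on its (smaller) undecided residual (R294 (2)). -/
theorem coreLawHull_iff_corVirtualHard : CoreLawHull ↔ CorVirtualHard :=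
  ⟨corVirtualHard_of_partitionHull maxCutLPApproxHard udisjCorruption_known (corSandwichHard bfps2012_known), coreLawHull_of_corVirtualHard⟩

/-- the rev-23 and rev-24 research statements are equivalent. -/
theorem coreLawHull_iff_coreLawFace : CoreLawHull ↔ CoreLawFace :=
  coreLawHull_iff_corVirtualHard.trans coreLawFace_iff_corVirtualHard.symm

/-- ★ **KILL LINE OF RECORD, IN KERNEL (rev 22; crit-9 g3 V#100 (b′)):** a kernel `¬ CorVirtualHardN` in the flat Theorems currency — e.g. a
refutation of C′ = `LocatedRows.ExactPencilLaw` once 41 g4's `exactPencilLaw_iff_corVirtualHardN` is kernel — refutes the research stub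
`stub_coreLaw` (every rev of this line falls with it; the crux 21181 itself is NOT refuted by it and stays OPEN). -/
theorem not_coreLawOrb_of_not_corVirtualHardN
    (hN : ¬ Summit.ValiantsHypothesis.ValiantsHypothesis.Theorems.FifoMatching.LocatedRows.CorVirtualHardN) : ¬ CoreLawOrb :=
  fun hC => hN (Summit.ValiantsHypothesis.ValiantsHypothesis.Cruxes.NNLinearDegreeCofactorHard.XcDivision.VPLine.corVirtualHardN_iff_locatedRows.1
    (Summit.ValiantsHypothesis.ValiantsHypothesis.Cruxes.NNLinearDegreeCofactorHard.XcDivision.VPLine.corVirtualHardN_of_corVirtualHard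
      (coreLawOrb_iff_corVirtualHard.1 hC)))

/-- … and conversely the research stub is exactly flat COR-VIRTUAL (rev 22, by name). -/
theorem coreLawOrb_iff_corVirtualHardN :
    CoreLawOrb ↔ Summit.ValiantsHypothesis.ValiantsHypothesis.Theorems.FifoMatching.LocatedRows.CorVirtualHardN :=
  coreLawOrb_iff_corVirtualHard.trans
    (Summit.ValiantsHypothesis.ValiantsHypothesis.Cruxes.NNLinearDegreeCofactorHard.XcDivision.VPLine.corVirtualHardN_iff_corVirtualHard.symm.trans
      Summit.ValiantsHypothesis.ValiantsHypothesis.Cruxes.NNLinearDegreeCofactorHard.XcDivision.VPLine.corVirtualHardN_iff_locatedRows)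

/-- ★ **KILL LINE OF RECORD, IN KERNEL, for the rev-23 stub:** `¬ LocatedRows.CorVirtualHardN → ¬ CoreLawFace` (≡ `¬ ExactPencilLaw → …` by
val-idea-41 g4's `exactPencilLaw_iff_corVirtualHardN`, ✓ p688316 `…Theorems.FifoMatchingNNDivisionHardExactIsVirtual`; see `not_coreLawFace_of_not_exactPencilLaw` below). -/
theorem not_coreLawFace_of_not_corVirtualHardN
    (hN : ¬ Summit.ValiantsHypothesis.ValiantsHypothesis.Theorems.FifoMatching.LocatedRows.CorVirtualHardN) : ¬ CoreLawFace :=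
  fun hC => not_coreLawOrb_of_not_corVirtualHardN hN (coreLawFace_iff_coreLawOrb.1 hC)

/-- … and `CoreLawFace ↔ LocatedRows.CorVirtualHardN` (flat currency, by name). -/
theorem coreLawFace_iff_corVirtualHardN :
    CoreLawFace ↔ Summit.ValiantsHypothesis.ValiantsHypothesis.Theorems.FifoMatching.LocatedRows.CorVirtualHardN :=
  coreLawFace_iff_coreLawOrb.trans coreLawOrb_iff_corVirtualHardN

/-- ★★ **THE KILL CHAIN OF RECORD IN ONE NAME (director R335 (2)(b′) / R341 (1), live since T1 ✓ p688316):** `CoreLawFace ↔ ExactPencilLaw` —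
the registered research stub IS val-idea-38/40/41's exact-pencil law C′ (`LocatedRows.ExactPencilLaw`), by `coreLawFace_iff_corVirtualHardN` and
val-idea-41 g4's `ExactIsVirtual.exactPencilLaw_iff_corVirtualHardN` (✓ p688316 `…Theorems.FifoMatchingNNDivisionHardExactIsVirtual`). -/
theorem coreLawFace_iff_exactPencilLaw : CoreLawFace ↔ Summit.ValiantsHypothesis.ValiantsHypothesis.Theorems.FifoMatching.LocatedRows.ExactPencilLaw :=
  coreLawFace_iff_corVirtualHardN.trans Summit.ValiantsHypothesis.ValiantsHypothesis.Theorems.FifoMatching.ExactIsVirtual.exactPencilLaw_iff_corVirtualHardN.symm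

/-- ★★ … hence ANY kernel `¬ ExactPencilLaw` (an explicit enemy of C′ surviving in Theorems) REFUTES `stub_coreLaw` and this LINE — not the crux
`NNDivisionHard` (21181 stays OPEN; a new line would be needed). -/
theorem not_coreLawFace_of_not_exactPencilLaw (hN : ¬ Summit.ValiantsHypothesis.ValiantsHypothesis.Theorems.FifoMatching.LocatedRows.ExactPencilLaw) : ¬ CoreLawFace :=
  fun hC => hN (coreLawFace_iff_exactPencilLaw.1 hC)

/-- the rev-20/22 statement likewise: `CoreLawOrb ↔ ExactPencilLaw`. -/
theorem coreLawOrb_iff_exactPencilLaw : CoreLawOrb ↔ Summit.ValiantsHypothesis.ValiantsHypothesis.Theorems.FifoMatching.LocatedRows.ExactPencilLaw :=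
  coreLawFace_iff_coreLawOrb.symm.trans coreLawFace_iff_exactPencilLaw

/-- bookkeeping: the line's graph-currency `CorVirtualHard` (§1, `…XcDivision.VPLine.CorVirtualHard`) IS val-idea-43's Theorems copy
`Localization.CorVirtualHard` (✓ `…FifoMatchingNNDivisionHardLocalization`), definitionally. -/
theorem corVirtualHard_iff_localization : CorVirtualHard ↔ Theorems.FifoMatching.Localization.CorVirtualHard :=
  Iff.rfl

/-- ★★ KILL CHAIN OF RECORD for the rev-24 stub, ONE NAME: `¬ ExactPencilLaw → ¬ CoreLawHull`. -/
theorem not_coreLawHull_of_not_exactPencilLaw (hN : ¬ Summit.ValiantsHypothesis.ValiantsHypothesis.Theorems.FifoMatching.LocatedRows.ExactPencilLaw) : ¬ CoreLawHull :=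
  fun hC => not_coreLawFace_of_not_exactPencilLaw hN (coreLawHull_iff_coreLawFace.1 hC)

/-- `CoreLawHull ↔ ExactPencilLaw` and `↔ LocatedRows.CorVirtualHardN`. -/
theorem coreLawHull_iff_exactPencilLaw : CoreLawHull ↔ Summit.ValiantsHypothesis.ValiantsHypothesis.Theorems.FifoMatching.LocatedRows.ExactPencilLaw :=
  coreLawHull_iff_coreLawFace.trans coreLawFace_iff_exactPencilLaw

theorem coreLawHull_iff_corVirtualHardN : CoreLawHull ↔ Summit.ValiantsHypothesis.ValiantsHypothesis.Theorems.FifoMatching.LocatedRows.CorVirtualHardN :=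
  coreLawHull_iff_coreLawFace.trans coreLawFace_iff_corVirtualHardN

theorem not_coreLawHull_of_not_corVirtualHardN (hN : ¬ Summit.ValiantsHypothesis.ValiantsHypothesis.Theorems.FifoMatching.LocatedRows.CorVirtualHardN) : ¬ CoreLawHull :=
  fun hC => hN (coreLawHull_iff_corVirtualHardN.1 hC)

/-- ★★ **THE REGISTERED SKELETON (rev 21: ONE binder; rev 11 R293 (1) / R294 (3) SWITCH GO with two KNOWN port stubs Razborov · BFPS + the research
core; rev 13: KMR binder DISCHARGED; rev 21: Razborov and BFPS binders DISCHARGED BY NAME, `udisjCorruption_known` / `bfps2012_known`):** the research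
core C♭_orb⋆ ⇒ `Theses.FifoMatching.NNDivisionHard` BY NAME.  Sorry count of record: 1 = research. -/
theorem NNDivisionHard_of (hC : Registered.stub_coreLaw) :
    Summit.ValiantsHypothesis.ValiantsHypothesis.Theses.FifoMatching.NNDivisionHard :=
  nnDivisionHard_of_corVirtual (corVirtualHard_of_partitionHull maxCutLPApproxHard udisjCorruption_known (corSandwichHard bfps2012_known) hC)

/-- Wiring checks: the registered stub feeds `NNDivisionHard_of` as stated; the alias unfolds to the crux by `Iff.rfl`; C alone still
concludes the crux (`NNDivisionHard_ofC ∘ _`, no print binder). -/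
example : Summit.ValiantsHypothesis.ValiantsHypothesis.Theses.FifoMatching.NNDivisionHard :=
  NNDivisionHard_of stub_coreLaw
example : (Summit.ValiantsHypothesis.ValiantsHypothesis.Cruxes.NNLinearDegreeCofactorHard.XcDivision.VPLine.Crux21181 ↔
    Summit.ValiantsHypothesis.ValiantsHypothesis.Theses.FifoMatching.NNDivisionHard) ∧
    (GadgetSaturatedBudgetedLaw → Summit.ValiantsHypothesis.ValiantsHypothesis.Theses.FifoMatching.NNDivisionHard) :=
  ⟨Iff.rfl, fun hC => NNDivisionHard_ofC hC⟩

end Summit.ValiantsHypothesis.ValiantsHypothesis.Cruxes.NNDivisionHard.VirtualPassenger
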